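import Literature.Computability.Complexity.StackHarveySearch
import Literature.Computability.Cryptography.Harvey2021Search
import HarnessLib

/-!
# Harvey's Algorithm 2 on the stack machine, II: the scan, Step 4, the assembly, and its meaning

Literature / complexity toolkit, the sequel of `StackHarveySearch.lean` (split only for size; see
the overview there).  Contents:

* the specification of the scan of the sorted words (`keyOf`/`tagOf`/`payloadOf`, `recoverSpec`,
  `ScanSt`, `scanStep`, `scanRun`) and the recovery of Lemma 10 on the machine (`a2Recover`,
  **`runs_a2Recover`**);
* the scan (`a2ScanKey`, `a2ScanBody`, `a2Scan`, **`runs_a2Scan`**);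
* Step 4 (`a2Cnt`, `a2SixE`, `a2SixP`, `a2SixR`, `a2Six`, `a2Fin`, **`runs_a2Fin`**): the unmatched
  values, counted, padded with zeros to `2^e` values and handed to Algorithm 1 of `StackAlgOne.lean`
  with the shift `c = C = α^{J* m}` and `k = |enc(2^e + m)| + 1`;
* the assembly (`alg2`, `a2Out`, `alg2Cost`, **`runs_alg2`**);
* what Algorithm 2 proves (section `AlgTwoMath`): the LSD radix sort is stable on equal keys
  (`radixIter_pairwise`), so in the sorted tagged union every baby step precedes the giant steps of
  the same key and the one-pass scan finds every exact match (`matched_of_baby`); hence a value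
  handed to Step 4 is no baby-step value (`a2Res_acc_no_baby`, the precondition of Algorithm 1);
  **`a2Out_factor`** (soundness: with `ord_N(α) ≥ m` a reported factor is a proper divisor) and
  **`a2Out_complete`** (Harvey's Prop. 4.2: for `N = pq`, primes `p < q`, `r < p`, `N ≤ r p²`,
  `α` a unit with `ord_p(α) ≥ m`, a factor IS reported), the latter from the witness
  `Harvey2021Search.prop42_witness` (Lemma 12 + the congruence `v_{a₀,b₀,j₀} ≡ α^{i₀} (mod p)`),
  the arithmetic of the recovery (`recoverSpec_isSome`, Lemma 10) and the outcome lemmas of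
  Algorithm 1 (`alg1Out_clear`, `alg1Out_hit_resolved`, `alg1Out_exact`).

## References

* D. Harvey, *An exponent one-fifth algorithm for deterministic integer factorisation*,
  Math. Comp. 90 (2021) 2937–2950, §4, Algorithm 2 and Prop. 4.2 (arXiv:2010.05450, Algorithm 2,
  Prop. 15); Lemma 3.1 (arXiv Lemma 10) for the recovery; Lemma 3.3 (arXiv Lemma 12).
  [Harvey2021]
* M. Hittmeir, *A time-space tradeoff for Lehman's deterministic integer factorization method*,
  Math. Comp. 90 (2021) 1999–2010, arXiv:2006.16729 (the sort-and-match search). (Folklore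
  material, fully proved here.)
* D. E. Knuth, *The Art of Computer Programming*, Vol. 3, §5.2.5 (LSD radix sort is stable).
-/

namespace Literature.Computability.Complexity

open _root_.Computability SProg

namespace Com

variable {β : Type} [DecidableEq β] (h : HReg ↪ β)

section AlgTwoScanSpec

/-! #### Step 3: the scan of the sorted words — specification

The raw-word functions the machine computes: the key (first `nb` bits, as a number), the tag
bit, the payload, the decoded giant-step fields, Lemma 3.1's recovery attempt. -/

/-- The key of a word. [folklore] -/
def keyOf (nb : ℕ) (w : List Bool) : ℕ := bitsToNat (w.take nb)

/-- The tag of a word. [folklore] -/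
def tagOf (nb : ℕ) (w : List Bool) : Bool := (w.drop nb).headD false

/-- The payload of a word. [folklore] -/
def payloadOf (nb : ℕ) (w : List Bool) : List Bool := (w.drop nb).tail

/-- The fields `(a, b, j)` of a giant-step payload. [folklore] -/
def fieldsOf (pl : List Bool) : ℕ × ℕ × ℕ :=
  (bitsToNat (boolUnpair pl).1, bitsToNat (boolUnpair (boolUnpair pl).2).1, bitsToNat (boolUnpair (boolUnpair pl).2).2)

/-- A proper-divisor test on a gcd. [folklore] -/
def properOpt (N g : ℕ) : Option ℕ := if g = 1 then none else if g = N then none else some g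

/-- Lemma 3.1's recovery from a candidate `u = i + jm + ⌈√(4abN)⌉`: with `v = ⌊√(u² − 4abN)⌋`, try
`gcd((u ± v)/2, N)`. [cite: Harvey2021, Lemma 3.1] -/
def recoverSpec (N m i a b j : ℕ) : Option ℕ :=
  let x := 4 * a * b * N
  let u := i + j * m + ceilSqrt x
  if x ≤ u * u then
    let s := Nat.sqrt (u * u - x)
    (properOpt N (Nat.gcd ((u + s) / 2) N)).or (properOpt N (Nat.gcd ((u - s) / 2) N))
  else none

/-- The state of the scan: the last baby-step key and payload, whether one was seen, the factor
found, the unmatched giant-step values. [folklore] -/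
structure ScanSt where
  /-- last baby key (raw bits) -/ (cand : List Bool)
  /-- last baby payload -/ (beta : List Bool)
  /-- a baby step was seen -/ (hb : Bool)
  /-- the factor found -/ (found : Option ℕ)
  /-- the unmatched giant-step values -/ (acc : List ℕ)

/-- One word of the scan. [folklore] -/
def scanStep (N m nb : ℕ) (st : ScanSt) (w : List Bool) : ScanSt :=
  if tagOf nb w then
    let f := fieldsOf (payloadOf nb w)
    if st.hb ∧ keyOf nb w = bitsToNat st.cand then
      { st with found := st.found.or (recoverSpec N m (bitsToNat st.beta) f.1 f.2.1 f.2.2) }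
    else { st with acc := st.acc ++ [keyOf nb w] }
  else { st with cand := w.take nb, beta := payloadOf nb w, hb := true }

/-- The scan of a list of words. [folklore] -/
def scanRun (N m nb : ℕ) (st : ScanSt) (sw : List (List Bool)) : ScanSt := sw.foldl (scanStep N m nb) st

/-- The initial state. [folklore] -/
def ScanSt.init : ScanSt := ⟨[], [], false, none, []⟩

/-- `scanRun` on `sw ++ [w]`. [folklore] -/
theorem scanRun_append (N m nb : ℕ) (st : ScanSt) (sw : List (List Bool)) (w : List Bool) :
    scanRun N m nb st (sw ++ [w]) = scanStep N m nb (scanRun N m nb st sw) w := by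
  simp [scanRun, List.foldl_append]

/-- The registers of a scan state. [folklore] -/
def HSlots.scanRegs (u : HSlots) (st : ScanSt) : HSlots :=
  { u with sfcand := st.cand, sfbeta := st.beta, sfdivs := flag st.hb, a2p := encOpt st.found, a2q := flagOpt st.found, l4 := outRev (st.acc.map encodeNat),
           a2l2 := List.replicate st.acc.length true }

end AlgTwoScanSpec

section AlgTwoRecover

/-! #### Lemma 3.1 on the machine: recovering `p, q` from a candidate `u` -/

/-- `X3 := u = i + jm + ⌈√x⌉`, `X2 := u²`, `FL2 := [x ≤ u²]` (consuming `SQ1 = ⌈√x⌉`). [folklore] -/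
def a2RecU : NS β :=
  NS.ofList [.mul (h .X3) (h .A2J) (h .A2Y), .add (h .X4) (h .X3) (h .SFBETA), .clear (h .X3), .add (h .X3) (h .X4) (h .SQ1), .clear (h .X4), .clear (h .SQ1), .clear (h .X2),
    .mul (h .X2) (h .X3) (h .X3), .cmp (h .FL2) (h .X2) (h .SFE)]

/-- `X4 := u² − x` (consuming `X2`, `SFE`). [folklore] -/
def a2RecS : NS β := NS.ofList [.sub (h .X4) (h .X2) (h .SFE), .clear (h .X2), .clear (h .SFE)]

/-- The halves `X4 := (u+s)/2`, `X2 := (u−s)/2` from `X3 = u`, `SQ1 = s` (consumed, with `X4`). [folklore] -/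
def a2RecH : NS β :=
  NS.ofList [.add (h .X2) (h .X3) (h .SQ1), .sub (h .X5) (h .X3) (h .SQ1), .clear (h .X3), .clear (h .SQ1), .clear (h .X4), .const (h .X3) (encodeNat 2),
    .divMod (h .X4) (h .X6) (h .X2) (h .X3), .clear (h .X6), .clear (h .X2), .divMod (h .X2) (h .X6) (h .X5) (h .X3), .clear (h .X6), .clear (h .X5), .clear (h .X3)]

/-- The casework on a gcd `g` in `X3`: record it on `A2P`/`A2Q` unless `g ∈ {1, N}`. [folklore] -/
def a2RecCase : NS β :=
  NS.seq (NS.ofList [.const (h .X5) [true], .eq (h .FL2) (h .X3) (h .X5) (h .X6), .clear (h .X5)])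
    (NS.ite (h .FL2) NS.nop (NS.seq (NS.op (.eq (h .FL2) (h .X3) (h (.g (.f (.n (.v .MD))))) (h .X6)))
      (NS.ite (h .FL2) NS.nop (NS.ofList [.copy (h .X3) (h .A2P), .const (h .A2Q) [true]]))))

/-- `gcd(SRC, N)` and its casework. [folklore] -/
def a2RecG (SRC : HReg) : Com (EReg ⊕ β) := nGcd (h .X3) (h SRC) (h (.g (.f (.n (.v .MD))))) ;; ((a2RecCase h).com ;; ((NS.op (.clear (h .X3))) : NS β).com)

/-- The square-root branch of the recovery. [folklore] -/
def a2RecYes : Com (EReg ⊕ β) :=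
  ((a2RecS h).com ;; (isqrtAt h .X4 ;; (a2RecH h).com)) ;; (a2RecG h .X4 ;; (whenNot h .A2Q (a2RecG h .X2) ;; ((NS.ofList [.clear (h .X4), .clear (h .X2)] : NS β).com)))

/-- The recovery from the match of the baby step `i` (`SFBETA`) with the giant step `(a, b, j)` (`A2A`, `A2B`, `A2J`). [folklore] -/
def a2Recover : Com (EReg ⊕ β) :=
  a2PairA h ;; ((a2RecU h).com ;; Com.pop (Sum.inr (h .FL2)) (a2RecYes h) ((NS.ofList [.clear (h .X2), .clear (h .X3), .clear (h .SFE)] : NS β).com)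
    ((NS.ofList [.clear (h .X2), .clear (h .X3), .clear (h .SFE)] : NS β).com))

/-- Size facts of the recovery: everything is below `64N²`. [folklore] -/
theorem a2_len64 {N n : ℕ} (hN1 : 1 < N) (hn : 2 * (encodeNat N).length + 8 ≤ n) {y : ℕ} (hy : y ≤ 64 * N * N) : (encodeNat y).length ≤ n := by
  have hN0 : 0 < N := by omega
  have h1 : (encodeNat (2 * N)).length = (encodeNat N).length + 1 := by rw [encodeNat_two_mul _ hN0]; rfl
  have h2 : (encodeNat (2 * (2 * N))).length = (encodeNat (2 * N)).length + 1 := by rw [encodeNat_two_mul _ (by omega)]; rfl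
  have h3 : (encodeNat (2 * (2 * (2 * N)))).length = (encodeNat (2 * (2 * N))).length + 1 := by rw [encodeNat_two_mul _ (by omega)]; rfl
  have h4 := length_encodeNat_mul_le (2 * (2 * (2 * N))) (2 * (2 * (2 * N)))
  have h5 := Brick.length_encodeNat_mono (show y ≤ 2 * (2 * (2 * N)) * (2 * (2 * (2 * N))) by nlinarith)
  omega

/-- **The candidate `u`**, on abstract operands. [folklore] -/
theorem runs_a2RecU {N n i j m ce x : ℕ} (hN1 : 1 < N) (hn : 2 * (encodeNat N).length + 8 ≤ n) (T : Regs β) (u : HSlots)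
    (hiN : i ≤ N) (hjm : j * m ≤ N) (hjN : j ≤ N) (hmN : m ≤ N) (hce : ce ≤ 2 * N + 1) (hx : x ≤ 4 * N * N)
    (hsfbeta : u.sfbeta = encodeNat i) (ha2j : u.a2j = encodeNat j) (ha2y : u.a2y = encodeNat m) (hsq1 : u.sq1 = encodeNat ce) (hsfe : u.sfe = encodeNat x)
    {wx : List Bool} (hx2 : u.x2 = wx) (hwx : wx.length ≤ n) (hx3 : u.x3 = []) (hx4 : u.x4 = []) (hfl2 : u.fl2 = []) :
    Runs (a2RecU h).com (base (hSt h T u))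
      (base (hSt h T { u with x3 := encodeNat (i + j * m + ce), x2 := encodeNat ((i + j * m + ce) * (i + j * m + ce)), fl2 := flag (decide (x ≤ (i + j * m + ce) * (i + j * m + ce))), sq1 := [] }))
      (738 * (n + 1) ^ 3) := by
  have hN0 : 0 < N := by omega
  have hl := fun (y : ℕ) (hy : y ≤ 64 * N * N) => a2_len64 hN1 hn hy
  have hNN : N ≤ 64 * N * N := by nlinarith
  set uu := i + j * m + ce with huu
  have hu4 : uu ≤ 4 * N + 1 := by omega
  have huu2 : uu * uu ≤ 64 * N * N := by nlinarith
  have hli := hl i (hiN.trans hNN)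
  have hlj := hl j (hjN.trans hNN)
  have hlm := hl m (hmN.trans hNN)
  have hljm := hl (j * m) (hjm.trans hNN)
  have hljmi := hl (j * m + i) (by nlinarith)
  have hlce := hl ce (by nlinarith)
  have hlu := hl uu (by nlinarith)
  have hlu2 := hl (uu * uu) huu2
  have hlx := hl x (by nlinarith)
  have euu : j * m + i + ce = uu := by rw [huu]; ring
  refine NS.runs_of_eq (N := n) _ _ ?_ ?_ (by simp [a2RecU])
  · simp (config := { decide := true }) only [a2RecU, NS.ofList, NS.ok, NOp.ok, NS.eval, NOp.eval, hSt_X3, hSt_A2J, hSt_A2Y, hSt_X4, hSt_SFBETA, hSt_SQ1, hSt_X2, hSt_FL2, hSt_SFE,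
      update_hSt_X3, update_hSt_X4, update_hSt_SQ1, update_hSt_X2, ha2j, ha2y, hx3, hx4, hsfbeta, hsq1, hx2, hwx, hfl2, hsfe, euu, bitsToNat_encodeNat,
      List.length_nil, zero_le, and_self, hlj, hlm, hljm, hli, hljmi, hlce, hlu, hlu2, hlx]
  · simp [a2RecU, ha2j, ha2y, hx4, hsfbeta, hsq1, hx2, hfl2, hsfe, euu]

/-- **The square root and the halves**, on abstract operands. [folklore] -/
theorem runs_a2RecSH {N n uu x : ℕ} (hN1 : 1 < N) (hn : 2 * (encodeNat N).length + 8 ≤ n) (T : Regs β) (u : HSlots)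
    (hux : x ≤ uu * uu) (hu : uu ≤ 4 * N + 1)
    (hx3 : u.x3 = encodeNat uu) (hx2 : u.x2 = encodeNat (uu * uu)) (hsfe : u.sfe = encodeNat x)
    (hx4 : u.x4 = []) (hx5 : u.x5 = []) (hx6 : u.x6 = []) (hsq1 : u.sq1 = []) (hsq2 : u.sq2 = []) (hsq3 : u.sq3 = []) (hsq4 : u.sq4 = []) (hsq5 : u.sq5 = []) :
    Runs ((a2RecS h).com ;; (isqrtAt h .X4 ;; (a2RecH h).com)) (base (hSt h T u))
      (base (hSt h T { u with x3 := [], sfe := [], x4 := encodeNat ((uu + Nat.sqrt (uu * uu - x)) / 2), x2 := encodeNat ((uu - Nat.sqrt (uu * uu - x)) / 2) }))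
      (941 * (n + 1) ^ 3 + isqrtCost n) := by
  have hN0 : 0 < N := by omega
  have hl := fun (y : ℕ) (hy : y ≤ 64 * N * N) => a2_len64 hN1 hn hy
  have hNN : N ≤ 64 * N * N := by nlinarith
  have huu2 : uu * uu ≤ 64 * N * N := by nlinarith
  set d := uu * uu - x with hd0
  have hdle : d ≤ 64 * N * N := (Nat.sub_le _ _).trans huu2
  set sq := Nat.sqrt d with hsq0
  have hsqu : sq ≤ uu := by
    have := Nat.sqrt_le_sqrt (show d ≤ uu * uu from Nat.sub_le _ _); rwa [Nat.sqrt_eq] at this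
  have h4N : 4 * N + 1 ≤ 64 * N * N := by nlinarith
  have hlu := hl uu (by omega)
  have hlu2 := hl (uu * uu) huu2
  have hlx := hl x (hux.trans huu2)
  have hld := hl d hdle
  have h8N : 2 * (4 * N + 1) ≤ 64 * N * N := by nlinarith
  have hlsq := hl sq (by omega)
  have hlp := hl (uu + sq) (by omega)
  have hlm := hl (uu - sq) (by omega)
  have hlh1 := hl ((uu + sq) / 2) ((Nat.div_le_self _ _).trans (by omega))
  have hlh2 := hl ((uu - sq) / 2) ((Nat.div_le_self _ _).trans (by omega))
  have hlr1 := hl ((uu + sq) % 2) ((Nat.mod_lt _ (by omega)).le.trans (by omega))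
  have hlr2 := hl ((uu - sq) % 2) ((Nat.mod_lt _ (by omega)).le.trans (by omega))
  have e2 : encodeNat 2 = [false, true] := by simpa using encodeNat_two_pow 1
  have hl2 : (encodeNat 2).length ≤ n := by rw [e2]; simp; omega
  let u1 : HSlots := { u with x4 := encodeNat d, x2 := [], sfe := [] }
  have h1 : Runs (a2RecS h).com (base (hSt h T u)) (base (hSt h T u1)) (77 * (n + 1) ^ 3) := by
    refine NS.runs_of_eq (N := n) _ _ ?_ ?_ (by simp [a2RecS])
    · simp (config := { decide := true }) only [a2RecS, NS.ofList, NS.ok, NOp.ok, NS.eval, NOp.eval, hSt_X4, hSt_X2, hSt_SFE, update_hSt_X4, update_hSt_X2, hx4, hx2, hsfe,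
        bitsToNat_encodeNat, List.length_nil, zero_le, and_self, hlu2, hlx, hux]
    · simp [a2RecS, u1, hx2, hsfe, hd0]
  let u2 : HSlots := { u1 with sq1 := encodeNat sq }
  have h2 : Runs (isqrtAt h .X4) (base (hSt h T u1)) (base (hSt h T u2)) (isqrtCost n) :=
    runs_isqrtAt h (S := .X4) (by decide) hld T u1 (by simp [u1]) (by simp [u1, hsq1]) (by simp [u1, hsq2]) (by simp [u1, hsq3]) (by simp [u1, hsq4]) (by simp [u1, hsq5]) (by simp [u1, hx6])
  have h3 : Runs (a2RecH h).com (base (hSt h T u2)) (base (hSt h T { u with x3 := [], sfe := [], x4 := encodeNat ((uu + sq) / 2), x2 := encodeNat ((uu - sq) / 2) })) (864 * (n + 1) ^ 3) := by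
    refine NS.runs_of_eq (N := n) _ _ ?_ ?_ (by simp [a2RecH])
    · simp (config := { decide := true }) only [a2RecH, NS.ofList, NS.ok, NOp.ok, NS.eval, NOp.eval, hSt_X2, hSt_X3, hSt_SQ1, hSt_X5, hSt_X4, hSt_X6, update_hSt_X2, update_hSt_X5,
        update_hSt_X3, update_hSt_SQ1, update_hSt_X4, update_hSt_X6, u2, u1, hx3, hx5, hx6, bitsToNat_encodeNat, ne_eq, EmbeddingLike.apply_eq_iff_eq, List.length_nil, zero_le,
        and_self, hlu, hlsq, hsqu, hlp, hlm, hld, hl2, hlr1, hlr2, not_false_eq_true]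
    · simp [a2RecH, u2, u1, hx3, hx5, hx6, hsq1]
  exact (h1.seq (h2.seq h3)).of_eq rfl (by omega)

/-- The flags of a gcd's casework. [folklore] -/
theorem properOpt_cases (N g : ℕ) : (g = 1 ∧ properOpt N g = none) ∨ (g ≠ 1 ∧ g = N ∧ properOpt N g = none) ∨ (g ≠ 1 ∧ g ≠ N ∧ properOpt N g = some g) := by
  by_cases h1 : g = 1
  · left; simp [properOpt, h1]
  · by_cases h2 : g = N
    · have : N ≠ 1 := fun h => h1 (h2.trans h)
      right; left; exact ⟨h1, h2, by simp [properOpt, h2, this]⟩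
    · right; right; exact ⟨h1, h2, by simp [properOpt, h1, h2]⟩

/-- **A gcd and its casework**: `A2P`/`A2Q` record `properOpt N (gcd(y, N))`. [folklore] -/
theorem runs_a2RecG {N n y : ℕ} {SRC : HReg} (hS1 : SRC ≠ .X3)
    (hN1 : 1 < N) (hn : 2 * (encodeNat N).length + 8 ≤ n) (T : Regs β) (hI : DrvInv (rGH h) N T) (u : HSlots)
    (hy : y ≤ 64 * N * N) (hsrc : hSt h T u (h SRC) = encodeNat y) (hx3 : u.x3 = []) (hx5 : u.x5 = []) (hx6 : u.x6 = []) (hfl2 : u.fl2 = []) (ha2p : u.a2p = []) (ha2q : u.a2q = []) :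
    Runs (a2RecG h SRC) (base (hSt h T u)) (base (hSt h T { u with a2p := encOpt (properOpt N (Nat.gcd y N)), a2q := flagOpt (properOpt N (Nat.gcd y N)) })) (1265 * (n + 1) ^ 3) := by
  have hN0 : 0 < N := by omega
  obtain ⟨hMD, -, -, -, -, -, -, -, -, -, -, -, -, -, -, -, -, -⟩ := id hI
  have rdMD : ∀ u' : HSlots, hSt h T u' (h (.g (.f (.n (.v .MD))))) = encodeNat N := fun u' => by
    rw [hSt_gv h T u' (by decide) (by decide) (by decide) (by decide) (by decide) (by decide)]; exact hMD
  have hl := fun (z : ℕ) (hz : z ≤ 64 * N * N) => a2_len64 hN1 hn hz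
  have hNN : N ≤ 64 * N * N := by nlinarith
  have hlN := hl N hNN
  have hly := hl y hy
  set g := Nat.gcd y N with hg0
  have hgN : g ≤ N := Nat.gcd_le_right _ hN0
  have hlg := hl g (hgN.trans hNN)
  have hN1' : N ≠ 1 := by omega
  have hn1 : 1 ≤ n := by omega
  have hl1 : (encodeNat 1).length ≤ n := hl 1 (by nlinarith)
  have h1 : Runs (nGcd (h .X3) (h SRC) (h (.g (.f (.n (.v .MD)))))) (base (hSt h T u)) (base (hSt h T { u with x3 := encodeNat g })) (1000 * (n + 1) ^ 3) := by
    have g1 := runs_nGcd (h .X3) (h SRC) (h (.g (.f (.n (.v .MD))))) (hSt h T u) (x := y) (y := N) (n := n) hsrc (rdMD u) hly hlN (by simp [hx3])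
    refine g1.of_eq ?_ le_rfl
    rw [update_hSt_X3]
  have hsrc' : ∀ w : List Bool, hSt h T { u with x3 := w } (h SRC) = encodeNat y := fun w => by
    rw [← update_hSt_X3, Function.update_of_ne (hq_ne h hS1)]; exact hsrc
  let u2 : HSlots := { u with x3 := encodeNat g, a2p := encOpt (properOpt N g), a2q := flagOpt (properOpt N g) }
  have h2 : Runs (a2RecCase h).com (base (hSt h T { u with x3 := encodeNat g })) (base (hSt h T u2)) (262 * (n + 1) ^ 3) := by
    rcases properOpt_cases N g with ⟨hg1, hpo⟩ | ⟨hg1, hgN', hpo⟩ | ⟨hg1, hgN', hpo⟩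
    · refine NS.runs_of_eq (N := n) _ _ ?_ ?_ (by simp [a2RecCase])
      · simp (config := { decide := true }) only [a2RecCase, NS.ofList, NS.ok, NOp.ok, NS.eval, NOp.eval, hSt_X5, hSt_FL2, hSt_X3, hSt_X6, update_hSt_X5, update_hSt_FL2, hx5, hfl2, hx6,
          bitsToNat_encodeNat, bitsToNat_cons, bitsToNat_nil, Bool.toNat_true, hg1, ne_eq, EmbeddingLike.apply_eq_iff_eq, List.length_nil, List.length_cons, zero_le, and_self,
          not_false_eq_true, decide_true, flag_true, true_and, true_or, hn1, hl1]
      · have hpo1 : properOpt N 1 = none := by simp [properOpt]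
        simp [a2RecCase, u2, hx5, hfl2, hx6, hg1, hpo1, ha2p, ha2q, encOpt, flagOpt]
    · refine NS.runs_of_eq (N := n) _ _ ?_ ?_ (by simp [a2RecCase])
      · simp (config := { decide := true }) only [a2RecCase, NS.ofList, NS.ok, NOp.ok, NS.eval, NOp.eval, hSt_X5, hSt_FL2, hSt_X3, hSt_X6, update_hSt_X5, update_hSt_FL2, hx5, hfl2, hx6,
          rdMD, bitsToNat_encodeNat, bitsToNat_cons, bitsToNat_nil, Bool.toNat_true, hgN', hN1', ne_eq, EmbeddingLike.apply_eq_iff_eq, List.length_nil, List.length_cons, zero_le,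
          and_self, hlN, not_false_eq_true, decide_true, decide_false, flag_true, flag_false, true_and, true_or, or_true, hn1]
      · have hpoN : properOpt N N = none := by simp [properOpt, hN1']
        simp [a2RecCase, u2, hx5, hfl2, hx6, hgN', hN1', hpoN, rdMD, ha2p, ha2q, encOpt, flagOpt]
    · refine NS.runs_of_eq (N := n) _ _ ?_ ?_ (by simp [a2RecCase])
      · simp (config := { decide := true }) only [a2RecCase, NS.ofList, NS.ok, NOp.ok, NS.eval, NOp.eval, hSt_X5, hSt_FL2, hSt_X3, hSt_X6, hSt_A2P, hSt_A2Q, update_hSt_X5, update_hSt_FL2,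
          update_hSt_A2P, hx5, hfl2, hx6, ha2p, ha2q, rdMD, bitsToNat_encodeNat, bitsToNat_cons, bitsToNat_nil, Bool.toNat_true, hg1, hgN', ne_eq, EmbeddingLike.apply_eq_iff_eq, List.length_nil,
          List.length_cons, zero_le, and_self, hlg, hlN, not_false_eq_true, decide_false, flag_false, or_true, and_true, hn1]
      · simp [a2RecCase, u2, hx5, hfl2, hx6, hg1, hgN', hpo, rdMD, ha2p, ha2q, encOpt, flagOpt]
  have h3 : Runs ((NS.op (.clear (h .X3)) : NS β).com) (base (hSt h T u2)) (base (hSt h T { u with a2p := encOpt (properOpt N g), a2q := flagOpt (properOpt N g) })) (3 * (n + 1) ^ 3) :=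
    NS.runs_of_eq (N := n) _ _ (by simp only [NS.ok, NOp.ok, hSt_X3, u2]; exact hlg) (by simp [u2, hx3]) (by simp)
  exact (h1.seq (h2.seq h3)).of_eq rfl (by omega)

/-- Cost of the recovery. [folklore] -/
def a2RecoverCost (n : ℕ) : ℕ := 5383 * (n + 1) ^ 3 + 2 * isqrtCost n + 20

/-- **The square-root branch**, on abstract operands `u`, `x ≤ u²`. [folklore] -/
theorem runs_a2RecYes {N n uu x : ℕ} (hN1 : 1 < N) (hn : 2 * (encodeNat N).length + 8 ≤ n) (T : Regs β) (hI : DrvInv (rGH h) N T) (u : HSlots)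
    (hux : x ≤ uu * uu) (hu : uu ≤ 4 * N + 1)
    (hx3 : u.x3 = encodeNat uu) (hx2 : u.x2 = encodeNat (uu * uu)) (hsfe : u.sfe = encodeNat x)
    (hx4 : u.x4 = []) (hx5 : u.x5 = []) (hx6 : u.x6 = []) (hfl2 : u.fl2 = []) (hsq1 : u.sq1 = []) (hsq2 : u.sq2 = []) (hsq3 : u.sq3 = []) (hsq4 : u.sq4 = []) (hsq5 : u.sq5 = [])
    (ha2p : u.a2p = []) (ha2q : u.a2q = []) :
    let o := (properOpt N (Nat.gcd ((uu + Nat.sqrt (uu * uu - x)) / 2) N)).or (properOpt N (Nat.gcd ((uu - Nat.sqrt (uu * uu - x)) / 2) N))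
    Runs (a2RecYes h) (base (hSt h T u)) (base (hSt h T { u with x3 := [], x2 := [], sfe := [], a2p := encOpt o, a2q := flagOpt o })) (3477 * (n + 1) ^ 3 + isqrtCost n + 2) := by
  intro o
  have hN0 : 0 < N := by omega
  set c := (n + 1) ^ 3 with hc3
  have hl := fun (y : ℕ) (hy : y ≤ 64 * N * N) => a2_len64 hN1 hn hy
  have hc1 : 1 ≤ c := Nat.one_le_pow _ _ (by omega)
  have g1 := runs_a2RecSH h hN1 hn T u hux hu hx3 hx2 hsfe hx4 hx5 hx6 hsq1 hsq2 hsq3 hsq4 hsq5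
  set sq := Nat.sqrt (uu * uu - x) with hsq0
  have hsqu : sq ≤ uu := by have := Nat.sqrt_le_sqrt (show uu * uu - x ≤ uu * uu from Nat.sub_le _ _); rwa [Nat.sqrt_eq] at this
  have h8N : 2 * (4 * N + 1) ≤ 64 * N * N := by nlinarith
  have hh1 : (uu + sq) / 2 ≤ 64 * N * N := (Nat.div_le_self _ _).trans (by omega)
  have hh2 : (uu - sq) / 2 ≤ 64 * N * N := (Nat.div_le_self _ _).trans (by omega)
  let u3 : HSlots := { u with x3 := [], sfe := [], x4 := encodeNat ((uu + sq) / 2), x2 := encodeNat ((uu - sq) / 2) }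
  set o1 := properOpt N (Nat.gcd ((uu + sq) / 2) N) with ho1
  set o2 := properOpt N (Nat.gcd ((uu - sq) / 2) N) with ho2
  have g2 := runs_a2RecG h (SRC := .X4) (by decide) hN1 hn T hI u3 hh1 (by simp [u3]) (by simp [u3]) (by simp [u3, hx5]) (by simp [u3, hx6]) (by simp [u3, hfl2]) (by simp [u3, ha2p])
    (by simp [u3, ha2q])
  rw [← ho1] at g2
  let u4 : HSlots := { u3 with a2p := encOpt o1, a2q := flagOpt o1 }
  have g3 : Runs (whenNot h .A2Q (a2RecG h .X2)) (base (hSt h T u4)) (base (hSt h T { u3 with a2p := encOpt (o1.or o2), a2q := flagOpt (o1.or o2) })) (1265 * c + 2) := by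
    cases ho : o1 with
    | some g =>
      refine (runs_whenNot_true h _ (hSt h T u4) (by simp [u4, ho, flagOpt])).of_eq (by simp [u4, ho]) (by omega)
    | none =>
      have g' := runs_a2RecG h (SRC := .X2) (by decide) hN1 hn T hI u4 hh2 (by simp [u4, u3]) (by simp [u4, u3]) (by simp [u4, u3, hx5]) (by simp [u4, u3, hx6]) (by simp [u4, u3, hfl2])
        (by simp [u4, ho, encOpt]) (by simp [u4, ho, flagOpt])
      rw [← ho2] at g'
      refine (runs_whenNot_nil h (hSt h T u4) (by simp [u4, ho, flagOpt]) g').of_eq ?_ le_rfl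
      simp [u4, Option.none_or]
  have g4 : Runs ((NS.ofList [.clear (h .X4), .clear (h .X2)] : NS β).com) (base (hSt h T { u3 with a2p := encOpt (o1.or o2), a2q := flagOpt (o1.or o2) }))
      (base (hSt h T { u with x3 := [], x2 := [], sfe := [], a2p := encOpt o, a2q := flagOpt o })) (6 * c) := by
    refine NS.runs_of_eq (N := n) _ _ ?_ ?_ (by simp [hc3])
    · simp only [NS.ofList, NS.ok, NOp.ok, NS.eval, NOp.eval, hSt_X4, hSt_X2, update_hSt_X4, u3]
      exact ⟨hl _ hh1, hl _ hh2, trivial⟩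
    · simp [u3, hx4, o, ← ho1, ← ho2, ← hsq0]
  refine (g1.seq (g2.seq (g3.seq g4))).of_eq rfl ?_
  simp only [← hc3]; omega

/-- **Lemma 3.1 on the machine**: from the baby step `i` (`SFBETA`) and the giant step `(a, b, j)`
(`A2A`, `A2B`, `A2J`), `A2P`/`A2Q` record `recoverSpec N m i a b j`. [cite: Harvey2021, Lemma 3.1] -/
theorem runs_a2Recover {N n i a b j m r : ℕ} (hN1 : 1 < N) (hn : 2 * (encodeNat N).length + 8 ≤ n) (T : Regs β) (hI : DrvInv (rGH h) N T) (u : HSlots)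
    (ha1 : 1 ≤ a) (hb1 : 1 ≤ b) (habr : a * b ≤ r) (hrN : r ≤ N) (hiN : i ≤ N) (hjm : j * m ≤ N) (hjN : j ≤ N) (hmN : m ≤ N)
    (hsfbeta : u.sfbeta = encodeNat i) (ha2a : u.a2a = encodeNat a) (ha2b : u.a2b = encodeNat b) (ha2j : u.a2j = encodeNat j) (ha2y : u.a2y = encodeNat m)
    (hx2 : u.x2 = []) (hx3 : u.x3 = []) (hx4 : u.x4 = []) (hx5 : u.x5 = []) (hx6 : u.x6 = []) (hsfe : u.sfe = []) (hfl1 : u.fl1 = []) (hfl2 : u.fl2 = [])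
    (hsq1 : u.sq1 = []) (hsq2 : u.sq2 = []) (hsq3 : u.sq3 = []) (hsq4 : u.sq4 = []) (hsq5 : u.sq5 = []) (ha2p : u.a2p = []) (ha2q : u.a2q = []) :
    Runs (a2Recover h) (base (hSt h T u)) (base (hSt h T { u with a2p := encOpt (recoverSpec N m i a b j), a2q := flagOpt (recoverSpec N m i a b j) })) (a2RecoverCost n) := by
  have hN0 : 0 < N := by omega
  set c := (n + 1) ^ 3 with hc3
  have hl := fun (y : ℕ) (hy : y ≤ 64 * N * N) => a2_len64 hN1 hn hy
  have habN : a * b ≤ N := habr.trans hrN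
  have hlab := hl (a * b) (by nlinarith)
  generalize hx0 : 4 * a * b * N = x
  have hxle : x ≤ 4 * N * N := by rw [← hx0]; nlinarith
  have hce2 : ceilSqrt x ≤ 2 * N + 1 := ceilSqrt_le_two_mul hxle
  generalize hce0 : ceilSqrt x = ce at hce2
  generalize huu0 : i + j * m + ce = uu
  have hu4 : uu ≤ 4 * N + 1 := by omega
  have hlu := hl uu (by nlinarith)
  have hlu2 := hl (uu * uu) (by nlinarith)
  have hlx := hl x (by nlinarith)
  have hsp : recoverSpec N m i a b j = if x ≤ uu * uu then
      (properOpt N (Nat.gcd ((uu + Nat.sqrt (uu * uu - x)) / 2) N)).or (properOpt N (Nat.gcd ((uu - Nat.sqrt (uu * uu - x)) / 2) N)) else none := by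
    simp only [recoverSpec, hx0, hce0, huu0]
  have h1 := runs_a2PairA h hN1 hn T hI u ha1 hb1 habr hrN ha2a ha2b hx2 hx3 hx4 hsfe hfl1 hsq1 hsq2 hsq3 hsq4 hsq5 hx6
  rw [hx0, hce0] at h1
  let u1 : HSlots := { u with x2 := encodeNat (a * b), sfe := encodeNat x, sq1 := encodeNat ce }
  have h2 := runs_a2RecU h (i := i) (j := j) (m := m) (ce := ce) (x := x) hN1 hn T u1 hiN hjm hjN hmN hce2 hxle (by simp [u1, hsfbeta]) (by simp [u1, ha2j]) (by simp [u1, ha2y])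
    (by simp [u1]) (by simp [u1]) (wx := encodeNat (a * b)) (by simp [u1]) hlab (by simp [u1, hx3]) (by simp [u1, hx4]) (by simp [u1, hfl2])
  rw [huu0] at h2
  let u2 : HSlots := { u1 with x3 := encodeNat uu, x2 := encodeNat (uu * uu), fl2 := flag (decide (x ≤ uu * uu)), sq1 := [] }
  by_cases hux : x ≤ uu * uu
  · rw [if_pos hux] at hsp
    have hfl : hSt h T u2 (h .FL2) = true :: [] := by simp [u2, hux]
    have gy := runs_a2RecYes h (uu := uu) (x := x) hN1 hn T hI { u2 with fl2 := [] } hux hu4 (by simp [u2]) (by simp [u2]) (by simp [u2, u1]) (by simp [u2, u1, hx4]) (by simp [u2, u1, hx5])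
      (by simp [u2, u1, hx6]) (by simp) (by simp [u2]) (by simp [u2, u1, hsq2]) (by simp [u2, u1, hsq3]) (by simp [u2, u1, hsq4]) (by simp [u2, u1, hsq5]) (by simp [u2, u1, ha2p])
      (by simp [u2, u1, ha2q])
    have gp := Runs.opop_true (k := h .FL2) (ct := a2RecYes h) ((NS.ofList [.clear (h .X2), .clear (h .X3), .clear (h .SFE)] : NS β).com)
      ((NS.ofList [.clear (h .X2), .clear (h .X3), .clear (h .SFE)] : NS β).com) (T := hSt h T u2) (w := []) hfl (by rw [update_hSt_FL2]; exact gy)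
    refine (h1.seq (h2.seq gp)).of_eq ?_ ?_
    · simp [u2, u1, hsp, hx3, hx2, hsfe, hsq1, hfl2]
    · simp only [a2RecoverCost, ← hc3]; omega
  · rw [if_neg hux] at hsp
    have hfl : hSt h T u2 (h .FL2) = [] := by simp [u2, hux]
    have gn : Runs ((NS.ofList [.clear (h .X2), .clear (h .X3), .clear (h .SFE)] : NS β).com) (base (hSt h T u2))
        (base (hSt h T { u with a2p := encOpt (recoverSpec N m i a b j), a2q := flagOpt (recoverSpec N m i a b j) })) (9 * c) := by
      refine NS.runs_of_eq (N := n) _ _ ?_ ?_ (by simp [hc3])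
      · simp only [NS.ofList, NS.ok, NOp.ok, NS.eval, NOp.eval, hSt_X2, hSt_X3, hSt_SFE, update_hSt_X2, update_hSt_X3, u2, u1]
        exact ⟨hlu2, hlu, hlx, trivial⟩
      · simp [u2, u1, hx2, hx3, hsfe, hsq1, hsp, hux, ha2p, ha2q, hfl2, encOpt, flagOpt]
    have gp := Runs.opop_nil (k := h .FL2) (a2RecYes h) ((NS.ofList [.clear (h .X2), .clear (h .X3), .clear (h .SFE)] : NS β).com) (T := hSt h T u2) hfl gn
    refine (h1.seq (h2.seq gp)).of_eq rfl ?_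
    simp only [a2RecoverCost, ← hc3]; omega

end AlgTwoRecover

section AlgTwoScan

/-! #### Step 3: the scan of the sorted words on the machine -/

/-- Reading one word onto `A2V` and splitting it: key bits onto `SFE`, tag bit onto `FL1`, payload left on `A2V`. [folklore] -/
def a2ScanKey : Com (EReg ⊕ β) :=
  readItemTo (Sum.inr (h .RX1)) (Sum.inr (h .A2V)) (Sum.inr (h (.g (.f (.n (.v .W)))))) (Sum.inr (h (.g (.f (.n (.v .TT)))))) ;;
  (((NS.op (.copy (h .A2U) (h .U2))) : NS β).com ;; (countLoop (Sum.inr (h .U2)) ((NOp.popTo (h .A2V) (h .SFK)).com) ;;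
  (pour (Sum.inr (h .SFK)) (Sum.inr (h .SFE)) ;; ((NOp.popTo (h .A2V) (h .FL1)).com))))

/-- Cost of the split of a word of length `≤ L`. [folklore] -/
def a2ScanKeyCost (n nb L : ℕ) : ℕ := 11 * L + 9 + 13 * (n + 1) ^ 3 + (nb * (3 + 2) + 1) + (3 * nb + 1) + 3

/-- **Reading and splitting one word.** [folklore] -/
theorem runs_a2ScanKey {N n nb L : ℕ} (hn : 2 * (encodeNat N).length + 8 ≤ n) (hnb : (encodeNat N).length = nb) (T : Regs β) (hI : DrvInv (rGH h) N T) (u : HSlots)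
    (w : List Bool) (rest : List (List Bool)) (hw : nb ≤ w.length) (hwL : w.length ≤ L)
    (hrx1 : u.rx1 = encList (w :: rest)) (ha2u : u.a2u = List.replicate nb true) (ha2v : u.a2v = []) (hsfk : u.sfk = []) (hsfe : u.sfe = []) (hfl1 : u.fl1 = []) (hu2 : u.u2 = []) :
    Runs (a2ScanKey h) (base (hSt h T u)) (base (hSt h T { u with rx1 := encList rest, sfe := w.take nb, fl1 := [tagOf nb w], a2v := payloadOf nb w })) (a2ScanKeyCost n nb L) := by
  have hhq : ∀ {i j : HReg}, i ≠ j → h i ≠ h j := fun hij => hq_ne h hij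
  obtain ⟨-, -, -, -, -, -, hW, hTT, -, -, -, -, -, -, -, -, -, -⟩ := id hI
  have rdW : ∀ u' : HSlots, hSt h T u' (h (.g (.f (.n (.v .W))))) = [] := fun u' => by
    rw [hSt_gv h T u' (by decide) (by decide) (by decide) (by decide) (by decide) (by decide)]; exact hW
  have rdTT : ∀ u' : HSlots, hSt h T u' (h (.g (.f (.n (.v .TT))))) = [] := fun u' => by
    rw [hSt_gv h T u' (by decide) (by decide) (by decide) (by decide) (by decide) (by decide)]; exact hTT
  have hnbn : nb ≤ n := by omega
  let u1 : HSlots := { u with rx1 := encList rest, a2v := w }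
  have h1 : Runs (readItemTo (Sum.inr (h .RX1)) (Sum.inr (h .A2V)) (Sum.inr (h (.g (.f (.n (.v .W)))))) (Sum.inr (h (.g (.f (.n (.v .TT))))))) (base (hSt h T u)) (base (hSt h T u1)) (11 * L + 9) := by
    refine (runs_readItemTo (by simp [hhq]) (by simp [hhq]) (by simp [hhq]) (by simp [hhq]) (by simp [hhq]) w (encList rest)
      (base (hSt h T u)) (by simp [hrx1, encList_cons_eq_dbl]) (by simp [rdW]) (by simp [rdTT])).of_eq ?_ (by omega)
    simp [u1, ha2v]
  let u2 : HSlots := { u1 with u2 := List.replicate nb true }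
  have h2 : Runs ((NS.op (.copy (h .A2U) (h .U2)) : NS β).com) (base (hSt h T u1)) (base (hSt h T u2)) (13 * (n + 1) ^ 3) := by
    refine NS.runs_of_eq (N := n) _ _ ?_ (by simp [u1, u2, ha2u, hu2]) (by simp)
    simp (config := { decide := true }) only [NS.ok, NOp.ok, hSt_A2U, u1, ha2u, List.length_replicate, ne_eq, EmbeddingLike.apply_eq_iff_eq, not_false_eq_true, true_and]; exact hnbn
  let st : ℕ → HSlots := fun i => { u1 with u2 := List.replicate i true, a2v := w.drop (nb - i), sfk := (w.take (nb - i)).reverse }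
  have hst : u2 = st nb := by simp [u2, u1, st, hsfk]
  have hL := runs_countLoop (U := (Sum.inr (h .U2) : EReg ⊕ β)) (body := (NOp.popTo (h .A2V) (h .SFK)).com) (fun i R => i ≤ nb ∧ R = base (hSt h T (st i))) 3
    (by
      rintro i R ⟨hi, rfl⟩ -
      have hupd : Function.update (base (hSt h T (st (i + 1)))) (Sum.inr (h .U2)) (List.replicate i true) = base (hSt h T { st (i + 1) with u2 := List.replicate i true }) := by simp [st]
      rw [hupd]
      refine ⟨_, (NOp.runs_popTo (hhq (by decide)) (hSt h T { st (i + 1) with u2 := List.replicate i true })).of_eq ?_ le_rfl, by simp [st], by omega, rfl⟩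
      have hlt : nb - (i + 1) < w.length := by omega
      have e1 : w.drop (nb - (i + 1)) = w[nb - (i + 1)] :: w.drop (nb - i) := by
        rw [show nb - i = nb - (i + 1) + 1 by omega]; exact (List.drop_eq_getElem_cons hlt)
      have e3 : (w.take (nb - i)).reverse = w[nb - (i + 1)] :: (w.take (nb - (i + 1))).reverse := by
        rw [show nb - i = nb - (i + 1) + 1 by omega, List.take_add_one, List.getElem?_eq_getElem hlt]; simp
      simp only [NOp.eval, hSt_A2V, hSt_SFK, update_hSt_A2V, update_hSt_SFK, st, e1, e3, List.headD_cons, List.tail_cons])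
    nb (base (hSt h T (st nb))) ⟨le_rfl, rfl⟩ (by simp [st])
  obtain ⟨R', hR, -, -, rfl⟩ := hL
  rw [← hst] at hR
  let u3 : HSlots := { st 0 with sfk := [], sfe := w.take nb }
  have h3 : Runs (pour (Sum.inr (h .SFK)) (Sum.inr (h .SFE))) (base (hSt h T (st 0))) (base (hSt h T u3)) (3 * nb + 1) := by
    refine (runs_opour (a := h .SFK) (b := h .SFE) (hhq (by decide)) (hSt h T (st 0))).of_eq ?_ ?_
    · simp [st, u3, u1, hsfe]
    · simp only [hSt_SFK, st, Nat.sub_zero, List.length_reverse, List.length_take]; omega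
  have h4 : Runs ((NOp.popTo (h .A2V) (h .FL1)).com) (base (hSt h T u3)) (base (hSt h T { u with rx1 := encList rest, sfe := w.take nb, fl1 := [tagOf nb w], a2v := payloadOf nb w })) 3 := by
    refine (NOp.runs_popTo (hhq (by decide)) (hSt h T u3)).of_eq ?_ le_rfl
    simp [u3, st, u1, NOp.eval, hfl1, hu2, hsfk, tagOf, payloadOf]
  refine (h1.seq (h2.seq (hR.seq (h3.seq h4)))).of_eq rfl ?_
  simp only [a2ScanKeyCost]; omega

/-- The baby-step branch: remember the key and the payload, raise `SFDIVS`. [folklore] -/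
def a2BabyBr : NS β :=
  NS.ofList [.clear (h .SFCAND), .move (h .SFE) (h .SFCAND), .clear (h .SFBETA), .move (h .A2V) (h .SFBETA), .const (h .SFDIVS) [true]]

/-- The giant-step decoding and the match test: `X3 := [match]`. [folklore] -/
def a2GiantPre : NS β :=
  NS.seq (NS.ofList [.unpair (h .A2V) (h .A2A) (h .X6), .unpair (h .X6) (h .A2B) (h .A2J), .eq (h .FL2) (h .SFE) (h .SFCAND) (h .X4)])
    (NS.ite (h .FL2) (NS.op (.copy (h .SFDIVS) (h .X3))) NS.nop)

/-- A matched giant step: the recovery (unless a factor is known), clean-up. [folklore] -/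
def a2MatchedBr : Com (EReg ⊕ β) :=
  ((NS.op (.clear (h .SFE))) : NS β).com ;; (whenNot h .A2Q (a2Recover h) ;; ((NS.ofList [.clear (h .A2A), .clear (h .A2B), .clear (h .A2J)] : NS β).com))

/-- An unmatched giant step: its value joins the list for Algorithm 1. [folklore] -/
def a2UnmatchedBr : Com (EReg ⊕ β) :=
  ((NS.op (.nrm (h .SFE))) : NS β).com ;; (emit (Sum.inr (h .SFE)) (Sum.inr (h .L4)) ;; (push (Sum.inr (h .A2L2)) true ;;
    ((NS.ofList [.clear (h .A2A), .clear (h .A2B), .clear (h .A2J)] : NS β).com)))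

/-- The giant-step branch. [folklore] -/
def a2GiantBr : Com (EReg ⊕ β) := (a2GiantPre h).com ;; Com.pop (Sum.inr (h .X3)) (a2MatchedBr h) (a2UnmatchedBr h) (a2UnmatchedBr h)

/-- One word of the scan. [folklore] -/
def a2ScanBody : Com (EReg ⊕ β) := a2ScanKey h ;; Com.pop (Sum.inr (h .FL1)) (a2GiantBr h) (a2BabyBr h).com (a2BabyBr h).com

/-- The words the scan meets: baby steps `(v, i)`, `i < m`, and giant steps `(v, a, b, j)` from the pairs. [folklore] -/
def GoodWord (N m r nb : ℕ) (w : List Bool) : Prop :=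
  (∃ v i, v < N ∧ i < m ∧ w = mkWord nb v false (encodeNat i)) ∨
  (∃ v a b j, v < N ∧ 1 ≤ a ∧ 1 ≤ b ∧ a * b ≤ r ∧ j * m ≤ N ∧ j ≤ N ∧ w = mkWord nb v true (gPayload a b j))

/-- The scan states the machine meets. [folklore] -/
def GoodSt (N nb : ℕ) (st : ScanSt) : Prop := (∃ i, i ≤ N ∧ st.beta = encodeNat i) ∧ st.cand.length ≤ nb ∧ (∀ v ∈ st.acc, v < N)

/-- Splitting a word. [folklore] -/
theorem mkWord_split {nb v : ℕ} (hv : (encodeNat v).length ≤ nb) (tag : Bool) (pl : List Bool) :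
    (mkWord nb v tag pl).take nb = encodeNat v ++ List.replicate (nb - (encodeNat v).length) false ∧ tagOf nb (mkWord nb v tag pl) = tag ∧ payloadOf nb (mkWord nb v tag pl) = pl ∧
    nb ≤ (mkWord nb v tag pl).length ∧ keyOf nb (mkWord nb v tag pl) = v := by
  have hlen : (encodeNat v ++ List.replicate (nb - (encodeNat v).length) false).length = nb := by simp; omega
  have htake : (mkWord nb v tag pl).take nb = encodeNat v ++ List.replicate (nb - (encodeNat v).length) false := by rw [mkWord, List.take_left' hlen]
  have hdrop : (mkWord nb v tag pl).drop nb = tag :: pl := by rw [mkWord, List.drop_left' hlen]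
  refine ⟨htake, by simp [tagOf, hdrop], by simp [payloadOf, hdrop], by simp [mkWord]; omega, ?_⟩
  rw [keyOf, htake, bitsToNat_append, bitsToNat_replicate_false, mul_zero, add_zero, bitsToNat_encodeNat]

/-- The fields of a giant-step payload. [folklore] -/
theorem fieldsOf_gPayload (a b j : ℕ) : fieldsOf (gPayload a b j) = (a, b, j) := by
  simp [fieldsOf, gPayload, boolUnpair_boolPair, bitsToNat_encodeNat]

/-- **The baby-step branch.** [folklore] -/
theorem runs_a2BabyBr {n : ℕ} (T : Regs β) (v : HSlots) {key pl : List Bool} (hsfe : v.sfe = key) (hkey : key.length ≤ n) (ha2v : v.a2v = pl) (hpl : pl.length ≤ n)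
    (hcand : v.sfcand.length ≤ n) (hbeta : v.sfbeta.length ≤ n) (hdivs : v.sfdivs.length ≤ n) (hn1 : 1 ≤ n) :
    Runs (a2BabyBr h).com (base (hSt h T v)) (base (hSt h T { v with sfcand := key, sfe := [], sfbeta := pl, a2v := [], sfdivs := [true] })) (26 * (n + 1) ^ 3) := by
  refine NS.runs_of_eq (N := n) _ _ ?_ ?_ (by simp [a2BabyBr])
  · simp (config := { decide := true }) only [a2BabyBr, NS.ofList, NS.ok, NOp.ok, NS.eval, NOp.eval, hSt_SFCAND, hSt_SFE, hSt_SFBETA, hSt_A2V, hSt_SFDIVS, update_hSt_SFCAND, update_hSt_SFE,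
      update_hSt_SFBETA, update_hSt_A2V, hsfe, ha2v, ne_eq, EmbeddingLike.apply_eq_iff_eq, List.length_nil, List.length_cons, and_self, hkey, hpl, hcand, hbeta, hdivs, hn1,
      not_false_eq_true]
  · simp [a2BabyBr, hsfe, ha2v]

/-- **The giant-step decoding and match test.** [folklore] -/
theorem runs_a2GiantPre {N n a b j r : ℕ} (hn : 2 * (encodeNat N).length + 8 ≤ n) (T : Regs β) (v : HSlots) {key cand : List Bool} {hb : Bool}
    (ha1 : 1 ≤ a) (hb1 : 1 ≤ b) (habr : a * b ≤ r) (hrN : r ≤ N) (hjN : j ≤ N) (hnr : 4 * (encodeNat r).length + (encodeNat N).length + 4 ≤ n)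
    (ha2v : v.a2v = gPayload a b j) (hsfe : v.sfe = key) (hkey : key.length ≤ n) (hsfcand : v.sfcand = cand) (hcand : cand.length ≤ n) (hsfdivs : v.sfdivs = flag hb)
    (hx3 : v.x3 = []) (hx4 : v.x4 = []) (hx6 : v.x6 = []) (hfl2 : v.fl2 = []) (ha2a : v.a2a = []) (ha2b : v.a2b = []) (ha2j : v.a2j = []) :
    Runs (a2GiantPre h).com (base (hSt h T v))
      (base (hSt h T { v with a2a := encodeNat a, a2b := encodeNat b, a2j := encodeNat j, a2v := [], x3 := (if bitsToNat key = bitsToNat cand then flag hb else []) })) (164 * (n + 1) ^ 3) := by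
  have hlN : (encodeNat N).length ≤ n := by omega
  have habN : a * b ≤ N := habr.trans hrN
  have hla' : (encodeNat a).length ≤ (encodeNat r).length := Brick.length_encodeNat_mono (le_trans (Nat.le_mul_of_pos_right _ hb1) habr)
  have hlb' : (encodeNat b).length ≤ (encodeNat r).length := Brick.length_encodeNat_mono (le_trans (Nat.le_mul_of_pos_left _ ha1) habr)
  have hlj' : (encodeNat j).length ≤ (encodeNat N).length := Brick.length_encodeNat_mono hjN
  have hlp2 : (boolPair (encodeNat b) (encodeNat j)).length ≤ n := by rw [length_boolPair]; omega
  have hlpl : (boolPair (encodeNat a) (boolPair (encodeNat b) (encodeNat j))).length ≤ n := by simp only [length_boolPair]; omega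
  have hb2 : (flag hb).length ≤ n := by cases hb <;> simp [flag]; omega
  by_cases hm : bitsToNat key = bitsToNat cand
  · refine NS.runs_of_eq (N := n) _ _ ?_ ?_ (by simp [a2GiantPre])
    · simp (config := { decide := true }) only [a2GiantPre, NS.ofList, NS.ok, NOp.ok, NS.eval, NOp.eval, hSt_A2V, hSt_A2A, hSt_X6, hSt_A2B, hSt_A2J, hSt_FL2, hSt_SFE, hSt_SFCAND, hSt_X4,
        hSt_SFDIVS, update_hSt_A2V, update_hSt_A2A, update_hSt_X6, update_hSt_A2B, update_hSt_A2J, update_hSt_FL2, ha2v, hsfe, hsfcand, hsfdivs, hx3, hx4, hx6, hfl2, ha2a,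
        ha2b, ha2j, gPayload, boolUnpair_boolPair, hm, ne_eq, EmbeddingLike.apply_eq_iff_eq, and_self, hkey, hcand, hlpl, hlp2, hb2, not_false_eq_true, decide_true,
        flag_true, and_true, true_or]
    · simp [a2GiantPre, ha2v, hsfe, hsfcand, hsfdivs, hx3, hx4, hx6, hfl2, ha2a, ha2b, ha2j, gPayload, boolUnpair_boolPair, hm]
  · refine NS.runs_of_eq (N := n) _ _ ?_ ?_ (by simp [a2GiantPre])
    · simp (config := { decide := true }) only [a2GiantPre, NS.ofList, NS.ok, NOp.ok, NS.eval, NOp.eval, hSt_A2V, hSt_A2A, hSt_X6, hSt_A2B, hSt_A2J, hSt_FL2, hSt_SFE, hSt_SFCAND, hSt_X4,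
        hSt_SFDIVS, update_hSt_A2V, update_hSt_A2A, update_hSt_X6, update_hSt_A2B, update_hSt_A2J, update_hSt_FL2, ha2v, hsfe, hsfcand, hsfdivs, hx3, hx4, hx6, hfl2, ha2a,
        ha2b, ha2j, gPayload, boolUnpair_boolPair, hm, ne_eq, EmbeddingLike.apply_eq_iff_eq, and_self, hkey, hcand, hlpl, hlp2, hb2, not_false_eq_true, decide_false,
        flag_false, and_true, or_true]
    · simp [a2GiantPre, ha2v, hsfe, hsfcand, hsfdivs, hx3, hx4, hx6, hfl2, ha2a, ha2b, ha2j, gPayload, boolUnpair_boolPair, hm]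

/-- **A matched giant step**: the recovery joins `found` (first hit kept). [folklore] -/
theorem runs_a2MatchedBr {N n i a b j m r : ℕ} (hN1 : 1 < N) (hn : 2 * (encodeNat N).length + 8 ≤ n) (T : Regs β) (hI : DrvInv (rGH h) N T) (v : HSlots) (fnd : Option ℕ)
    (ha1 : 1 ≤ a) (hb1 : 1 ≤ b) (habr : a * b ≤ r) (hrN : r ≤ N) (hiN : i ≤ N) (hjm : j * m ≤ N) (hjN : j ≤ N) (hmN : m ≤ N)
    {key : List Bool} (hsfe : v.sfe = key) (hkey : key.length ≤ n)
    (hsfbeta : v.sfbeta = encodeNat i) (ha2a : v.a2a = encodeNat a) (ha2b : v.a2b = encodeNat b) (ha2j : v.a2j = encodeNat j) (ha2y : v.a2y = encodeNat m)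
    (ha2p : v.a2p = encOpt fnd) (ha2q : v.a2q = flagOpt fnd)
    (hx2 : v.x2 = []) (hx3 : v.x3 = []) (hx4 : v.x4 = []) (hx5 : v.x5 = []) (hx6 : v.x6 = []) (hfl1 : v.fl1 = []) (hfl2 : v.fl2 = [])
    (hsq1 : v.sq1 = []) (hsq2 : v.sq2 = []) (hsq3 : v.sq3 = []) (hsq4 : v.sq4 = []) (hsq5 : v.sq5 = []) :
    Runs (a2MatchedBr h) (base (hSt h T v))
      (base (hSt h T { v with sfe := [], a2a := [], a2b := [], a2j := [], a2p := encOpt (fnd.or (recoverSpec N m i a b j)), a2q := flagOpt (fnd.or (recoverSpec N m i a b j)) }))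
      (12 * (n + 1) ^ 3 + a2RecoverCost n + 2) := by
  have hlN : (encodeNat N).length ≤ n := by omega
  have habN : a * b ≤ N := habr.trans hrN
  have hla : (encodeNat a).length ≤ n := (Brick.length_encodeNat_mono (le_trans (Nat.le_mul_of_pos_right _ hb1) habN)).trans hlN
  have hlb : (encodeNat b).length ≤ n := (Brick.length_encodeNat_mono (le_trans (Nat.le_mul_of_pos_left _ ha1) habN)).trans hlN
  have hlj : (encodeNat j).length ≤ n := (Brick.length_encodeNat_mono hjN).trans hlN
  have hc1 : 1 ≤ (n + 1) ^ 3 := Nat.one_le_pow _ _ (by omega)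
  let v1 : HSlots := { v with sfe := [] }
  have h1 : Runs ((NS.op (.clear (h .SFE)) : NS β).com) (base (hSt h T v)) (base (hSt h T v1)) (3 * (n + 1) ^ 3) :=
    NS.runs_of_eq (N := n) _ _ (by simp only [NS.ok, NOp.ok, hSt_SFE, hsfe]; exact hkey) (by simp [v1]) (by simp)
  set res := fnd.or (recoverSpec N m i a b j) with hres
  let v2 : HSlots := { v1 with a2p := encOpt res, a2q := flagOpt res }
  have h2 : Runs (whenNot h .A2Q (a2Recover h)) (base (hSt h T v1)) (base (hSt h T v2)) (a2RecoverCost n + 2) := by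
    rcases fnd with _ | g
    · have g' := runs_a2Recover h hN1 hn T hI v1 ha1 hb1 habr hrN hiN hjm hjN hmN (by simp [v1, hsfbeta]) (by simp [v1, ha2a]) (by simp [v1, ha2b]) (by simp [v1, ha2j]) (by simp [v1, ha2y])
        (by simp [v1, hx2]) (by simp [v1, hx3]) (by simp [v1, hx4]) (by simp [v1, hx5]) (by simp [v1, hx6]) (by simp [v1]) (by simp [v1, hfl1]) (by simp [v1, hfl2])
        (by simp [v1, hsq1]) (by simp [v1, hsq2]) (by simp [v1, hsq3]) (by simp [v1, hsq4]) (by simp [v1, hsq5]) (by simp [v1, ha2p, encOpt]) (by simp [v1, ha2q, flagOpt])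
      refine (runs_whenNot_nil h (hSt h T v1) (by simp [v1, ha2q, flagOpt]) g').of_eq ?_ le_rfl
      simp [v1, v2, hres]
    · refine (runs_whenNot_true h _ (hSt h T v1) (by simp [v1, ha2q, flagOpt])).of_eq (by simp [v1, v2, hres, ha2p, ha2q]) ?_
      simp only [a2RecoverCost]; omega
  have h3 : Runs ((NS.ofList [.clear (h .A2A), .clear (h .A2B), .clear (h .A2J)] : NS β).com) (base (hSt h T v2))
      (base (hSt h T { v with sfe := [], a2a := [], a2b := [], a2j := [], a2p := encOpt res, a2q := flagOpt res })) (9 * (n + 1) ^ 3) := by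
    refine NS.runs_of_eq (N := n) _ _ ?_ (by simp [v2, v1]) (by simp)
    simp only [NS.ofList, NS.ok, NOp.ok, NS.eval, NOp.eval, hSt_A2A, hSt_A2B, hSt_A2J, update_hSt_A2A, update_hSt_A2B, v2, v1, ha2a, ha2b, ha2j]
    exact ⟨hla, hlb, hlj, trivial⟩
  exact (h1.seq (h2.seq h3)).of_eq rfl (by omega)

/-- **An unmatched giant step**: its value is appended to the list. [folklore] -/
theorem runs_a2UnmatchedBr {N n a b j r kv : ℕ} (hn : 2 * (encodeNat N).length + 8 ≤ n) (T : Regs β) (v : HSlots) (acc : List ℕ)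
    (ha1 : 1 ≤ a) (hb1 : 1 ≤ b) (habr : a * b ≤ r) (hrN : r ≤ N) (hjN : j ≤ N)
    {key : List Bool} (hsfe : v.sfe = key) (hkey : key.length ≤ n) (hkv : bitsToNat key = kv)
    (ha2a : v.a2a = encodeNat a) (ha2b : v.a2b = encodeNat b) (ha2j : v.a2j = encodeNat j) (hl4 : v.l4 = outRev (acc.map encodeNat)) (ha2l2 : v.a2l2 = List.replicate acc.length true) :
    Runs (a2UnmatchedBr h) (base (hSt h T v))
      (base (hSt h T { v with sfe := [], a2a := [], a2b := [], a2j := [], l4 := outRev ((acc ++ [kv]).map encodeNat), a2l2 := List.replicate (acc ++ [kv]).length true })) (42 * (n + 1) ^ 3 + 4 * n + 4) := by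
  have hlN : (encodeNat N).length ≤ n := by omega
  have habN : a * b ≤ N := habr.trans hrN
  have hla : (encodeNat a).length ≤ n := (Brick.length_encodeNat_mono (le_trans (Nat.le_mul_of_pos_right _ hb1) habN)).trans hlN
  have hlb : (encodeNat b).length ≤ n := (Brick.length_encodeNat_mono (le_trans (Nat.le_mul_of_pos_left _ ha1) habN)).trans hlN
  have hlj : (encodeNat j).length ≤ n := (Brick.length_encodeNat_mono hjN).trans hlN
  have hlkv : (encodeNat kv).length ≤ n := by rw [← hkv]; exact (Brick.length_encodeNat_bitsToNat_le key).trans hkey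
  let v1 : HSlots := { v with sfe := encodeNat kv }
  have h1 : Runs ((NS.op (.nrm (h .SFE)) : NS β).com) (base (hSt h T v)) (base (hSt h T v1)) (30 * (n + 1) ^ 3) :=
    NS.runs_of_eq (N := n) _ _ (by simp only [NS.ok, NOp.ok, hSt_SFE, hsfe]; exact hkey) (by simp [v1, hsfe, norm_eq_encodeNat, hkv]) (by simp)
  let v2 : HSlots := { v with sfe := [], l4 := outRev ((acc ++ [kv]).map encodeNat) }
  have h2 : Runs (emit (Sum.inr (h .SFE)) (Sum.inr (h .L4))) (base (hSt h T v1)) (base (hSt h T v2)) (4 * n + 3) := by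
    refine (runs_emit (h := (Sum.inr (h .SFE) : EReg ⊕ β)) (o := Sum.inr (h .L4)) (by simp [hq_ne h (show HReg.SFE ≠ .L4 by decide)]) (base (hSt h T v1))).of_eq ?_ ?_
    · simp [v1, v2, hl4, List.map_append, outRev_append]
    · simp only [nst_inr, hSt_SFE, v1]; omega
  let v3 : HSlots := { v2 with a2l2 := List.replicate (acc ++ [kv]).length true }
  have h3 : Runs (push (Sum.inr (h .A2L2)) true) (base (hSt h T v2)) (base (hSt h T v3)) 1 := Runs.push' (by simp [v2, v3, ha2l2, List.replicate_succ])
  have h4 : Runs ((NS.ofList [.clear (h .A2A), .clear (h .A2B), .clear (h .A2J)] : NS β).com) (base (hSt h T v3))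
      (base (hSt h T { v with sfe := [], a2a := [], a2b := [], a2j := [], l4 := outRev ((acc ++ [kv]).map encodeNat), a2l2 := List.replicate (acc ++ [kv]).length true })) (9 * (n + 1) ^ 3) := by
    refine NS.runs_of_eq (N := n) _ _ ?_ (by simp [v3, v2]) (by simp)
    simp only [NS.ofList, NS.ok, NOp.ok, NS.eval, NOp.eval, hSt_A2A, hSt_A2B, hSt_A2J, update_hSt_A2A, update_hSt_A2B, v3, v2, ha2a, ha2b, ha2j]
    exact ⟨hla, hlb, hlj, trivial⟩
  exact (h1.seq (h2.seq (h3.seq h4))).of_eq rfl (by omega)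

/-- Values below `N` fit the key width. [folklore] -/
theorem len_le_nb {N nb v : ℕ} (hnb : (encodeNat N).length = nb) (hv : v < N) : (encodeNat v).length ≤ nb := by rw [← hnb]; exact Brick.length_encodeNat_mono hv.le

/-- `GoodSt` is preserved by `scanStep` on a good word. [folklore] -/
theorem scanStep_good {N m r nb : ℕ} (hnb : (encodeNat N).length = nb) (hm : m ≤ N) {st : ScanSt} (hst : GoodSt N nb st) {w : List Bool} (hw : GoodWord N m r nb w) :
    GoodSt N nb (scanStep N m nb st w) := by
  obtain ⟨⟨i, hi, hbeta⟩, hcand, hacc⟩ := hst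
  rcases hw with ⟨v, i', hv, hi', rfl⟩ | ⟨v, a, b, j, hv, ha1, hb1, habr, hjm, hjN, rfl⟩
  · obtain ⟨htake, htag, hpl, -, -⟩ := mkWord_split (len_le_nb hnb hv) false (encodeNat i')
    refine ⟨⟨i', by omega, ?_⟩, ?_, ?_⟩
    · simp [scanStep, htag, hpl]
    · simp [scanStep, htag, htake]; have := len_le_nb hnb hv; omega
    · simpa [scanStep, htag] using hacc
  · obtain ⟨htake, htag, hpl, -, hkey⟩ := mkWord_split (len_le_nb hnb hv) true (gPayload a b j)
    by_cases hc : st.hb ∧ keyOf nb (mkWord nb v true (gPayload a b j)) = bitsToNat st.cand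
    · refine ⟨⟨i, hi, ?_⟩, ?_, ?_⟩
      · simp [scanStep, htag, hc, hbeta]
      · simpa [scanStep, htag, hc] using hcand
      · simpa [scanStep, htag, hc] using hacc
    · refine ⟨⟨i, hi, ?_⟩, ?_, ?_⟩
      · simp [scanStep, htag, hc, hbeta]
      · simpa [scanStep, htag, hc] using hcand
      · intro x hx
        simp only [scanStep, htag, if_true, if_neg hc, List.mem_append, List.mem_singleton] at hx
        rcases hx with hx | rfl
        · exact hacc x hx
        · rw [hkey]; exact hv

/-- Cost of one word of the scan. [folklore] -/
def a2ScanBodyCost (n nb : ℕ) : ℕ := a2ScanKeyCost n nb (3 * n) + 2 + (206 * (n + 1) ^ 3 + a2RecoverCost n + 4 * n + 10)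

/-- **One word of the scan.** [folklore] -/
theorem runs_a2ScanBody {N n m r nb : ℕ} (hN1 : 1 < N) (hn : 2 * (encodeNat N).length + 8 ≤ n) (hnb : (encodeNat N).length = nb) (T : Regs β) (hI : DrvInv (rGH h) N T) (u : HSlots)
    (hrN : r ≤ N) (hmN : m ≤ N) (hnr : 4 * (encodeNat r).length + (encodeNat N).length + 4 ≤ n) (st : ScanSt) (hst : GoodSt N nb st)
    (w : List Bool) (rest : List (List Bool)) (hw : GoodWord N m r nb w)
    (ha2u : u.a2u = List.replicate nb true) (ha2y : u.a2y = encodeNat m)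
    (ha2v : u.a2v = []) (hsfk : u.sfk = []) (hsfe : u.sfe = []) (hfl1 : u.fl1 = []) (hu2 : u.u2 = [])
    (hx2 : u.x2 = []) (hx3 : u.x3 = []) (hx4 : u.x4 = []) (hx5 : u.x5 = []) (hx6 : u.x6 = []) (hfl2 : u.fl2 = [])
    (hsq1 : u.sq1 = []) (hsq2 : u.sq2 = []) (hsq3 : u.sq3 = []) (hsq4 : u.sq4 = []) (hsq5 : u.sq5 = []) (ha2a : u.a2a = []) (ha2b : u.a2b = []) (ha2j : u.a2j = []) :
    Runs (a2ScanBody h) (base (hSt h T { u.scanRegs st with rx1 := encList (w :: rest) })) (base (hSt h T { u.scanRegs (scanStep N m nb st w) with rx1 := encList rest })) (a2ScanBodyCost n nb) := by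
  have hN0 : 0 < N := by omega
  set c := (n + 1) ^ 3 with hc3
  have hc1 : 1 ≤ c := Nat.one_le_pow _ _ (by omega)
  have hlN : (encodeNat N).length ≤ n := by omega
  have hnbn : nb ≤ n := by omega
  obtain ⟨⟨i, hi, hbeta⟩, hcand, hacc⟩ := hst
  have hli : (encodeNat i).length ≤ n := (Brick.length_encodeNat_mono hi).trans hlN
  let v0 : HSlots := { u.scanRegs st with rx1 := encList (w :: rest) }
  rcases hw with ⟨v, i', hv, hi', rfl⟩ | ⟨v, a, b, j, hv, ha1, hb1, habr, hjm, hjN, rfl⟩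
  · -- a baby step
    obtain ⟨htake, htag, hpl, hnbw, -⟩ := mkWord_split (len_le_nb hnb hv) false (encodeNat i')
    have hwl : (mkWord nb v false (encodeNat i')).length ≤ 3 * n := by
      simp only [mkWord, List.length_append, List.length_replicate, List.length_cons]
      have := len_le_nb hnb hv; have := Brick.length_encodeNat_mono (show i' ≤ N by omega); omega
    have h1 := runs_a2ScanKey h hn hnb T hI v0 (mkWord nb v false (encodeNat i')) rest hnbw hwl (by simp [v0]) (by simp [v0, HSlots.scanRegs, ha2u]) (by simp [v0, HSlots.scanRegs, ha2v])
      (by simp [v0, HSlots.scanRegs, hsfk]) (by simp [v0, HSlots.scanRegs, hsfe]) (by simp [v0, HSlots.scanRegs, hfl1]) (by simp [v0, HSlots.scanRegs, hu2])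
    rw [htag, hpl] at h1
    let v1 : HSlots := { v0 with rx1 := encList rest, sfe := (mkWord nb v false (encodeNat i')).take nb, fl1 := [false], a2v := encodeNat i' }
    have hli' : (encodeNat i').length ≤ n := (Brick.length_encodeNat_mono (show i' ≤ N by omega)).trans hlN
    have h2 := runs_a2BabyBr h T { v1 with fl1 := [] } (key := (mkWord nb v false (encodeNat i')).take nb) (pl := encodeNat i') (by simp [v1]) (by rw [htake]; simp; have := len_le_nb hnb hv; omega)
      (by simp [v1]) hli' (by simp [v1, v0, HSlots.scanRegs]; omega) (by simp [v1, v0, HSlots.scanRegs, hbeta]; exact hli) (by simp [v1, v0, HSlots.scanRegs]; cases st.hb <;> simp [flag]; omega)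
      (by omega)
    have gp := Runs.opop_false (k := h .FL1) (a2GiantBr h) (a2BabyBr h).com (T := hSt h T v1) (w := []) (by simp [v1]) (by rw [update_hSt_FL1]; exact h2)
    refine (h1.seq gp).of_eq ?_ ?_
    · simp [v1, v0, HSlots.scanRegs, scanStep, htag, hpl, htake, flag, ha2v, hfl1, hsfe, hsfk]
    · simp only [a2ScanBodyCost, ← hc3]; omega
  · -- a giant step
    obtain ⟨htake, htag, hpl, hnbw, hkey⟩ := mkWord_split (len_le_nb hnb hv) true (gPayload a b j)
    have habN : a * b ≤ N := habr.trans hrN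
    have hla' : (encodeNat a).length ≤ (encodeNat r).length := Brick.length_encodeNat_mono (le_trans (Nat.le_mul_of_pos_right _ hb1) habr)
    have hlb' : (encodeNat b).length ≤ (encodeNat r).length := Brick.length_encodeNat_mono (le_trans (Nat.le_mul_of_pos_left _ ha1) habr)
    have hlj' : (encodeNat j).length ≤ (encodeNat N).length := Brick.length_encodeNat_mono hjN
    have hwl : (mkWord nb v true (gPayload a b j)).length ≤ 3 * n := by
      simp only [mkWord, gPayload, List.length_append, List.length_replicate, List.length_cons, length_boolPair]
      have := len_le_nb hnb hv; omega
    have h1 := runs_a2ScanKey h hn hnb T hI v0 (mkWord nb v true (gPayload a b j)) rest hnbw hwl (by simp [v0]) (by simp [v0, HSlots.scanRegs, ha2u]) (by simp [v0, HSlots.scanRegs, ha2v])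
      (by simp [v0, HSlots.scanRegs, hsfk]) (by simp [v0, HSlots.scanRegs, hsfe]) (by simp [v0, HSlots.scanRegs, hfl1]) (by simp [v0, HSlots.scanRegs, hu2])
    rw [htag, hpl] at h1
    have hlkey : ((mkWord nb v true (gPayload a b j)).take nb).length ≤ n := by rw [htake]; simp; have := len_le_nb hnb hv; omega
    let v1 : HSlots := { v0 with rx1 := encList rest, sfe := (mkWord nb v true (gPayload a b j)).take nb, fl1 := [true], a2v := gPayload a b j }
    have h2 := runs_a2GiantPre h (N := N) (hb := st.hb) hn T { v1 with fl1 := [] } ha1 hb1 habr hrN hjN hnr (by simp [v1]) (by simp [v1]) hlkey (by simp [v1, v0, HSlots.scanRegs]) (hcand.trans hnbn)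
      (by simp [v1, v0, HSlots.scanRegs]) (by simp [v1, v0, HSlots.scanRegs, hx3]) (by simp [v1, v0, HSlots.scanRegs, hx4]) (by simp [v1, v0, HSlots.scanRegs, hx6])
      (by simp [v1, v0, HSlots.scanRegs, hfl2]) (by simp [v1, v0, HSlots.scanRegs, ha2a]) (by simp [v1, v0, HSlots.scanRegs, ha2b]) (by simp [v1, v0, HSlots.scanRegs, ha2j])
    let v2 : HSlots := { ({ v1 with fl1 := [] } : HSlots) with a2a := encodeNat a, a2b := encodeNat b, a2j := encodeNat j, a2v := [], x3 := (if bitsToNat ((mkWord nb v true (gPayload a b j)).take nb) = bitsToNat st.cand then flag st.hb else []) }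
    have hkv : bitsToNat ((mkWord nb v true (gPayload a b j)).take nb) = v := hkey
    by_cases hmatch : st.hb = true ∧ bitsToNat ((mkWord nb v true (gPayload a b j)).take nb) = bitsToNat st.cand
    · -- matched
      obtain ⟨hhb, hkc⟩ := hmatch
      have hss : scanStep N m nb st (mkWord nb v true (gPayload a b j)) = { st with found := st.found.or (recoverSpec N m i a b j) } := by
        simp only [scanStep, htag, if_true, keyOf, hpl, fieldsOf_gPayload, hbeta, bitsToNat_encodeNat]; rw [if_pos ⟨hhb, hkc⟩]
      have hx3v : hSt h T v2 (h .X3) = true :: [] := by simp [v2, hkc, hhb, flag]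
      let v3 : HSlots := { v2 with x3 := [] }
      have h3 := runs_a2MatchedBr h (N := N) (n := n) (i := i) (a := a) (b := b) (j := j) (m := m) (r := r) (key := (mkWord nb v true (gPayload a b j)).take nb) hN1 hn T hI v3 st.found
        ha1 hb1 habr hrN hi hjm hjN hmN
        (hsfe := by simp [v3, v2, v1]) (hkey := hlkey) (hsfbeta := by simp [v3, v2, v1, v0, HSlots.scanRegs, hbeta]) (ha2a := by simp [v3, v2]) (ha2b := by simp [v3, v2]) (ha2j := by simp [v3, v2])
        (ha2y := by simp [v3, v2, v1, v0, HSlots.scanRegs, ha2y]) (ha2p := by simp [v3, v2, v1, v0, HSlots.scanRegs]) (ha2q := by simp [v3, v2, v1, v0, HSlots.scanRegs])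
        (hx2 := by simp [v3, v2, v1, v0, HSlots.scanRegs, hx2]) (hx3 := by simp [v3]) (hx4 := by simp [v3, v2, v1, v0, HSlots.scanRegs, hx4]) (hx5 := by simp [v3, v2, v1, v0, HSlots.scanRegs, hx5])
        (hx6 := by simp [v3, v2, v1, v0, HSlots.scanRegs, hx6]) (hfl1 := by simp [v3, v2]) (hfl2 := by simp [v3, v2, v1, v0, HSlots.scanRegs, hfl2])
        (hsq1 := by simp [v3, v2, v1, v0, HSlots.scanRegs, hsq1]) (hsq2 := by simp [v3, v2, v1, v0, HSlots.scanRegs, hsq2]) (hsq3 := by simp [v3, v2, v1, v0, HSlots.scanRegs, hsq3])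
        (hsq4 := by simp [v3, v2, v1, v0, HSlots.scanRegs, hsq4]) (hsq5 := by simp [v3, v2, v1, v0, HSlots.scanRegs, hsq5])
      have gp2 := Runs.opop_true (k := h .X3) (ct := a2MatchedBr h) (a2UnmatchedBr h) (a2UnmatchedBr h) (T := hSt h T v2) (w := []) hx3v (by rw [update_hSt_X3]; exact h3)
      have gp := Runs.opop_true (k := h .FL1) (ct := a2GiantBr h) (a2BabyBr h).com (a2BabyBr h).com (T := hSt h T v1) (w := []) (by simp [v1]) (by rw [update_hSt_FL1]; exact h2.seq gp2)
      refine (h1.seq gp).of_eq ?_ ?_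
      · simp [v3, v2, v1, v0, HSlots.scanRegs, hss, ha2v, hfl1, hsfe, hsfk, hx3, ha2a, ha2b, ha2j]
      · simp only [a2ScanBodyCost, ← hc3]; omega
    · -- unmatched
      have hss : scanStep N m nb st (mkWord nb v true (gPayload a b j)) = { st with acc := st.acc ++ [v] } := by
        simp only [scanStep, htag, if_true, keyOf]; rw [if_neg hmatch, hkv]
      have hx3v : hSt h T v2 (h .X3) = [] := by
        simp only [v2, hSt_X3]
        by_cases hkc' : bitsToNat ((mkWord nb v true (gPayload a b j)).take nb) = bitsToNat st.cand
        · have hhb : st.hb = false := by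
            cases hh : st.hb with
            | false => rfl
            | true => exact absurd ⟨rfl, hkc'⟩ (hh ▸ hmatch)
          simp [hkc', hhb, flag]
        · simp [hkc']
      let v3 : HSlots := { v2 with x3 := [] }
      have h3 := runs_a2UnmatchedBr h (N := N) (n := n) (kv := v) (key := (mkWord nb v true (gPayload a b j)).take nb) hn T v3 st.acc ha1 hb1 habr hrN hjN (hsfe := by simp [v3, v2, v1]) (hkey := hlkey)
        (hkv := hkv) (ha2a := by simp [v3, v2]) (ha2b := by simp [v3, v2]) (ha2j := by simp [v3, v2]) (hl4 := by simp [v3, v2, v1, v0, HSlots.scanRegs]) (ha2l2 := by simp [v3, v2, v1, v0, HSlots.scanRegs])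
      have hv2 : hSt h T v2 = hSt h T v3 := by rw [show v3 = { v2 with x3 := [] } from rfl, ← update_hSt_X3]; exact (Function.update_eq_self_iff.2 hx3v.symm).symm
      have gp2 := Runs.opop_nil (k := h .X3) (a2MatchedBr h) (a2UnmatchedBr h) (T := hSt h T v2) hx3v (by rw [hv2]; exact h3)
      have gp := Runs.opop_true (k := h .FL1) (ct := a2GiantBr h) (a2BabyBr h).com (a2BabyBr h).com (T := hSt h T v1) (w := []) (by simp [v1]) (by rw [update_hSt_FL1]; exact h2.seq gp2)
      refine (h1.seq gp).of_eq ?_ ?_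
      · simp [v3, v2, v1, v0, HSlots.scanRegs, hss, List.map_append, ha2v, hfl1, hsfe, hsfk, hx3, ha2a, ha2b, ha2j]
      · simp only [a2ScanBodyCost, ← hc3]; omega

/-- The scan: one guarded round per word (count on `A2L1`), then clean-up of the baby-step memory. [folklore] -/
def a2Scan : Com (EReg ⊕ β) := countLoop (Sum.inr (h .A2L1)) (a2ScanBody h) ;; ((NS.ofList [.clear (h .SFCAND), .clear (h .SFBETA), .clear (h .SFDIVS)] : NS β).com)

/-- `GoodSt` along the scan. [folklore] -/
theorem scanRun_good {N m r nb : ℕ} (hnb : (encodeNat N).length = nb) (hm : m ≤ N) (sw : List (List Bool)) (hsw : ∀ w ∈ sw, GoodWord N m r nb w) :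
    ∀ k, GoodSt N nb (scanRun N m nb ScanSt.init (sw.take k))
  | 0 => ⟨⟨0, Nat.zero_le _, rfl⟩, by simp [scanRun, ScanSt.init], by simp [scanRun, ScanSt.init]⟩
  | k + 1 => by
    by_cases hk : k < sw.length
    · rw [List.take_add_one, List.getElem?_eq_getElem hk]
      simp only [Option.toList_some, scanRun_append]
      exact scanStep_good hnb hm (scanRun_good hnb hm sw hsw k) (hsw _ (List.getElem_mem hk))
    · rw [List.take_of_length_le (by omega)]
      have := scanRun_good hnb hm sw hsw k
      rwa [List.take_of_length_le (by omega)] at this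

/-- Cost of the scan of `L` words. [folklore] -/
def a2ScanCost (n nb L : ℕ) : ℕ := L * (a2ScanBodyCost n nb + 2) + 1 + 9 * (n + 1) ^ 3

/-- **The scan of the sorted words.** [folklore] -/
theorem runs_a2Scan {N n m r nb : ℕ} (hN1 : 1 < N) (hn : 2 * (encodeNat N).length + 8 ≤ n) (hnb : (encodeNat N).length = nb) (T : Regs β) (hI : DrvInv (rGH h) N T) (u : HSlots)
    (hrN : r ≤ N) (hmN : m ≤ N) (hnr : 4 * (encodeNat r).length + (encodeNat N).length + 4 ≤ n) (sw : List (List Bool)) (hsw : ∀ w ∈ sw, GoodWord N m r nb w)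
    (ha2u : u.a2u = List.replicate nb true) (ha2y : u.a2y = encodeNat m)
    (ha2v : u.a2v = []) (hsfk : u.sfk = []) (hsfe : u.sfe = []) (hfl1 : u.fl1 = []) (hu2 : u.u2 = [])
    (hx2 : u.x2 = []) (hx3 : u.x3 = []) (hx4 : u.x4 = []) (hx5 : u.x5 = []) (hx6 : u.x6 = []) (hfl2 : u.fl2 = [])
    (hsq1 : u.sq1 = []) (hsq2 : u.sq2 = []) (hsq3 : u.sq3 = []) (hsq4 : u.sq4 = []) (hsq5 : u.sq5 = []) (ha2a : u.a2a = []) (ha2b : u.a2b = []) (ha2j : u.a2j = []) :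
    let res := scanRun N m nb ScanSt.init sw
    Runs (a2Scan h) (base (hSt h T { u.scanRegs ScanSt.init with rx1 := encList sw, a2l1 := List.replicate sw.length true }))
      (base (hSt h T { u.scanRegs res with rx1 := [], a2l1 := [], sfcand := [], sfbeta := [], sfdivs := [] })) (a2ScanCost n nb sw.length) := by
  intro res
  set c := (n + 1) ^ 3 with hc3
  have hlN : (encodeNat N).length ≤ n := by omega
  set L := sw.length with hL
  let stA : ℕ → HSlots := fun i => { ({ u with a2l1 := List.replicate i true } : HSlots).scanRegs (scanRun N m nb ScanSt.init (sw.take (L - i))) with rx1 := encList (sw.drop (L - i)) }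
  have hstart : ({ u.scanRegs ScanSt.init with rx1 := encList sw, a2l1 := List.replicate sw.length true } : HSlots) = stA L := by
    simp [stA, HSlots.scanRegs, ← hL, scanRun]
  have hLoop := runs_countLoop (U := (Sum.inr (h .A2L1) : EReg ⊕ β)) (body := a2ScanBody h) (fun i R => i ≤ L ∧ R = base (hSt h T (stA i))) (a2ScanBodyCost n nb)
    (by
      rintro i R ⟨hi, rfl⟩ -
      have hlt : L - (i + 1) < sw.length := by omega
      set w := sw[L - (i + 1)] with hw0
      have hdrop : sw.drop (L - (i + 1)) = w :: sw.drop (L - i) := by rw [show L - i = L - (i + 1) + 1 by omega]; exact List.drop_eq_getElem_cons hlt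
      have htake : sw.take (L - i) = sw.take (L - (i + 1)) ++ [w] := by rw [show L - i = L - (i + 1) + 1 by omega, List.take_add_one, List.getElem?_eq_getElem hlt]; rfl
      have hgood := scanRun_good (r := r) hnb hmN sw hsw (L - (i + 1))
      have hwgood : GoodWord N m r nb w := hsw _ (List.getElem_mem hlt)
      let u' : HSlots := { u with a2l1 := List.replicate i true }
      have hupd : Function.update (base (hSt h T (stA (i + 1)))) (Sum.inr (h .A2L1)) (List.replicate i true) =
          base (hSt h T { u'.scanRegs (scanRun N m nb ScanSt.init (sw.take (L - (i + 1)))) with rx1 := encList (w :: sw.drop (L - i)) }) := by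
        simp [stA, u', HSlots.scanRegs, hdrop]
      rw [hupd]
      refine ⟨_, runs_a2ScanBody h hN1 hn hnb T hI u' hrN hmN hnr _ hgood w (sw.drop (L - i)) hwgood (by simp [u', ha2u]) (by simp [u', ha2y]) (by simp [u', ha2v]) (by simp [u', hsfk])
        (by simp [u', hsfe]) (by simp [u', hfl1]) (by simp [u', hu2]) (by simp [u', hx2]) (by simp [u', hx3]) (by simp [u', hx4]) (by simp [u', hx5]) (by simp [u', hx6]) (by simp [u', hfl2])
        (by simp [u', hsq1]) (by simp [u', hsq2]) (by simp [u', hsq3]) (by simp [u', hsq4]) (by simp [u', hsq5]) (by simp [u', ha2a]) (by simp [u', ha2b]) (by simp [u', ha2j]),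
        by simp [u', HSlots.scanRegs], by omega, ?_⟩
      simp [stA, u', HSlots.scanRegs, htake, scanRun_append])
    L (base (hSt h T (stA L))) ⟨le_rfl, rfl⟩ (by simp [stA, HSlots.scanRegs])
  obtain ⟨R', hR, -, -, rfl⟩ := hLoop
  rw [← hstart] at hR
  obtain ⟨⟨i, hi, hbeta⟩, hcand, -⟩ := scanRun_good (r := r) hnb hmN sw hsw L
  rw [List.take_of_length_le (le_of_eq hL.symm)] at hbeta hcand
  have hli : (encodeNat i).length ≤ n := (Brick.length_encodeNat_mono hi).trans hlN
  have h2 : Runs ((NS.ofList [.clear (h .SFCAND), .clear (h .SFBETA), .clear (h .SFDIVS)] : NS β).com) (base (hSt h T (stA 0)))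
      (base (hSt h T { u.scanRegs res with rx1 := [], a2l1 := [], sfcand := [], sfbeta := [], sfdivs := [] })) (9 * c) := by
    refine NS.runs_of_eq (N := n) _ _ ?_ ?_ (by simp [hc3])
    · simp only [NS.ofList, NS.ok, NOp.ok, NS.eval, NOp.eval, hSt_SFCAND, hSt_SFBETA, hSt_SFDIVS, update_hSt_SFCAND, update_hSt_SFBETA, stA, HSlots.scanRegs, Nat.sub_zero,
        List.take_of_length_le (le_of_eq hL.symm), hbeta]
      refine ⟨hcand.trans (by omega), hli, ?_, trivial⟩
      cases (scanRun N m nb ScanSt.init sw).hb <;> simp [flag]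
      all_goals omega
    · simp [stA, HSlots.scanRegs, res, List.take_of_length_le (le_of_eq hL.symm), List.drop_of_length_le (le_of_eq hL.symm)]
  refine (hR.seq h2).of_eq rfl ?_
  simp only [a2ScanCost, ← hc3]; omega

end AlgTwoScan

section AlgTwoFinal

/-! #### Step 4 of Algorithm 2: Algorithm 1 on the unmatched values

The unmatched giant-step values `acc` (on `L4`, reversed, counted in unary on `A2L2`) are padded
with zeros to `2^e` values, `e = |enc(|acc| − 1)|`, and handed to Algorithm 1 with the shift
`c = α^{J* m}` and `k = |enc(2^e + m)| + 1` (so that `2^e + m ≤ 2^{k−1}`). -/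

/-- Counting the tokens of `A2L2` into the numeral `X2`. [folklore] -/
def a2Cnt : Com (EReg ⊕ β) :=
  countLoop (Sum.inr (h .A2L2)) ((NS.ofList [.succ (h .X4) (h .X2), .clear (h .X2), .move (h .X4) (h .X2)] : NS β).com)

/-- A number is below the power of two of its length (a private copy of a one-liner that exists
in unrelated files of the tree, e.g. `LWEAmplifyProb.lean`, none importable here). [folklore] -/
private theorem lt_two_pow_length_encodeNat (x : ℕ) : x < 2 ^ (encodeNat x).length := by
  rw [TM2Pass.length_encodeNat_eq_size]; exact Nat.lt_size_self x

/-- **Counting.** [folklore] -/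
theorem runs_a2Cnt {n L : ℕ} (hL : (encodeNat L).length ≤ n) (T : Regs β) (u : HSlots) (hx2 : u.x2 = []) (hx4 : u.x4 = []) :
    Runs (a2Cnt h) (base (hSt h T { u with a2l2 := List.replicate L true })) (base (hSt h T { u with a2l2 := [], x2 := encodeNat L })) (L * (83 * (n + 1) ^ 3 + 2) + 1) := by
  have e0 : encodeNat 0 = [] := rfl
  let st : ℕ → HSlots := fun i => { u with a2l2 := List.replicate i true, x2 := encodeNat (L - i) }
  have hstart : ({ u with a2l2 := List.replicate L true } : HSlots) = st L := by simp [st, e0, hx2]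
  have hl := runs_countLoop (U := (Sum.inr (h .A2L2) : EReg ⊕ β)) (body := ((NS.ofList [.succ (h .X4) (h .X2), .clear (h .X2), .move (h .X4) (h .X2)] : NS β).com))
    (fun i R => i ≤ L ∧ R = base (hSt h T (st i))) (83 * (n + 1) ^ 3)
    (by
      rintro i R ⟨hi, rfl⟩ -
      have hupd : Function.update (base (hSt h T (st (i + 1)))) (Sum.inr (h .A2L2)) (List.replicate i true) = base (hSt h T { st (i + 1) with a2l2 := List.replicate i true }) := by
        simp [st]
      rw [hupd]
      have hl1 : (encodeNat (L - (i + 1))).length ≤ n := (Brick.length_encodeNat_mono (Nat.sub_le _ _)).trans hL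
      have hl2 : (encodeNat (L - (i + 1) + 1)).length ≤ n := (Brick.length_encodeNat_mono (by omega)).trans hL
      refine ⟨_, NS.runs_of_eq (N := n) _ _ ?_ ?_ (by simp), by simp [st], by omega, rfl⟩
      · simp (config := { decide := true }) only [NS.ofList, NS.ok, NOp.ok, NS.eval, NOp.eval, hSt_X4, hSt_X2, update_hSt_X4, update_hSt_X2, st, hx4, bitsToNat_encodeNat,
          List.length_nil, ne_eq, EmbeddingLike.apply_eq_iff_eq, not_false_eq_true, hl1, hl2, zero_le, and_self]
      · have e1 : L - (i + 1) + 1 = L - i := by omega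
        simp [st, hx4, e1])
    L (base (hSt h T (st L))) ⟨le_rfl, rfl⟩ (by simp [st])
  obtain ⟨R', hR, -, -, rfl⟩ := hl
  rw [← hstart] at hR
  exact hR.of_eq (by simp [st]) le_rfl

/-- The numerics of the padding: `A1P := e = |enc(cnt − 1)|`, `X4 := 2^e` (from `X2 = cnt`). [folklore] -/
def a2SixE : Com (EReg ⊕ β) :=
  ((NS.ofList [.const (h .X3) (encodeNat 1), .sub (h .X4) (h .X2) (h .X3), .clear (h .X3), .len (h .A1P) (h .X4) (h .X3), .clear (h .X4)] : NS β).com) ;;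
  pow2Into (rGH h) (h .X4) (h .A1P)

/-- The exponent `e` of the padding. [folklore] -/
def a2E (cnt : ℕ) : ℕ := (encodeNat (cnt - 1)).length

/-- `cnt ≤ 2^e ≤ 2 cnt` (for `cnt ≥ 1`). [folklore] -/
theorem a2E_facts {cnt : ℕ} (hc : 1 ≤ cnt) : cnt ≤ 2 ^ a2E cnt ∧ 2 ^ a2E cnt ≤ 2 * cnt := by
  refine ⟨?_, ?_⟩
  · have := lt_two_pow_length_encodeNat (cnt - 1); unfold a2E; omega
  · unfold a2E
    rcases Nat.eq_or_lt_of_le hc with h1 | h1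
    · subst h1; exact le_of_eq_of_le (by rfl) (show 1 ≤ 2 by norm_num)
    · rw [TM2Pass.length_encodeNat_eq_size]
      have hpos : 0 < cnt - 1 := by omega
      have := (Nat.size_le (m := cnt - 1) (n := Nat.size (cnt - 1))).1 le_rfl
      have h2 : 2 ^ (Nat.size (cnt - 1) - 1) ≤ cnt - 1 := by
        have := Nat.lt_size.1 (show Nat.size (cnt - 1) - 1 < Nat.size (cnt - 1) from Nat.sub_lt (Nat.size_pos.2 hpos) one_pos)
        exact this
      have h3 : 2 ^ Nat.size (cnt - 1) = 2 * 2 ^ (Nat.size (cnt - 1) - 1) := by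
        rw [← pow_succ']; congr 1; have := Nat.size_pos.2 hpos; omega
      omega

/-- **The numerics of the padding.** [folklore] -/
theorem runs_a2SixE {N n cnt : ℕ} (hn : 2 * (encodeNat N).length + 8 ≤ n) (hcnt : cnt ≤ 64 * N * N) (hN1 : 1 < N) (hc1 : 1 ≤ cnt)
    (T : Regs β) (hI : DrvInv (rGH h) N T) (u : HSlots)
    (hx2 : u.x2 = encodeNat cnt) (hx3 : u.x3 = []) (hx4 : u.x4 = []) (ha1p : u.a1p = []) :
    Runs (a2SixE h) (base (hSt h T u)) (base (hSt h T { u with a1p := encodeNat (a2E cnt), x4 := encodeNat (2 ^ a2E cnt) }))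
      (175 * (n + 1) ^ 3 + (n * (16 * n + 21) + 3 * n + 7)) := by
  obtain ⟨-, -, -, -, -, -, -, -, -, -, hU, -, -, -, -, -, -, -⟩ := id hI
  have rdU : ∀ u' : HSlots, hSt h T u' ((rGH h) (.f (.n (.v .U)))) = [] := fun u' => by
    rw [rGH_apply, hSt_gv h T u' (by decide) (by decide) (by decide) (by decide) (by decide) (by decide)]; exact hU
  set c := (n + 1) ^ 3 with hc3
  have hlN : (encodeNat N).length ≤ n := by omega
  have e1 : encodeNat 1 = [true] := by simpa using encodeNat_two_pow 0
  have hl1n : (encodeNat 1).length ≤ n := by rw [e1]; simp only [List.length_cons, List.length_nil]; omega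
  have hlc : (encodeNat cnt).length ≤ n := a2_len64 hN1 hn hcnt
  have hlc1 : (encodeNat (cnt - 1)).length ≤ n := (Brick.length_encodeNat_mono (Nat.sub_le _ _)).trans hlc
  have hen : a2E cnt ≤ n := hlc1
  have hle : (encodeNat (a2E cnt)).length ≤ n := (length_encodeNat_le_self _).trans hen
  let u1 : HSlots := { u with a1p := encodeNat (a2E cnt) }
  have h1 : Runs ((NS.ofList [.const (h .X3) (encodeNat 1), .sub (h .X4) (h .X2) (h .X3), .clear (h .X3), .len (h .A1P) (h .X4) (h .X3), .clear (h .X4)] : NS β).com)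
      (base (hSt h T u)) (base (hSt h T u1)) (175 * c) := by
    refine NS.runs_of_eq (N := n) _ _ ?_ ?_ (by simp [hc3])
    · simp (config := { decide := true }) only [NS.ofList, NS.ok, NOp.ok, NS.eval, NOp.eval, hSt_X3, hSt_X4, hSt_X2, hSt_A1P, update_hSt_X3, update_hSt_X4, update_hSt_A1P,
        hx2, hx3, hx4, ha1p, bitsToNat_encodeNat, List.length_nil, ne_eq, EmbeddingLike.apply_eq_iff_eq, not_false_eq_true,
        hlc, hlc1, hl1n, hc1, zero_le, and_self]
    · simp [u1, hx2, hx3, hx4, ha1p, a2E]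
  have h2 : Runs (pow2Into (rGH h) (h .X4) (h .A1P)) (base (hSt h T u1)) (base (hSt h T { u1 with x4 := encodeNat (2 ^ a2E cnt) })) (n * (16 * a2E cnt + 21) + 3 * a2E cnt + 7) := by
    have hne : h .X4 ≠ h .A1P := hq_ne h (by decide)
    have hneU : h .X4 ≠ (rGH h) (.f (.n (.v .U))) := (rGH_ne h .X4 (fun _ e => HReg.noConfusion e) _).symm
    have r1 : hSt h T u1 (h .A1P) = encodeNat (a2E cnt) := by rw [hSt_A1P]
    have r2 : hSt h T u1 (h .X4) = [] := by rw [hSt_X4]; exact hx4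
    refine (runs_pow2Into (rGH h) hneU hne hle (hSt h T u1) r1 r2 (rdU u1)).of_eq ?_ le_rfl
    rw [update_hSt_X4]
  refine (h1.seq h2).of_eq (by simp [u1]) ?_
  have : n * (16 * a2E cnt + 21) + 3 * a2E cnt + 7 ≤ n * (16 * n + 21) + 3 * n + 7 := by
    have := Nat.mul_le_mul_left n (show 16 * a2E cnt + 21 ≤ 16 * n + 21 by omega); omega
  omega

/-- `k = |enc(2^e + m)| + 1`. [folklore] -/
def a2K (P m : ℕ) : ℕ := (encodeNat (P + m)).length + 1

/-- `2^e + m ≤ 2^{k − 1}`. [folklore] -/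
theorem a2K_facts (P m : ℕ) : P + m ≤ 2 ^ (a2K P m - 1) ∧ 1 ≤ a2K P m :=
  ⟨by rw [a2K, Nat.add_sub_cancel]; exact (lt_two_pow_length_encodeNat _).le, by simp [a2K]⟩

/-- Padding with `Z = 2^e − cnt` zero values, `k`, and moving the values to `A1V`. [folklore] -/
def a2SixP : Com (EReg ⊕ β) :=
  ((NS.ofList [.sub (h .X3) (h .X4) (h .X2), .clear (h .X2), .add (h .X5) (h .X4) (h .A2Y), .clear (h .X4), .len (h .X6) (h .X5) (h .X2), .clear (h .X5),
      .succ (h .BLK) (h .X6), .clear (h .X6)] : NS β).com) ;;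
  (nToUnary (h .U1) (h .X3) ;; (((NS.op (.clear (h .X3))) : NS β).com ;; (blZeros h ;; pour (Sum.inr (h .L4)) (Sum.inr (h .A1V)))))

/-- Cost of the padding. [folklore] -/
def a2SixPCost (n P : ℕ) : ℕ := 313 * (n + 1) ^ 3 + (n * (16 * P + 21) + 5) + (P * (2 + 2) + 1) + (3 * (P * (2 * n)) + 1)

/-- The padded values. [folklore] -/
theorem encVec_pad_zero (acc : List ℕ) (Z : ℕ) : encList (acc.map encodeNat ++ List.replicate Z []) = encVec (acc ++ List.replicate Z 0) := by
  rw [encVec, List.map_append, List.map_replicate]; rfl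

/-- **The padding.** [folklore] -/
theorem runs_a2SixP {N n P m : ℕ} (hN1 : 1 < N) (hn : 2 * (encodeNat N).length + 8 ≤ n) (hP : P ≤ 32 * N * N) (hmN : m ≤ N)
    (T : Regs β) (u : HSlots) (acc : List ℕ) (hacc : ∀ v ∈ acc, v < N) (hcP : acc.length ≤ P)
    (hx2 : u.x2 = encodeNat acc.length) (hx4 : u.x4 = encodeNat P) (ha2y : u.a2y = encodeNat m) (hl4 : u.l4 = outRev (acc.map encodeNat))
    (hx3 : u.x3 = []) (hx5 : u.x5 = []) (hx6 : u.x6 = []) (hblk : u.blk = []) (hu1 : u.u1 = []) (ha1v : u.a1v = []) :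
    Runs (a2SixP h) (base (hSt h T u))
      (base (hSt h T { u with x2 := [], x4 := [], blk := encodeNat (a2K P m), l4 := [], a1v := encVec (acc ++ List.replicate (P - acc.length) 0) }))
      (a2SixPCost n P) := by
  have hN0 : 0 < N := by omega
  set c := (n + 1) ^ 3 with hc3
  have hlN : (encodeNat N).length ≤ n := by omega
  set cnt := acc.length with hcnt0
  set Z := P - cnt with hZ0
  have hlP : (encodeNat P).length ≤ n := a2_len64 hN1 hn (by nlinarith)
  have hlc : (encodeNat cnt).length ≤ n := a2_len64 hN1 hn (by nlinarith)
  have hlZ : (encodeNat Z).length ≤ n := a2_len64 hN1 hn (by nlinarith [Nat.sub_le P cnt])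
  have hlm : (encodeNat m).length ≤ n := (Brick.length_encodeNat_mono hmN).trans hlN
  have hlPm : (encodeNat (P + m)).length ≤ n := a2_len64 hN1 hn (by nlinarith)
  have hlk' : (encodeNat (encodeNat (P + m)).length).length ≤ n := (length_encodeNat_le_self _).trans hlPm
  let u1 : HSlots := { u with x3 := encodeNat Z, x2 := [], x4 := [], blk := encodeNat (a2K P m) }
  have h1 : Runs ((NS.ofList [.sub (h .X3) (h .X4) (h .X2), .clear (h .X2), .add (h .X5) (h .X4) (h .A2Y), .clear (h .X4), .len (h .X6) (h .X5) (h .X2), .clear (h .X5),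
      .succ (h .BLK) (h .X6), .clear (h .X6)] : NS β).com) (base (hSt h T u)) (base (hSt h T u1)) (310 * c) := by
    refine NS.runs_of_eq (N := n) _ _ ?_ ?_ (by simp [hc3])
    · simp (config := { decide := true }) only [NS.ofList, NS.ok, NOp.ok, NS.eval, NOp.eval, hSt_X3, hSt_X4, hSt_X2, hSt_X5, hSt_A2Y, hSt_X6, hSt_BLK,
        update_hSt_X3, update_hSt_X2, update_hSt_X5, update_hSt_X4, update_hSt_X6, update_hSt_BLK,
        hx2, hx3, hx4, hx5, hx6, hblk, ha2y, bitsToNat_encodeNat, List.length_nil, ne_eq, EmbeddingLike.apply_eq_iff_eq, not_false_eq_true,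
        hlP, hlc, hlm, hlPm, hlk', hcP, zero_le, and_self]
    · simp [u1, hx2, hx4, hx5, hx6, hblk, ha2y, a2K, hZ0]
  let u2 : HSlots := { u1 with u1 := List.replicate Z true }
  have h2 : Runs (nToUnary (h .U1) (h .X3)) (base (hSt h T u1)) (base (hSt h T u2)) ((encodeNat Z).length * (16 * Z + 21) + 5) := by
    refine (runs_nToUnary (h .U1) (h .X3) (hSt h T u1) (by simp [u1, hu1])).of_eq (by simp [u1, u2]) ?_
    simp only [hSt_X3, u1, bitsToNat_encodeNat]; exact le_rfl
  let u3 : HSlots := { u2 with x3 := [] }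
  have h3 : Runs ((NS.op (.clear (h .X3)) : NS β).com) (base (hSt h T u2)) (base (hSt h T u3)) (3 * c) :=
    NS.runs_of_eq (N := n) _ _ (by simp only [NS.ok, NOp.ok, hSt_X3, u2, u1]; exact hlZ) (by simp [u2, u3]) (by simp [hc3])
  let u4 : HSlots := { u3 with u1 := [], l4 := outRev (acc.map encodeNat ++ List.replicate Z []) }
  have h4 : Runs (blZeros h) (base (hSt h T u3)) (base (hSt h T u4)) (Z * (2 + 2) + 1) :=
    (runs_blZeros h T u3 (acc.map encodeNat) Z (by simp [u3, u2, u1, hl4]) (by simp [u3, u2])).of_eq (by simp [u3, u4]) le_rfl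
  have hlenE : (outRev (acc.map encodeNat ++ List.replicate Z [])).length ≤ P * (2 * n) := by
    rw [← List.length_reverse, reverse_outRev, encVec_pad_zero]
    have hall : ∀ v ∈ acc ++ List.replicate Z 0, v < N := fun v hv => by
      rcases List.mem_append.1 hv with hv | hv
      · exact hacc v hv
      · rw [List.eq_of_mem_replicate hv]; exact hN0
    have := length_encVec_le_of_lt hall (show (encodeNat N).length + 1 ≤ n by omega)
    have hlen : (acc ++ List.replicate Z 0).length = P := by simp [hZ0, hcnt0]; omega
    rw [hlen] at this; exact this
  have h5 : Runs (pour (Sum.inr (h .L4)) (Sum.inr (h .A1V))) (base (hSt h T u4))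
      (base (hSt h T { u with x2 := [], x4 := [], blk := encodeNat (a2K P m), l4 := [], a1v := encVec (acc ++ List.replicate (P - acc.length) 0) })) (3 * (P * (2 * n)) + 1) := by
    refine (runs_opour (a := h .L4) (b := h .A1V) (hq_ne h (by decide)) (hSt h T u4)).of_eq ?_ ?_
    · simp [u4, u3, u2, u1, ha1v, hx3, hu1, reverse_outRev, encVec_pad_zero, hZ0, hcnt0]
    · simp only [hSt_L4, u4]; omega
  refine (h1.seq (h2.seq (h3.seq (h4.seq h5)))).of_eq rfl ?_
  have hZP : Z ≤ P := Nat.sub_le _ _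
  have : (encodeNat Z).length * (16 * Z + 21) + 5 ≤ n * (16 * P + 21) + 5 := by
    have := Nat.mul_le_mul hlZ (show 16 * Z + 21 ≤ 16 * P + 21 by omega); omega
  simp only [a2SixPCost, ← hc3]; nlinarith

/-- The parameters of Algorithm 1 (`c := C`, `m`), Algorithm 1, and the collection of its factor. [folklore] -/
def a2SixR : Com (EReg ⊕ β) :=
  ((NS.ofList [.copy (h .A2C) (h .A1C), .copy (h .A2Y) (h .BLM)] : NS β).com) ;; (alg1 h ;;
  (whenCons h .A1G ((NS.ofList [.move (h .A1G) (h .A2P), .const (h .A2Q) [true]] : NS β).com) skip ;;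
   ((NS.ofList [.clear (h .BLFP), .clear (h .BLG), .clear (h .A1AI), .clear (h .A1I), .clear (h .A1C), .clear (h .BLM), .clear (h .BLK), .clear (h .A1P)] : NS β).com)))

/-- Cost of `a2SixR`. [folklore] -/
def a2SixRCost (n e k m : ℕ) : ℕ := 26 * (n + 1) ^ 3 + (alg1Cost n e k m + ((1 + 12 * (n + 1) ^ 3 + 2) + 24 * (n + 1) ^ 3))

/-- **Algorithm 1 on the padded values and the collection of its factor.** [folklore] -/
theorem runs_a2SixR {N e n k α C m : ℕ} (hNodd : Odd N) (hN1 : 1 < N) (hn : 2 * (encodeNat N).length + 8 ≤ n) (hen : 2 * e + 6 ≤ n) (hk : 1 ≤ k)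
    (hkn : 2 * k + 4 ≤ n) (hm : 1 ≤ m) (hmN : m ≤ N) (hkm : 2 ^ e + m ≤ 2 ^ (k - 1)) (hαN : α < N) (hCN : C < N)
    (T : Regs β) (hI : DrvInv (rGH h) N T) (hCI : T (h (.g .CINV)) = encodeNat (NegFFT.inv2N N))
    (u : HSlots) (hw : u.gw.Clean) (hsched : u.gw.sched = []) (hhist : u.gw.hist = []) (hbg : u.gw.bg = []) (hkn' : u.gw.kn = []) (hbf : u.gw.bf = [])
    {vs : List ℕ} (hvs : vs.length = 2 ^ e) (hvN : ∀ v ∈ vs, v < N)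
    (ha1v : u.a1v = encVec vs) (ha1p : u.a1p = encodeNat e) (hbla : u.bla = encodeNat α) (ha2c : u.a2c = encodeNat C) (ha2y : u.a2y = encodeNat m)
    (hblk : u.blk = encodeNat k) (hblpow : u.blpow = encodeNat 2) (ha2p : u.a2p = []) (ha2q : u.a2q = []) (ha1c : u.a1c = []) (hblm : u.blm = [])
    (hl1 : u.l1 = []) (hx1 : u.x1 = []) (hx2 : u.x2 = []) (hx3 : u.x3 = []) (hx4 : u.x4 = []) (hx5 : u.x5 = []) (hx6 : u.x6 = [])
    (hfl1 : u.fl1 = []) (hfl2 : u.fl2 = []) (hu1 : u.u1 = []) (hl4 : u.l4 = []) (hptk : u.ptk = []) (hptu : u.ptu = []) (hblf : u.blf = [])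
    (hble : u.ble = []) (hblc1 : u.blc1 = []) (hblc2 : u.blc2 = []) (hblout : u.blout = []) (ha1i : u.a1i = []) (ha1ai : u.a1ai = []) (ha1g : u.a1g = [])
    (hblg : u.blg = []) (hblfp : u.blfp = []) :
    let o := alg1Out N α C m k e ((NegFFT.prodTreeH N e vs).headD []) vs
    Runs (a2SixR h) (base (hSt h T u))
      (base (hSt h T { u with a1v := [], a1p := [], blk := [], a2p := encOpt o.1, a2q := flagOpt o.1 })) (a2SixRCost n e k m) := by
  intro o
  have hN0 : 0 < N := by omega
  set c := (n + 1) ^ 3 with hc3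
  have hlN : (encodeNat N).length ≤ n := by omega
  have hlC : (encodeNat C).length ≤ n := (Brick.length_encodeNat_mono hCN.le).trans hlN
  have hlm : (encodeNat m).length ≤ n := (Brick.length_encodeNat_mono hmN).trans hlN
  have hle : (encodeNat e).length ≤ n := (length_encodeNat_le_self _).trans (by omega)
  have hlk : (encodeNat k).length ≤ n := (length_encodeNat_le_self _).trans (by omega)
  obtain ⟨b, hb, -, -, -⟩ := NegFFT.prodTreeH_spec hNodd hN1 (e := e) hvs
  have hhead : (NegFFT.prodTreeH N e vs).headD [] = b := by rw [hb]; rfl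
  have ho0 : o = alg1Out N α C m k e b vs := by simp only [o, hhead]
  let u1 : HSlots := { u with a1c := encodeNat C, blm := encodeNat m }
  have h1 : Runs ((NS.ofList [.copy (h .A2C) (h .A1C), .copy (h .A2Y) (h .BLM)] : NS β).com) (base (hSt h T u)) (base (hSt h T u1)) (26 * c) := by
    refine NS.runs_of_eq (N := n) _ _ ?_ (by simp [u1, ha1c, hblm, ha2c, ha2y]) (by simp [hc3])
    simp (config := { decide := true }) only [NS.ofList, NS.ok, NOp.ok, NS.eval, NOp.eval, hSt_A2C, hSt_A1C, hSt_A2Y, update_hSt_A1C, ha2c, ha2y,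
      ne_eq, EmbeddingLike.apply_eq_iff_eq, not_false_eq_true, hlC, hlm, and_self]
  have h2 := runs_alg1 h (e := e) (k := k) (cc := C) (m := m) hNodd hN1 (by omega) hen hk hkn hm hkm hαN hCN T hI hCI u1 hw hsched hhist hbg hkn' hbf hvs hvN hb
    (by simp [u1, ha1v]) (by simp [u1, ha1p]) (by simp [u1, hbla]) (by simp [u1]) (by simp [u1]) (by simp [u1, hblk]) (by simp [u1, hblpow])
    (by simp [u1, hl1]) (by simp [u1, hx1]) (by simp [u1, hx2]) (by simp [u1, hx3]) (by simp [u1, hx4]) (by simp [u1, hx5]) (by simp [u1, hx6])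
    (by simp [u1, hfl1]) (by simp [u1, hfl2]) (by simp [u1, hu1]) (by simp [u1, hl4]) (by simp [u1, hptk]) (by simp [u1, hptu]) (by simp [u1, hblf])
    (by simp [u1, hble]) (by simp [u1, hblc1]) (by simp [u1, hblc2]) (by simp [u1, hblout]) (by simp [u1, ha1i]) (by simp [u1, ha1ai]) (by simp [u1, ha1g])
    (by simp [u1, hblg]) (by simp [u1, hblfp])
  rw [← ho0] at h2
  let u2 : HSlots := u1.alg1Final o
  let u3 : HSlots := { u2 with a1g := [], a2p := encOpt o.1, a2q := flagOpt o.1 }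
  have h3 : Runs (whenCons h .A1G ((NS.ofList [.move (h .A1G) (h .A2P), .const (h .A2Q) [true]] : NS β).com) skip) (base (hSt h T u2)) (base (hSt h T u3)) (1 + 12 * c + 2) := by
    rcases hg : o.1 with _ | g
    · have hst : hSt h T u2 = hSt h T u3 := by simp [u3, u2, HSlots.alg1Final, hg, encOpt, flagOpt, ha2p, ha2q, u1]
      refine (runs_whenCons_nil h .A1G _ (hSt h T u2) (by simp [u2, HSlots.alg1Final, hg, encOpt]) (Runs.skip _)).of_eq (by rw [hst]) (by omega)
    · have hgf := alg1Out_factor (α := α) (cc := C) (m := m) (k := k) (e := e) (b := b) (vs := vs) hN1 (by rw [← ho0]; exact hg)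
      have hlg : (encodeNat g).length ≤ n := (Brick.length_encodeNat_mono hgf.2.1.le).trans hlN
      obtain ⟨bb, w, hbw⟩ := encodeNat_eq_cons (show 0 < g by omega)
      refine (runs_whenCons_cons h .A1G skip (hSt h T u2) (bb := bb) (w := w) (by simp [u2, HSlots.alg1Final, hg, encOpt, hbw]) ?_).of_eq rfl le_rfl
      refine NS.runs_of_eq (N := n) _ _ ?_ ?_ (by simp [hc3])
      · simp (config := { decide := true }) only [NS.ofList, NS.ok, NOp.ok, NS.eval, NOp.eval, hSt_A1G, hSt_A2P, hSt_A2Q, update_hSt_A1G, update_hSt_A2P, u2, u1,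
          HSlots.alg1Final, hg, encOpt, ha2p, ha2q, ne_eq, EmbeddingLike.apply_eq_iff_eq, not_false_eq_true, hlg, List.length_nil, List.length_cons, zero_le, true_and, and_true]
        omega
      · simp [u3, u2, u1, HSlots.alg1Final, hg, encOpt, flagOpt, ha2p]
  obtain ⟨hx2', hx3', -⟩ := alg1Out_index_facts N α C m k e b vs
  have hlblg : (encOpt o.2.1).length ≤ n := by
    rcases hq : o.2.1 with _ | i₀
    · simp [encOpt]
    · have := hx2' i₀ (by rw [← ho0]; exact hq); exact (Brick.length_encodeNat_mono (show i₀ ≤ N by omega)).trans hlN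
  have hla1i : (encOpt o.2.2).length ≤ n := by
    rcases hq : o.2.2 with _ | h₀
    · simp [encOpt]
    · have := hx3' h₀ (by rw [← ho0]; exact hq)
      exact (length_encodeNat_le_succ this.le).trans (by omega)
  have hflag : ∀ x : Option ℕ, (flagOpt x).length ≤ n := fun x => by
    cases x <;> simp [flagOpt]
    all_goals omega
  have h4 : Runs ((NS.ofList [.clear (h .BLFP), .clear (h .BLG), .clear (h .A1AI), .clear (h .A1I), .clear (h .A1C), .clear (h .BLM), .clear (h .BLK), .clear (h .A1P)] : NS β).com)
      (base (hSt h T u3)) (base (hSt h T { u with a1v := [], a1p := [], blk := [], a2p := encOpt o.1, a2q := flagOpt o.1 })) (24 * c) := by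
    refine NS.runs_of_eq (N := n) _ _ ?_ ?_ (by simp [hc3])
    · simp only [NS.ofList, NS.ok, NOp.ok, NS.eval, NOp.eval, hSt_BLFP, hSt_BLG, hSt_A1AI, hSt_A1I, hSt_A1C, hSt_BLM, hSt_BLK, hSt_A1P,
        update_hSt_BLFP, update_hSt_BLG, update_hSt_A1AI, update_hSt_A1I, update_hSt_A1C, update_hSt_BLM, update_hSt_BLK, u3, u2, u1, HSlots.alg1Final, ha1p, hblk]
      exact ⟨hflag _, hlblg, hflag _, hla1i, hlC, by simp, hlk, hle, trivial⟩
    · simp [u3, u2, u1, HSlots.alg1Final, hl1, hx1, hfl2, hblout, hptk, hptu, hblf, hblg, hblfp, ha1ai, ha1i, ha1g, ha1c, hblm]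
  refine (h1.seq (h2.seq (h3.seq h4))).of_eq rfl ?_
  simp only [a2SixRCost, ← hc3]; omega

/-- Sizes below `64N²`, intrinsically. [folklore] -/
theorem a2_len64' {N : ℕ} (hN1 : 1 < N) {y : ℕ} (hy : y ≤ 64 * N * N) : (encodeNat y).length ≤ 2 * (encodeNat N).length + 6 := by
  have hN0 : 0 < N := by omega
  have h1 : (encodeNat (2 * N)).length = (encodeNat N).length + 1 := by rw [encodeNat_two_mul _ hN0]; rfl
  have h2 : (encodeNat (2 * (2 * N))).length = (encodeNat (2 * N)).length + 1 := by rw [encodeNat_two_mul _ (by omega)]; rfl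
  have h3 : (encodeNat (2 * (2 * (2 * N)))).length = (encodeNat (2 * (2 * N))).length + 1 := by rw [encodeNat_two_mul _ (by omega)]; rfl
  have h4 := length_encodeNat_mul_le (2 * (2 * (2 * N))) (2 * (2 * (2 * N)))
  have h5 := Brick.length_encodeNat_mono (show y ≤ 2 * (2 * (2 * N)) * (2 * (2 * (2 * N))) by nlinarith)
  omega

/-- Step 4: the count, the numerics, the padding, Algorithm 1. [folklore] -/
def a2Six : Com (EReg ⊕ β) := a2Cnt h ;; (a2SixE h ;; (a2SixP h ;; a2SixR h))

/-- The padded value list handed to Algorithm 1. [folklore] -/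
def a2Vals (acc : List ℕ) : List ℕ := acc ++ List.replicate (2 ^ a2E acc.length - acc.length) 0

/-- The outcome of Step 4: the factor reported by Algorithm 1 on the unmatched values. [folklore] -/
def a2SixOut (N α C m : ℕ) (acc : List ℕ) : Option ℕ :=
  let e := a2E acc.length
  (alg1Out N α C m (a2K (2 ^ e) m) e ((NegFFT.prodTreeH N e (a2Vals acc)).headD []) (a2Vals acc)).1

/-- Cost of Step 4 on `cnt` values. [folklore] -/
def a2SixCost (n m cnt : ℕ) : ℕ :=
  (cnt * (83 * (n + 1) ^ 3 + 2) + 1) + ((175 * (n + 1) ^ 3 + (n * (16 * n + 21) + 3 * n + 7)) +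
    (a2SixPCost n (2 ^ a2E cnt) + a2SixRCost n (a2E cnt) (a2K (2 ^ a2E cnt) m) m))

/-- Facts about the padded values. [folklore] -/
theorem a2Vals_facts {N : ℕ} (hN0 : 0 < N) {acc : List ℕ} (hacc : ∀ v ∈ acc, v < N) (hne : acc ≠ []) :
    (a2Vals acc).length = 2 ^ a2E acc.length ∧ (∀ v ∈ a2Vals acc, v < N) ∧ (∀ v ∈ a2Vals acc, v ∈ acc ∨ v = 0) := by
  have hc1 : 1 ≤ acc.length := by cases acc with | nil => exact absurd rfl hne | cons _ _ => simp
  obtain ⟨hle, -⟩ := a2E_facts hc1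
  refine ⟨by simp [a2Vals]; omega, fun v hv => ?_, fun v hv => ?_⟩
  · rcases List.mem_append.1 hv with hv | hv
    · exact hacc v hv
    · rw [List.eq_of_mem_replicate hv]; exact hN0
  · rcases List.mem_append.1 hv with hv | hv
    · exact Or.inl hv
    · exact Or.inr (List.eq_of_mem_replicate hv)

/-- **Step 4 of Algorithm 2.** [folklore] -/
theorem runs_a2Six {N n α C m : ℕ} (hNodd : Odd N) (hN1 : 1 < N) (hn4 : 4 * (encodeNat N).length + 20 ≤ n) (hm : 1 ≤ m) (hmN : m ≤ N) (hαN : α < N) (hCN : C < N)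
    (T : Regs β) (hI : DrvInv (rGH h) N T) (hCI : T (h (.g .CINV)) = encodeNat (NegFFT.inv2N N))
    (u : HSlots) (hw : u.gw.Clean) (hsched : u.gw.sched = []) (hhist : u.gw.hist = []) (hbg : u.gw.bg = []) (hkn' : u.gw.kn = []) (hbf : u.gw.bf = [])
    (acc : List ℕ) (hacc : ∀ v ∈ acc, v < N) (hne : acc ≠ []) (hcnt : acc.length ≤ 16 * N * N)
    (hbla : u.bla = encodeNat α) (ha2c : u.a2c = encodeNat C) (ha2y : u.a2y = encodeNat m) (hblpow : u.blpow = encodeNat 2)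
    (ha2p : u.a2p = []) (ha2q : u.a2q = []) (ha1c : u.a1c = []) (hblm : u.blm = []) (ha1v : u.a1v = []) (ha1p : u.a1p = []) (hblk : u.blk = [])
    (hl1 : u.l1 = []) (hx1 : u.x1 = []) (hx2 : u.x2 = []) (hx3 : u.x3 = []) (hx4 : u.x4 = []) (hx5 : u.x5 = []) (hx6 : u.x6 = [])
    (hfl1 : u.fl1 = []) (hfl2 : u.fl2 = []) (hu1 : u.u1 = []) (hptk : u.ptk = []) (hptu : u.ptu = []) (hblf : u.blf = [])
    (hble : u.ble = []) (hblc1 : u.blc1 = []) (hblc2 : u.blc2 = []) (hblout : u.blout = []) (ha1i : u.a1i = []) (ha1ai : u.a1ai = []) (ha1g : u.a1g = [])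
    (hblg : u.blg = []) (hblfp : u.blfp = []) :
    Runs (a2Six h) (base (hSt h T { u with l4 := outRev (acc.map encodeNat), a2l2 := List.replicate acc.length true }))
      (base (hSt h T { u with l4 := [], a2l2 := [], a2p := encOpt (a2SixOut N α C m acc), a2q := flagOpt (a2SixOut N α C m acc) })) (a2SixCost n m acc.length) := by
  have hN0 : 0 < N := by omega
  have hn : 2 * (encodeNat N).length + 8 ≤ n := by omega
  set cnt := acc.length with hcnt0
  have hc1 : 1 ≤ cnt := by rw [hcnt0]; cases acc with | nil => exact absurd rfl hne | cons _ _ => simp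
  set e := a2E cnt with he0
  set P := 2 ^ e with hP0
  obtain ⟨hcP, hP2⟩ := a2E_facts hc1
  rw [← he0, ← hP0] at hcP hP2
  have hP32 : P ≤ 32 * N * N := by nlinarith
  set k := a2K P m with hk0
  obtain ⟨hkm, hk1⟩ := a2K_facts P m
  rw [← hk0] at hkm hk1
  have hle : e ≤ 2 * (encodeNat N).length + 6 := by
    rw [he0, a2E]; exact a2_len64' hN1 (by nlinarith [Nat.sub_le cnt 1])
  have hlk : k ≤ 2 * (encodeNat N).length + 7 := by
    rw [hk0, a2K]; have := a2_len64' hN1 (y := P + m) (by nlinarith); omega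
  have hlcnt : (encodeNat cnt).length ≤ n := a2_len64 hN1 hn (by nlinarith)
  obtain ⟨hvs, hvN, -⟩ := a2Vals_facts hN0 hacc hne
  rw [← hcnt0, ← he0, ← hP0] at hvs
  -- the count
  let u0 : HSlots := { u with l4 := outRev (acc.map encodeNat) }
  have h1 : Runs (a2Cnt h) (base (hSt h T { u with l4 := outRev (acc.map encodeNat), a2l2 := List.replicate acc.length true })) (base (hSt h T { u0 with a2l2 := [], x2 := encodeNat cnt }))
      (cnt * (83 * (n + 1) ^ 3 + 2) + 1) :=
    (runs_a2Cnt h (L := cnt) hlcnt T u0 (by simp [u0, hx2]) (by simp [u0, hx4])).of_eq (by simp [u0, hcnt0]) le_rfl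
  let u1 : HSlots := { u0 with a2l2 := [], x2 := encodeNat cnt }
  have h2 := runs_a2SixE h (N := N) (cnt := cnt) hn (by nlinarith) hN1 hc1 T hI u1 (by simp [u1]) (by simp [u1, u0, hx3]) (by simp [u1, u0, hx4]) (by simp [u1, u0, ha1p])
  rw [← he0, ← hP0] at h2
  let u2 : HSlots := { u1 with a1p := encodeNat e, x4 := encodeNat P }
  have h3 := runs_a2SixP h (N := N) (P := P) (m := m) hN1 hn hP32 hmN T u2 acc hacc (by rw [← hcnt0]; exact hcP) (by simp [u2, u1, hcnt0]) (by simp [u2]) (by simp [u2, u1, u0, ha2y])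
    (by simp [u2, u1, u0]) (by simp [u2, u1, u0, hx3]) (by simp [u2, u1, u0, hx5]) (by simp [u2, u1, u0, hx6]) (by simp [u2, u1, u0, hblk]) (by simp [u2, u1, u0, hu1])
    (by simp [u2, u1, u0, ha1v])
  rw [← hk0] at h3
  have hvals : acc ++ List.replicate (P - acc.length) 0 = a2Vals acc := by rw [a2Vals, ← hcnt0, ← he0, ← hP0]
  rw [hvals] at h3
  let u3 : HSlots := { u2 with x2 := [], x4 := [], blk := encodeNat k, l4 := [], a1v := encVec (a2Vals acc) }
  have h4 := runs_a2SixR h (e := e) (k := k) (C := C) (m := m) hNodd hN1 hn (by omega) hk1 (by omega) hm hmN hkm hαN hCN T hI hCI u3 hw hsched hhist hbg hkn' hbf hvs hvN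
    (by simp [u3]) (by simp [u3, u2]) (by simp [u3, u2, u1, u0, hbla]) (by simp [u3, u2, u1, u0, ha2c]) (by simp [u3, u2, u1, u0, ha2y]) (by simp [u3]) (by simp [u3, u2, u1, u0, hblpow])
    (by simp [u3, u2, u1, u0, ha2p]) (by simp [u3, u2, u1, u0, ha2q]) (by simp [u3, u2, u1, u0, ha1c]) (by simp [u3, u2, u1, u0, hblm])
    (by simp [u3, u2, u1, u0, hl1]) (by simp [u3, u2, u1, u0, hx1]) (by simp [u3]) (by simp [u3, u2, u1, u0, hx3]) (by simp [u3]) (by simp [u3, u2, u1, u0, hx5]) (by simp [u3, u2, u1, u0, hx6])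
    (by simp [u3, u2, u1, u0, hfl1]) (by simp [u3, u2, u1, u0, hfl2]) (by simp [u3, u2, u1, u0, hu1]) (by simp [u3]) (by simp [u3, u2, u1, u0, hptk]) (by simp [u3, u2, u1, u0, hptu])
    (by simp [u3, u2, u1, u0, hblf]) (by simp [u3, u2, u1, u0, hble]) (by simp [u3, u2, u1, u0, hblc1]) (by simp [u3, u2, u1, u0, hblc2]) (by simp [u3, u2, u1, u0, hblout])
    (by simp [u3, u2, u1, u0, ha1i]) (by simp [u3, u2, u1, u0, ha1ai]) (by simp [u3, u2, u1, u0, ha1g]) (by simp [u3, u2, u1, u0, hblg]) (by simp [u3, u2, u1, u0, hblfp])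
  have hout : (alg1Out N α C m k e ((NegFFT.prodTreeH N e (a2Vals acc)).headD []) (a2Vals acc)).1 = a2SixOut N α C m acc := by
    simp only [a2SixOut, ← hcnt0, ← he0, ← hP0, ← hk0]
  simp only [hout] at h4
  refine (h1.seq (h2.seq (h3.seq h4))).of_eq ?_ ?_
  · simp [u3, u2, u1, u0, hx2, hx4, ha1v, ha1p, hblk]
  · simp only [a2SixCost, ← he0, ← hP0, ← hk0]; omega

/-- The end of Algorithm 2: Step 4 unless a factor is known or no value is left; clean-up. [folklore] -/
def a2Fin : Com (EReg ⊕ β) :=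
  whenNot h .A2Q (whenCons h .A2L2 (a2Six h) skip) ;; (clear (Sum.inr (h .L4)) ;; clear (Sum.inr (h .A2L2)))

/-- The outcome of the end of Algorithm 2. [folklore] -/
def a2FinOut (N α C m : ℕ) (fnd : Option ℕ) (acc : List ℕ) : Option ℕ :=
  match fnd with
  | some g => some g
  | none => if acc = [] then none else a2SixOut N α C m acc

/-- Cost of the end of Algorithm 2. [folklore] -/
def a2FinCost (n m cnt : ℕ) : ℕ := (a2SixCost n m cnt + 5) + ((2 * (cnt * (2 * n)) + 1) + (2 * cnt + 1))

/-- **The end of Algorithm 2.** [folklore] -/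
theorem runs_a2Fin {N n α C m : ℕ} (hNodd : Odd N) (hN1 : 1 < N) (hn4 : 4 * (encodeNat N).length + 20 ≤ n) (hm : 1 ≤ m) (hmN : m ≤ N) (hαN : α < N) (hCN : C < N)
    (T : Regs β) (hI : DrvInv (rGH h) N T) (hCI : T (h (.g .CINV)) = encodeNat (NegFFT.inv2N N))
    (u : HSlots) (hw : u.gw.Clean) (hsched : u.gw.sched = []) (hhist : u.gw.hist = []) (hbg : u.gw.bg = []) (hkn' : u.gw.kn = []) (hbf : u.gw.bf = [])
    (fnd : Option ℕ) (acc : List ℕ) (hacc : ∀ v ∈ acc, v < N) (hcnt : acc.length ≤ 16 * N * N)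
    (hbla : u.bla = encodeNat α) (ha2c : u.a2c = encodeNat C) (ha2y : u.a2y = encodeNat m) (hblpow : u.blpow = encodeNat 2)
    (ha1c : u.a1c = []) (hblm : u.blm = []) (ha1v : u.a1v = []) (ha1p : u.a1p = []) (hblk : u.blk = [])
    (hl1 : u.l1 = []) (hx1 : u.x1 = []) (hx2 : u.x2 = []) (hx3 : u.x3 = []) (hx4 : u.x4 = []) (hx5 : u.x5 = []) (hx6 : u.x6 = [])
    (hfl1 : u.fl1 = []) (hfl2 : u.fl2 = []) (hu1 : u.u1 = []) (hptk : u.ptk = []) (hptu : u.ptu = []) (hblf : u.blf = [])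
    (hble : u.ble = []) (hblc1 : u.blc1 = []) (hblc2 : u.blc2 = []) (hblout : u.blout = []) (ha1i : u.a1i = []) (ha1ai : u.a1ai = []) (ha1g : u.a1g = [])
    (hblg : u.blg = []) (hblfp : u.blfp = []) :
    Runs (a2Fin h) (base (hSt h T { u with l4 := outRev (acc.map encodeNat), a2l2 := List.replicate acc.length true, a2p := encOpt fnd, a2q := flagOpt fnd }))
      (base (hSt h T { u with l4 := [], a2l2 := [], a2p := encOpt (a2FinOut N α C m fnd acc), a2q := flagOpt (a2FinOut N α C m fnd acc) })) (a2FinCost n m acc.length) := by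
  have hN0 : 0 < N := by omega
  have hlenE : (outRev (acc.map encodeNat)).length ≤ acc.length * (2 * n) := by
    rw [← List.length_reverse, reverse_outRev]
    exact length_encVec_le_of_lt hacc (show (encodeNat N).length + 1 ≤ n by omega)
  let uS : HSlots := { u with l4 := outRev (acc.map encodeNat), a2l2 := List.replicate acc.length true, a2p := encOpt fnd, a2q := flagOpt fnd }
  set res := a2FinOut N α C m fnd acc with hres
  let uM : HSlots := { uS with a2p := encOpt res, a2q := flagOpt res }
  -- the guarded step
  have hA : ∃ uA : HSlots, Runs (whenNot h .A2Q (whenCons h .A2L2 (a2Six h) skip)) (base (hSt h T uS)) (base (hSt h T uA)) (a2SixCost n m acc.length + 5) ∧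
      (uA = uM ∨ uA = { uM with l4 := [], a2l2 := [] }) := by
    rcases fnd with _ | g
    · by_cases hacc0 : acc = []
      · refine ⟨uS, (runs_whenNot_nil h (hSt h T uS) (by simp [uS, flagOpt]) (runs_whenCons_nil h .A2L2 _ (hSt h T uS) (by simp [uS, hacc0]) (Runs.skip _))).of_eq rfl (by omega), Or.inl ?_⟩
        simp [uM, uS, hres, a2FinOut, hacc0]
      · have hsix := runs_a2Six h hNodd hN1 hn4 hm hmN hαN hCN T hI hCI { u with a2p := encOpt (none : Option ℕ), a2q := flagOpt (none : Option ℕ) } hw hsched hhist hbg hkn' hbf acc hacc hacc0 hcnt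
          hbla ha2c ha2y hblpow (by simp [encOpt]) (by simp [flagOpt]) ha1c hblm ha1v ha1p hblk hl1 hx1 hx2 hx3 hx4 hx5 hx6 hfl1 hfl2 hu1 hptk hptu hblf hble hblc1 hblc2 hblout ha1i ha1ai ha1g hblg hblfp
        have hc1 : 1 ≤ acc.length := by cases acc with | nil => exact absurd rfl hacc0 | cons _ _ => simp
        have hst : ({ ({ u with a2p := encOpt (none : Option ℕ), a2q := flagOpt (none : Option ℕ) } : HSlots) with l4 := outRev (acc.map encodeNat), a2l2 := List.replicate acc.length true } : HSlots) = uS := by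
          simp [uS]
        rw [hst] at hsix
        refine ⟨_, (runs_whenNot_nil h (hSt h T uS) (by simp [uS, flagOpt]) (runs_whenCons_cons h .A2L2 skip (hSt h T uS) (bb := true) (w := List.replicate (acc.length - 1) true)
          (by simp only [hSt_A2L2, uS]; obtain ⟨k, hk⟩ : ∃ k, acc.length = k + 1 := ⟨acc.length - 1, by omega⟩; rw [hk, List.replicate_succ, Nat.add_sub_cancel]) hsix)).of_eq rfl (by omega),
          Or.inr ?_⟩
        simp [uM, uS, hres, a2FinOut, hacc0, encOpt, flagOpt]
    · refine ⟨uS, (runs_whenNot_true h _ (hSt h T uS) (by simp [uS, flagOpt])).of_eq rfl (by omega), Or.inl ?_⟩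
      simp [uM, uS, hres, a2FinOut]
  obtain ⟨uA, hrun, hA⟩ := hA
  have hl4A : uA.l4 = [] ∨ uA.l4 = outRev (acc.map encodeNat) := by rcases hA with rfl | rfl <;> simp [uM, uS]
  have ha2l2A : uA.a2l2 = [] ∨ uA.a2l2 = List.replicate acc.length true := by rcases hA with rfl | rfl <;> simp [uM, uS]
  have hfinal : ({ uA with l4 := [], a2l2 := [] } : HSlots) = { u with l4 := [], a2l2 := [], a2p := encOpt res, a2q := flagOpt res } := by
    rcases hA with rfl | rfl <;> simp [uM, uS]
  have h2 : Runs (clear (Sum.inr (h .L4))) (base (hSt h T uA)) (base (hSt h T { uA with l4 := [] })) (2 * (acc.length * (2 * n)) + 1) := by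
    refine (runs_oclear (h .L4) (hSt h T uA)).of_eq (by simp) ?_
    rcases hl4A with h0 | h0 <;> simp only [hSt_L4, h0, List.length_nil] <;> omega
  have h3 : Runs (clear (Sum.inr (h .A2L2))) (base (hSt h T { uA with l4 := [] })) (base (hSt h T { uA with l4 := [], a2l2 := [] })) (2 * acc.length + 1) := by
    refine (runs_oclear (h .A2L2) (hSt h T { uA with l4 := [] })).of_eq (by simp) ?_
    rcases ha2l2A with h0 | h0 <;> simp only [hSt_A2L2, h0, List.length_nil, List.length_replicate] <;> omega
  rw [hfinal] at h3
  exact (hrun.seq (h2.seq h3)).of_eq rfl (by simp only [a2FinCost]; omega)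

end AlgTwoFinal

section AlgTwoGlue

/-! #### Algorithm 2 assembled -/

/-- The baby-step words are good. [folklore] -/
theorem babyWords_good {N α C nb m r : ℕ} (hN0 : 0 < N) : ∀ w ∈ babyWords N α C nb m, GoodWord N m r nb w := by
  intro w hw
  simp only [babyWords, List.mem_map, List.mem_range] at hw
  obtain ⟨i, hi, rfl⟩ := hw
  exact Or.inl ⟨_, i, Nat.mod_lt _ hN0, hi, rfl⟩

/-- The giant-step values are residues. [folklore] -/
theorem gVal_lt {N α m r a b : ℕ} (hN0 : 0 < N) : ∀ jj, gVal N α m r a b jj < N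
  | 0 => Nat.mod_lt _ hN0
  | _ + 1 => Nat.mod_lt _ hN0

/-- The giant-step indices are small: `(J − 1) m ≤ N`, `J − 1 ≤ N`. [folklore] -/
theorem jCount_pred_facts {N m r a b : ℕ} (hN1 : 1 < N) (hr1 : 1 ≤ r) (hm1 : 1 ≤ m) : (jCount N m r a b - 1) * m ≤ N ∧ jCount N m r a b - 1 ≤ N := by
  have hsq : Nat.sqrt N + 1 ≤ N := by have := Nat.sqrt_lt_self hN1; omega
  set S := Nat.sqrt N + 1 with hS
  have hJ : jCount N m r a b - 1 = S / (4 * r * m * Nat.sqrt (a * b)) := by simp [jCount, hS]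
  have h1 : S / (4 * r * m * Nat.sqrt (a * b)) ≤ S / (4 * r * m) := by
    rcases Nat.eq_zero_or_pos (Nat.sqrt (a * b)) with hq | hq
    · rw [hq, mul_zero, Nat.div_zero]; exact Nat.zero_le _
    · exact Nat.div_le_div_left (Nat.le_mul_of_pos_right _ hq) (by positivity)
  have h2 : S / (4 * r * m) * m ≤ S := by
    rw [show 4 * r * m = (4 * r) * m by ring, ← Nat.div_div_eq_div_mul]
    exact (Nat.div_mul_le_self _ _).trans (Nat.div_le_self _ _)
  have h3 : S / (4 * r * m) ≤ S := Nat.div_le_self _ _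
  rw [hJ]
  exact ⟨(Nat.mul_le_mul_right m h1).trans (h2.trans hsq), h1.trans (h3.trans hsq)⟩

/-- The words of a pair are good. [folklore] -/
theorem pairWords_good {N α m r nb a b jj : ℕ} (hN1 : 1 < N) (hr1 : 1 ≤ r) (hm1 : 1 ≤ m) (ha1 : 1 ≤ a) (hb1 : 1 ≤ b) (habr : a * b ≤ r) :
    ∀ w ∈ pairWords N α m r nb a b jj, GoodWord N m r nb w := by
  intro w hw
  simp only [pairWords, List.mem_map, List.mem_range] at hw
  obtain ⟨i, -, rfl⟩ := hw
  obtain ⟨h1, h2⟩ := jCount_pred_facts (a := a) (b := b) hN1 hr1 hm1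
  refine Or.inr ⟨_, a, b, jCount N m r a b - 1 - i, gVal_lt (by omega) i, ha1, hb1, habr, ?_, ?_, rfl⟩
  · exact (Nat.mul_le_mul_right m (Nat.sub_le _ _)).trans h1
  · exact (Nat.sub_le _ _).trans h2

/-- The words of a row are good. [folklore] -/
theorem rowWords_good {N α m r nb a : ℕ} (hN1 : 1 < N) (hr1 : 1 ≤ r) (hm1 : 1 ≤ m) (ha1 : 1 ≤ a) :
    ∀ bd, a * bd ≤ r → ∀ w ∈ rowWords N α m r nb a bd, GoodWord N m r nb w
  | 0, _ => by simp [rowWords]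
  | bd + 1, hbd => by
    intro w hw
    simp only [rowWords, List.mem_append] at hw
    rcases hw with hw | hw
    · exact rowWords_good hN1 hr1 hm1 ha1 bd (by nlinarith) w hw
    · exact pairWords_good hN1 hr1 hm1 ha1 (by omega) hbd w hw

/-- The giant-step words are good. [folklore] -/
theorem giantWords_good {N α m r nb : ℕ} (hN1 : 1 < N) (hr1 : 1 ≤ r) (hm1 : 1 ≤ m) :
    ∀ ad, ∀ w ∈ giantWords N α m r nb ad, GoodWord N m r nb w
  | 0 => by simp [giantWords]
  | ad + 1 => by
    intro w hw
    simp only [giantWords, List.mem_append] at hw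
    rcases hw with hw | hw
    · exact giantWords_good hN1 hr1 hm1 ad w hw
    · exact rowWords_good hN1 hr1 hm1 (by omega) _ (by rw [mul_comm]; exact Nat.div_mul_le_self r (ad + 1)) w hw

/-- The number of words of a row. [folklore] -/
theorem length_rowWords_le {N α m r nb a : ℕ} (ha1 : 1 ≤ a) (hr1 : 1 ≤ r) (hm1 : 1 ≤ m) :
    ∀ bd, (rowWords N α m r nb a bd).length ≤ bd * a2JStar N m r
  | 0 => by simp [rowWords]
  | bd + 1 => by
    simp only [rowWords, List.length_append, pairWords, List.length_map, List.length_range, Nat.succ_mul]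
    have := length_rowWords_le (N := N) (α := α) (nb := nb) ha1 hr1 hm1 bd
    have := jCount_le_JStar (N := N) (a := a) (b := bd + 1) ha1 (by omega) hr1 hm1
    omega

/-- The number of giant-step words. [folklore] -/
theorem length_giantWords_le {N α m r nb : ℕ} (hr1 : 1 ≤ r) (hm1 : 1 ≤ m) :
    ∀ ad, (giantWords N α m r nb ad).length ≤ ad * (r * a2JStar N m r)
  | 0 => by simp [giantWords]
  | ad + 1 => by
    simp only [giantWords, List.length_append, Nat.succ_mul]
    have h1 := length_giantWords_le (N := N) (α := α) (nb := nb) hr1 hm1 ad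
    have h2 := length_rowWords_le (N := N) (α := α) (m := m) (r := r) (nb := nb) (a := ad + 1) (by omega) hr1 hm1 (r / (ad + 1))
    have h3 : r / (ad + 1) * a2JStar N m r ≤ r * a2JStar N m r := Nat.mul_le_mul_right _ (Nat.div_le_self _ _)
    omega

/-- The total number of words is at most `3N²`. [folklore] -/
theorem length_words_le {N α C m r nb : ℕ} (hN1 : 1 < N) (hr1 : 1 ≤ r) (hrN : r ≤ N) (hm1 : 1 ≤ m) (hmN : m ≤ N) :
    (babyWords N α C nb m ++ giantWords N α m r nb r).length ≤ 3 * N * N := by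
  have hsq : Nat.sqrt N + 1 ≤ N := by have := Nat.sqrt_lt_self hN1; omega
  have h1 := length_giantWords_le (N := N) (α := α) (nb := nb) hr1 hm1 r
  have hJ : r * a2JStar N m r ≤ N + r := by
    simp only [a2JStar, Nat.mul_add, mul_one]
    have : r * ((Nat.sqrt N + 1) / (4 * r * m)) ≤ Nat.sqrt N + 1 := by
      calc r * ((Nat.sqrt N + 1) / (4 * r * m)) ≤ (4 * r * m) * ((Nat.sqrt N + 1) / (4 * r * m)) := Nat.mul_le_mul_right _ (by nlinarith)
        _ ≤ Nat.sqrt N + 1 := Nat.mul_div_le _ _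
    omega
  simp only [List.length_append, babyWords, List.length_map, List.length_range]
  nlinarith

/-- The scan accumulates at most one value per word. [folklore] -/
theorem scanRun_acc_length_le (N m nb : ℕ) : ∀ (sw : List (List Bool)) (st : ScanSt), (scanRun N m nb st sw).acc.length ≤ st.acc.length + sw.length
  | [], st => by simp [scanRun]
  | w :: sw, st => by
    have ih := scanRun_acc_length_le N m nb sw (scanStep N m nb st w)
    have hstep : (scanStep N m nb st w).acc.length ≤ st.acc.length + 1 := by
      unfold scanStep; split_ifs <;> simp
    simp only [scanRun, List.foldl_cons, List.length_cons] at ih ⊢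
    exact ih.trans (by omega)

/-- The shift `C = α^{J* m}`. [folklore] -/
def a2C (N α m r : ℕ) : ℕ := α ^ (a2JStar N m r * m) % N

/-- The words of Algorithm 2 (before sorting). [folklore] -/
def a2Words (N α m r : ℕ) : List (List Bool) :=
  babyWords N α (a2C N α m r) (encodeNat N).length m ++ giantWords N α m r (encodeNat N).length r

/-- The result of the scan of Algorithm 2. [folklore] -/
def a2Res (N α m r : ℕ) : ScanSt := scanRun N m (encodeNat N).length ScanSt.init (radixIter (a2Words N α m r) (encodeNat N).length)

/-- **The outcome of Algorithm 2**: the factor found by Step 1, or by the recovery of Step 3, or by Algorithm 1 in Step 4. [folklore] -/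
def a2Out (N α m r : ℕ) : Option ℕ :=
  match firstHit (powHit N α) (m - 1) with
  | some i₀ => some (powGcd N α (i₀ + 1))
  | none => a2FinOut N α (a2C N α m r) m (a2Res N α m r).found (a2Res N α m r).acc

/-- The number of values handed to Step 4. [folklore] -/
def a2CntOf (N α m r : ℕ) : ℕ :=
  match firstHit (powHit N α) (m - 1) with
  | some _ => 0
  | none => (a2Res N α m r).acc.length

/-- Cost of Steps 2–3 (the lists, the sort, the scan). [folklore] -/
def a2ListsCost (N n α m r : ℕ) : ℕ :=
  a2BabyCost n m + (a2GiantsCost N n m r + (a2SortCost n (encodeNat N).length (a2Words N α m r) + a2ScanCost n (encodeNat N).length (a2Words N α m r).length))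

/-- The words are good. [folklore] -/
theorem a2Words_good {N α m r : ℕ} (hN1 : 1 < N) (hr1 : 1 ≤ r) (hm1 : 1 ≤ m) : ∀ w ∈ a2Words N α m r, GoodWord N m r (encodeNat N).length w := fun w hw => by
  rcases List.mem_append.1 hw with hw | hw
  · exact babyWords_good (by omega) w hw
  · exact giantWords_good hN1 hr1 hm1 r w hw

/-- **Steps 2–3 of Algorithm 2**: the two lists, the sort, the scan. [folklore] -/
theorem runs_a2Lists {N n α m r nb : ℕ} (hN1 : 1 < N) (hn : 2 * (encodeNat N).length + 8 ≤ n) (hnb : (encodeNat N).length = nb)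
    (hαN : α < N) (hm1 : 1 ≤ m) (hmN : m ≤ N) (hr1 : 1 ≤ r) (hrN : r ≤ N) (hrm : 4 * r * m ≤ N) (hnr : 4 * (encodeNat r).length + (encodeNat N).length + 4 ≤ n)
    (T : Regs β) (hI : DrvInv (rGH h) N T) (u : HSlots)
    (hbla : u.bla = encodeNat α) (ha2y : u.a2y = encodeNat m) (ha2r : u.a2r = encodeNat r)
    (ha2d : u.a2d = encodeNat nb) (ha2u : u.a2u = List.replicate nb true) (ha2al : u.a2al = encodeNat (4 * r * m)) (ha2s : u.a2s = encodeNat (Nat.sqrt N + 1))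
    (ha2jj : u.a2jj = encodeNat (a2JStar N m r)) (ha2c : u.a2c = encodeNat (a2C N α m r)) (ha2am : u.a2am = encodeNat (α ^ m % N))
    (ha2p : u.a2p = []) (ha2q : u.a2q = []) (ha2t : u.a2t = []) (ha2j : u.a2j = []) (ha2v : u.a2v = []) (ha2a : u.a2a = []) (ha2b : u.a2b = [])
    (ha2l1 : u.a2l1 = []) (ha2l2 : u.a2l2 = []) (ha2srt : u.a2srt = []) (hl4 : u.l4 = [])
    (hx2 : u.x2 = []) (hx3 : u.x3 = []) (hx4 : u.x4 = []) (hx5 : u.x5 = []) (hx6 : u.x6 = []) (hfl1 : u.fl1 = []) (hfl2 : u.fl2 = [])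
    (hu1 : u.u1 = []) (hu2 : u.u2 = []) (hsq1 : u.sq1 = []) (hsq2 : u.sq2 = []) (hsq3 : u.sq3 = []) (hsq4 : u.sq4 = []) (hsq5 : u.sq5 = [])
    (hrx1 : u.rx1 = []) (hrx2 : u.rx2 = []) (hrx3 : u.rx3 = []) (hrx4 : u.rx4 = []) (hrx5 : u.rx5 = []) (hrx6 : u.rx6 = []) (hrx7 : u.rx7 = []) (hrx8 : u.rx8 = []) (hrx9 : u.rx9 = [])
    (hsfk : u.sfk = []) (hsfe : u.sfe = []) (hsfcand : u.sfcand = []) (hsfbeta : u.sfbeta = []) (hsfdivs : u.sfdivs = []) (hsfr : u.sfr = []) (hsft : u.sft = []) :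
    Runs (a2Baby h ;; (a2Giants h ;; (a2Sort h ;; a2Scan h))) (base (hSt h T u))
      (base (hSt h T { u.scanRegs (a2Res N α m r) with rx1 := [], a2l1 := [], sfcand := [], sfbeta := [], sfdivs := [] })) (a2ListsCost N n α m r) := by
  have hN0 : 0 < N := by omega
  have hCN : a2C N α m r < N := Nat.mod_lt _ hN0
  have hwsGood : ∀ w ∈ a2Words N α m r, GoodWord N m r nb w := by rw [← hnb]; exact a2Words_good hN1 hr1 hm1
  have hswGood : ∀ w ∈ radixIter (a2Words N α m r) nb, GoodWord N m r nb w := fun w hw => hwsGood w ((radixIter_perm _ nb).subset hw)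
  have hswlen : (radixIter (a2Words N α m r) nb).length = (a2Words N α m r).length := length_radixIter _ _
  have hB := runs_a2Baby h (C := a2C N α m r) hN1 hn hnb T hI u hαN hCN hmN [] hbla ha2d ha2c ha2y (by simp [hl4]) (by simp [ha2l1]) ha2t ha2j hu1 hx5 ha2v hx2 hx3 hx4 hu2
  simp only [List.nil_append] at hB
  let uB : HSlots := { u with l4 := outRev (babyWords N α (a2C N α m r) nb m), a2l1 := List.replicate (babyWords N α (a2C N α m r) nb m).length true }
  have hG := runs_a2Giants h hN1 hn hnb T hI uB hαN hrN hm1 hr1 hrm hmN hnr (babyWords N α (a2C N α m r) nb m) (by simp [uB, hbla]) (by simp [uB, ha2r]) (by simp [uB, ha2al])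
    (by simp [uB, ha2s]) (by simp [uB, ha2jj]) (by simp [uB, ha2y]) (by simp [uB, ha2am]) (by simp [uB, ha2d]) (by simp [uB]) (by simp [uB])
    (by simp [uB, ha2a]) (by simp [uB, hu1]) (by simp [uB, ha2b]) (by simp [uB, hsfk]) (by simp [uB, hx2]) (by simp [uB, hx3]) (by simp [uB, hx4])
    (by simp [uB, hx5]) (by simp [uB, hx6]) (by simp [uB, hsfe]) (by simp [uB, hfl1]) (by simp [uB, hsq1]) (by simp [uB, hsq2]) (by simp [uB, hsq3])
    (by simp [uB, hsq4]) (by simp [uB, hsq5]) (by simp [uB, ha2t]) (by simp [uB, hsfcand]) (by simp [uB, hsfr]) (by simp [uB, hsft]) (by simp [uB, ha2j])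
    (by simp [uB, ha2v]) (by simp [uB, hu2])
  have hwsE : babyWords N α (a2C N α m r) nb m ++ giantWords N α m r nb r = a2Words N α m r := by simp only [a2Words, hnb]
  rw [hwsE] at hG
  let uG : HSlots := { uB with l4 := outRev (a2Words N α m r), a2l1 := List.replicate (a2Words N α m r).length true }
  have hS := runs_a2Sort h (n := n) (nb := nb) (by omega) (a2Words N α m r) T uG (by simp [uG]) (by simp [uG, uB, ha2u]) (by simp [uG, uB, hrx1]) (by simp [uG, uB, ha2srt]) (by simp [uG, uB, hrx2])
    (by simp [uG, uB, hrx3]) (by simp [uG, uB, hrx4]) (by simp [uG, uB, hrx5]) (by simp [uG, uB, hrx6]) (by simp [uG, uB, hrx7]) (by simp [uG, uB, hrx8])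
    (by simp [uG, uB, hrx9])
  have hSc := runs_a2Scan h hN1 hn hnb T hI u hrN hmN hnr (radixIter (a2Words N α m r) nb) hswGood ha2u ha2y ha2v hsfk hsfe hfl1 hu2 hx2 hx3 hx4 hx5 hx6 hfl2 hsq1 hsq2 hsq3 hsq4 hsq5
    ha2a ha2b ha2j
  have hform : ({ uG with l4 := [], rx1 := encList (radixIter (a2Words N α m r) nb) } : HSlots) = { u.scanRegs ScanSt.init with rx1 := encList (radixIter (a2Words N α m r) nb), a2l1 := List.replicate (radixIter (a2Words N α m r) nb).length true } := by
    rw [hswlen]; simp [uG, uB, HSlots.scanRegs, ScanSt.init, encOpt, flagOpt, flag, hsfcand, hsfbeta, hsfdivs, ha2p, ha2q, ha2l2]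
  rw [hform] at hS
  have hresE : scanRun N m nb ScanSt.init (radixIter (a2Words N α m r) nb) = a2Res N α m r := by simp only [a2Res, hnb]
  rw [hresE] at hSc
  refine (hB.seq (hG.seq (hS.seq hSc))).of_eq rfl (le_of_eq ?_)
  simp only [a2ListsCost, hnb, hswlen]

/-- **Algorithm 2** on the machine. [folklore] -/
def alg2 : Com (EReg ⊕ β) :=
  a2Init h ;; (a2Pow h ;; (whenNot h .A2Q (a2Baby h ;; (a2Giants h ;; (a2Sort h ;; a2Scan h))) ;; (a2Fin h ;;
    ((NS.ofList [.clear (h .A2D), .clear (h .A2U), .clear (h .A2AL), .clear (h .A2S), .clear (h .A2JJ), .clear (h .A2C), .clear (h .A2AM)] : NS β).com))))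

/-- Cost of Algorithm 2. [folklore] -/
def alg2Cost (N n α m r : ℕ) : ℕ :=
  a2InitCost n + (a2PowCost n m + ((a2ListsCost N n α m r + 2) + (a2FinCost n m (a2CntOf N α m r) + 21 * (n + 1) ^ 3)))

/-- **Algorithm 2 on the machine**: the registers at the end hold `a2Out`. [folklore] -/
theorem runs_alg2 {N n α m r : ℕ} (hNodd : Odd N) (hN1 : 1 < N) (hn4 : 4 * (encodeNat N).length + 20 ≤ n)
    (hαN : α < N) (hm1 : 1 ≤ m) (hmN : m ≤ N) (hr1 : 1 ≤ r) (hrN : r ≤ N) (hrm : 4 * r * m ≤ N) (hnr : 4 * (encodeNat r).length + (encodeNat N).length + 4 ≤ n)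
    (T : Regs β) (hI : DrvInv (rGH h) N T) (hCI : T (h (.g .CINV)) = encodeNat (NegFFT.inv2N N))
    (u : HSlots) (hw : u.gw.Clean) (hsched : u.gw.sched = []) (hhist : u.gw.hist = []) (hbg : u.gw.bg = []) (hkn' : u.gw.kn = []) (hbf : u.gw.bf = [])
    (hbla : u.bla = encodeNat α) (ha2y : u.a2y = encodeNat m) (ha2r : u.a2r = encodeNat r) (hblpow : u.blpow = encodeNat 2)
    (ha2d : u.a2d = []) (ha2u : u.a2u = []) (ha2al : u.a2al = []) (ha2s : u.a2s = []) (ha2jj : u.a2jj = []) (ha2c : u.a2c = []) (ha2am : u.a2am = [])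
    (ha2p : u.a2p = []) (ha2q : u.a2q = []) (ha2t : u.a2t = []) (ha2j : u.a2j = []) (ha2v : u.a2v = []) (ha2a : u.a2a = []) (ha2b : u.a2b = [])
    (ha2l1 : u.a2l1 = []) (ha2l2 : u.a2l2 = []) (ha2srt : u.a2srt = []) (hl4 : u.l4 = [])
    (hx1 : u.x1 = []) (hx2 : u.x2 = []) (hx3 : u.x3 = []) (hx4 : u.x4 = []) (hx5 : u.x5 = []) (hx6 : u.x6 = []) (hfl1 : u.fl1 = []) (hfl2 : u.fl2 = [])
    (hu1 : u.u1 = []) (hu2 : u.u2 = []) (hsq1 : u.sq1 = []) (hsq2 : u.sq2 = []) (hsq3 : u.sq3 = []) (hsq4 : u.sq4 = []) (hsq5 : u.sq5 = [])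
    (hrx1 : u.rx1 = []) (hrx2 : u.rx2 = []) (hrx3 : u.rx3 = []) (hrx4 : u.rx4 = []) (hrx5 : u.rx5 = []) (hrx6 : u.rx6 = []) (hrx7 : u.rx7 = []) (hrx8 : u.rx8 = []) (hrx9 : u.rx9 = [])
    (hsfk : u.sfk = []) (hsfe : u.sfe = []) (hsfcand : u.sfcand = []) (hsfbeta : u.sfbeta = []) (hsfdivs : u.sfdivs = []) (hsfr : u.sfr = []) (hsft : u.sft = [])
    (ha1c : u.a1c = []) (hblm : u.blm = []) (ha1v : u.a1v = []) (ha1p : u.a1p = []) (hblk : u.blk = []) (hl1 : u.l1 = [])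
    (hptk : u.ptk = []) (hptu : u.ptu = []) (hblf : u.blf = []) (hble : u.ble = []) (hblc1 : u.blc1 = []) (hblc2 : u.blc2 = []) (hblout : u.blout = [])
    (ha1i : u.a1i = []) (ha1ai : u.a1ai = []) (ha1g : u.a1g = []) (hblg : u.blg = []) (hblfp : u.blfp = []) :
    Runs (alg2 h) (base (hSt h T u)) (base (hSt h T { u with a2p := encOpt (a2Out N α m r), a2q := flagOpt (a2Out N α m r) })) (alg2Cost N n α m r) := by
  have hN0 : 0 < N := by omega
  have hn : 2 * (encodeNat N).length + 8 ≤ n := by omega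
  set c := (n + 1) ^ 3 with hc3
  have hlN : (encodeNat N).length ≤ n := by omega
  obtain ⟨-, -, hl4rm, hsq, hJN, -⟩ := a2Init_sizes (N := N) hN1 hn hm1 hmN hr1 hrN
  have hCN : a2C N α m r < N := Nat.mod_lt _ hN0
  have hlJ : (encodeNat (a2JStar N m r)).length ≤ n := (Brick.length_encodeNat_mono hJN).trans hlN
  have hlS : (encodeNat (Nat.sqrt N + 1)).length ≤ n := (Brick.length_encodeNat_mono hsq).trans hlN
  have hlC : (encodeNat (a2C N α m r)).length ≤ n := (Brick.length_encodeNat_mono hCN.le).trans hlN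
  have hlam : (encodeNat (α ^ m % N)).length ≤ n := (Brick.length_encodeNat_mono (Nat.mod_lt _ hN0).le).trans hlN
  have hlnb : (encodeNat (encodeNat N).length).length ≤ n := (length_encodeNat_le_self _).trans (by omega)
  -- the size of the unmatched list
  have hacc : ∀ v ∈ (a2Res N α m r).acc, v < N := by
    obtain ⟨-, -, h3⟩ := scanRun_good (r := r) rfl hmN (radixIter (a2Words N α m r) (encodeNat N).length)
      (fun w hw => a2Words_good hN1 hr1 hm1 w ((radixIter_perm _ _).subset hw)) (radixIter (a2Words N α m r) (encodeNat N).length).length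
    rw [List.take_length] at h3; exact h3
  have hcnt : (a2Res N α m r).acc.length ≤ 16 * N * N := by
    have h1' := scanRun_acc_length_le N m (encodeNat N).length (radixIter (a2Words N α m r) (encodeNat N).length) ScanSt.init
    have h2' : (a2Words N α m r).length ≤ 3 * N * N := length_words_le (N := N) (α := α) (C := a2C N α m r) (nb := (encodeNat N).length) hN1 hr1 hrN hm1 hmN
    rw [length_radixIter] at h1'
    simp only [ScanSt.init, List.length_nil, zero_add] at h1'
    have h3' : (a2Res N α m r).acc.length ≤ (a2Words N α m r).length := h1'
    nlinarith
  -- initialisation and Step 1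
  have h1 := runs_a2Init h hN1 hn T hI u hαN hm1 hmN hr1 hrN hbla ha2y ha2r ha2d ha2u ha2al ha2s ha2jj ha2c ha2am hx2 hx3 hx6 hsq1 hsq2 hsq3 hsq4 hsq5
  have hP1 : ∀ uX : HSlots, uX.bla = encodeNat α → uX.a2y = encodeNat m → uX.x1 = [] → uX.x2 = [] → uX.a2p = [] → uX.a2q = [] → uX.x3 = [] → uX.x4 = [] → uX.x5 = [] →
      uX.x6 = [] → uX.fl1 = [] → uX.u1 = [] → Runs (a2Pow h) (base (hSt h T uX)) (base (hSt h T (uX.powRes N α m))) (a2PowCost n m) :=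
    fun uX h1 h2 h3 h4 h5 h6 h7 h8 h9 h10 h11 h12 => runs_a2Pow h hN1 hn T hI uX hαN hm1 hmN h1 h2 h3 h4 h5 h6 h7 h8 h9 h10 h11 h12
  have h2 := hP1 (u.a2InitRes N α m r (encodeNat N).length) (by simp [HSlots.a2InitRes, hbla]) (by simp [HSlots.a2InitRes, ha2y]) (by simp [HSlots.a2InitRes, hx1])
    (by simp [HSlots.a2InitRes, hx2]) (by simp [HSlots.a2InitRes, ha2p]) (by simp [HSlots.a2InitRes, ha2q]) (by simp [HSlots.a2InitRes, hx3])
    (by simp [HSlots.a2InitRes, hx4]) (by simp [HSlots.a2InitRes, hx5]) (by simp [HSlots.a2InitRes, hx6]) (by simp [HSlots.a2InitRes, hfl1])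
    (by simp [HSlots.a2InitRes, hu1])
  -- the state before the lists
  let uP : HSlots := { u with a2d := encodeNat (encodeNat N).length, a2u := List.replicate (encodeNat N).length true, a2al := encodeNat (4 * r * m), a2s := encodeNat (Nat.sqrt N + 1), a2jj := encodeNat (a2JStar N m r), a2c := encodeNat (a2C N α m r), a2am := encodeNat (α ^ m % N) }
  have hL := runs_a2Lists h hN1 hn rfl hαN hm1 hmN hr1 hrN hrm hnr T hI uP (by simp [uP, hbla]) (by simp [uP, ha2y]) (by simp [uP, ha2r]) (by simp [uP]) (by simp [uP]) (by simp [uP])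
    (by simp [uP]) (by simp [uP]) (by simp [uP]) (by simp [uP]) (by simp [uP, ha2p]) (by simp [uP, ha2q]) (by simp [uP, ha2t]) (by simp [uP, ha2j]) (by simp [uP, ha2v])
    (by simp [uP, ha2a]) (by simp [uP, ha2b]) (by simp [uP, ha2l1]) (by simp [uP, ha2l2]) (by simp [uP, ha2srt]) (by simp [uP, hl4]) (by simp [uP, hx2]) (by simp [uP, hx3])
    (by simp [uP, hx4]) (by simp [uP, hx5]) (by simp [uP, hx6]) (by simp [uP, hfl1]) (by simp [uP, hfl2]) (by simp [uP, hu1]) (by simp [uP, hu2]) (by simp [uP, hsq1])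
    (by simp [uP, hsq2]) (by simp [uP, hsq3]) (by simp [uP, hsq4]) (by simp [uP, hsq5]) (by simp [uP, hrx1]) (by simp [uP, hrx2]) (by simp [uP, hrx3]) (by simp [uP, hrx4])
    (by simp [uP, hrx5]) (by simp [uP, hrx6]) (by simp [uP, hrx7]) (by simp [uP, hrx8]) (by simp [uP, hrx9]) (by simp [uP, hsfk]) (by simp [uP, hsfe]) (by simp [uP, hsfcand])
    (by simp [uP, hsfbeta]) (by simp [uP, hsfdivs]) (by simp [uP, hsfr]) (by simp [uP, hsft])
  have hF : ∀ (fnd : Option ℕ) (acc : List ℕ), (∀ v ∈ acc, v < N) → acc.length ≤ 16 * N * N →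
      Runs (a2Fin h) (base (hSt h T { uP with l4 := outRev (acc.map encodeNat), a2l2 := List.replicate acc.length true, a2p := encOpt fnd, a2q := flagOpt fnd }))
        (base (hSt h T { uP with l4 := [], a2l2 := [], a2p := encOpt (a2FinOut N α (a2C N α m r) m fnd acc), a2q := flagOpt (a2FinOut N α (a2C N α m r) m fnd acc) }))
        (a2FinCost n m acc.length) := fun fnd acc hacc' hcnt' =>
    runs_a2Fin h hNodd hN1 hn4 hm1 hmN hαN hCN T hI hCI uP hw hsched hhist hbg hkn' hbf fnd acc hacc' hcnt'
      (by simp [uP, hbla]) (by simp [uP]) (by simp [uP, ha2y]) (by simp [uP, hblpow]) (by simp [uP, ha1c]) (by simp [uP, hblm]) (by simp [uP, ha1v]) (by simp [uP, ha1p])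
      (by simp [uP, hblk]) (by simp [uP, hl1]) (by simp [uP, hx1]) (by simp [uP, hx2]) (by simp [uP, hx3]) (by simp [uP, hx4]) (by simp [uP, hx5]) (by simp [uP, hx6])
      (by simp [uP, hfl1]) (by simp [uP, hfl2]) (by simp [uP, hu1]) (by simp [uP, hptk]) (by simp [uP, hptu]) (by simp [uP, hblf]) (by simp [uP, hble]) (by simp [uP, hblc1])
      (by simp [uP, hblc2]) (by simp [uP, hblout]) (by simp [uP, ha1i]) (by simp [uP, ha1ai]) (by simp [uP, ha1g]) (by simp [uP, hblg]) (by simp [uP, hblfp])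
  have h5 : Runs ((NS.ofList [.clear (h .A2D), .clear (h .A2U), .clear (h .A2AL), .clear (h .A2S), .clear (h .A2JJ), .clear (h .A2C), .clear (h .A2AM)] : NS β).com)
      (base (hSt h T { uP with l4 := [], a2l2 := [], a2p := encOpt (a2Out N α m r), a2q := flagOpt (a2Out N α m r) }))
      (base (hSt h T { u with a2p := encOpt (a2Out N α m r), a2q := flagOpt (a2Out N α m r) })) (21 * c) := by
    refine NS.runs_of_eq (N := n) _ _ ?_ ?_ (by simp [hc3])
    · simp only [NS.ofList, NS.ok, NOp.ok, NS.eval, NOp.eval, hSt_A2D, hSt_A2U, hSt_A2AL, hSt_A2S, hSt_A2JJ, hSt_A2C, hSt_A2AM,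
        update_hSt_A2D, update_hSt_A2U, update_hSt_A2AL, update_hSt_A2S, update_hSt_A2JJ, update_hSt_A2C, uP, List.length_replicate]
      exact ⟨hlnb, by omega, hl4rm, hlS, hlJ, hlC, hlam, trivial⟩
    · simp [uP, ha2d, ha2u, ha2al, ha2s, ha2jj, ha2c, ha2am, hl4, ha2l2]
  -- the two cases of Step 1
  rcases hfh : firstHit (powHit N α) (m - 1) with _ | i₀
  · -- nothing found in Step 1
    have hPR : (u.a2InitRes N α m r (encodeNat N).length).powRes N α m = uP := by
      simp only [HSlots.powRes, hfh]; simp [uP, HSlots.a2InitRes, hx1, hx2, hu1, a2C]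
    rw [hPR] at h2
    have h3 := runs_whenNot_nil h (F := .A2Q) (hSt h T uP) (by simp [uP, ha2q]) hL
    have hform2 : ({ uP.scanRegs (a2Res N α m r) with rx1 := [], a2l1 := [], sfcand := [], sfbeta := [], sfdivs := [] } : HSlots) = { uP with l4 := outRev ((a2Res N α m r).acc.map encodeNat), a2l2 := List.replicate (a2Res N α m r).acc.length true, a2p := encOpt (a2Res N α m r).found, a2q := flagOpt (a2Res N α m r).found } := by
      simp [HSlots.scanRegs, uP, hrx1, ha2l1, hsfcand, hsfbeta, hsfdivs]
    rw [hform2] at h3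
    have h4 := hF (a2Res N α m r).found (a2Res N α m r).acc hacc hcnt
    have hout : a2FinOut N α (a2C N α m r) m (a2Res N α m r).found (a2Res N α m r).acc = a2Out N α m r := by simp only [a2Out, hfh]
    rw [hout] at h4
    refine (h1.seq (h2.seq (h3.seq (h4.seq h5)))).of_eq rfl ?_
    have hcnt' : a2CntOf N α m r = (a2Res N α m r).acc.length := by simp only [a2CntOf, hfh]
    simp only [alg2Cost, ← hc3, hcnt']; omega
  · -- Step 1 found a factor
    have hPR : (u.a2InitRes N α m r (encodeNat N).length).powRes N α m = { uP with l4 := outRev (([] : List ℕ).map encodeNat), a2l2 := List.replicate ([] : List ℕ).length true, a2p := encOpt (some (powGcd N α (i₀ + 1))), a2q := flagOpt (some (powGcd N α (i₀ + 1))) } := by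
      simp only [HSlots.powRes, hfh]; simp [uP, HSlots.a2InitRes, hx1, hx2, hu1, a2C, encOpt, flagOpt, hl4, ha2l2]
    rw [hPR] at h2
    have h3 := runs_whenNot_true h (F := .A2Q) (a2Baby h ;; (a2Giants h ;; (a2Sort h ;; a2Scan h)))
      (hSt h T { uP with l4 := outRev (([] : List ℕ).map encodeNat), a2l2 := List.replicate ([] : List ℕ).length true, a2p := encOpt (some (powGcd N α (i₀ + 1))), a2q := flagOpt (some (powGcd N α (i₀ + 1))) })
      (by simp [flagOpt])
    have h4 := hF (some (powGcd N α (i₀ + 1))) [] (by simp) (by simp)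
    have hout : a2FinOut N α (a2C N α m r) m (some (powGcd N α (i₀ + 1))) [] = a2Out N α m r := by simp only [a2Out, hfh, a2FinOut]
    rw [hout] at h4
    refine (h1.seq (h2.seq (h3.seq (h4.seq h5)))).of_eq rfl ?_
    have hcnt' : a2CntOf N α m r = 0 := by simp only [a2CntOf, hfh]
    have hpos : 1 ≤ a2BabyCost n m := by unfold a2BabyCost; omega
    simp only [alg2Cost, ← hc3, hcnt', List.length_nil, a2ListsCost]; omega

end AlgTwoGlue

section AlgTwoMath

/-! ### What Algorithm 2 proves

The arithmetic meaning of `a2Out`: a reported factor is a proper divisor of `N` (given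
`ord_N(α) ≥ m`), and for `N = pq` with `(N/r)^{1/2} ≤ p < q`, `r < p` and `ord_p(α) ≥ m` a factor
IS reported (Harvey's Prop. 4.2 = arXiv Prop. 15, through `Harvey2021Search.prop42_witness`). -/

open Literature.Computability.Cryptography.Harvey2021

/-! #### The sort is stable on equal keys -/

/-- Bit `k < nb` of a word is a bit of its key part. [folklore] -/
theorem bitAt_eq_of_take_eq {nb k : ℕ} (hk : k < nb) {x y : List Bool} (hxy : x.take nb = y.take nb) : bitAt k x = bitAt k y := by
  have h1 : (x.take nb)[k]? = (y.take nb)[k]? := by rw [hxy]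
  rw [List.getElem?_take_of_lt hk, List.getElem?_take_of_lt hk] at h1
  simp only [bitAt, List.getD_eq_getElem?_getD, h1]

/-- A radix pass keeps a pairwise property that holds automatically across different bits. [folklore] -/
theorem radixPass_pairwise {Q : List Bool → List Bool → Prop} {k : ℕ} {l : List (List Bool)} (hl : l.Pairwise Q)
    (hQ : ∀ x y, bitAt k x ≠ bitAt k y → Q x y) : (radixPass k l).Pairwise Q := by
  unfold radixPass
  rw [List.pairwise_append]
  refine ⟨hl.filter _, hl.filter _, fun x hx y hy => hQ x y fun heq => ?_⟩
  rw [List.mem_filter] at hx hy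
  have h1 := hx.2; have h2 := hy.2
  rw [heq, h2] at h1
  simp at h1

/-- **Stability**: `k ≤ nb` radix passes keep the relative order of words with the same first `nb` bits. [folklore] -/
theorem radixIter_pairwise {nb : ℕ} {T : List Bool → List Bool → Prop} {l : List (List Bool)} (hl : l.Pairwise T) :
    ∀ k, k ≤ nb → (radixIter l k).Pairwise (fun x y => x.take nb = y.take nb → T x y)
  | 0, _ => by
    show List.Pairwise _ l
    exact List.Pairwise.imp (R := T) (S := fun x y => x.take nb = y.take nb → T x y) (fun hab _ => hab) hl
  | k + 1, hk => by
    have ih := radixIter_pairwise (nb := nb) hl k (by omega)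
    exact radixPass_pairwise ih (fun x y hne heq => absurd (bitAt_eq_of_take_eq (show k < nb by omega) heq) hne)

/-! #### The scan, as a fold -/

/-- The last baby-step word of a list of words. [folklore] -/
def lastBaby (nb : ℕ) (l : List (List Bool)) : Option (List Bool) := l.foldl (fun o w => if tagOf nb w then o else some w) none

/-- `lastBaby` on `l ++ [w]`. [folklore] -/
theorem lastBaby_append (nb : ℕ) (l : List (List Bool)) (w : List Bool) :
    lastBaby nb (l ++ [w]) = if tagOf nb w then lastBaby nb l else some w := by
  simp [lastBaby, List.foldl_append]

/-- The last baby-step word is a baby-step word of the list, and every baby-step word is it or before it. [folklore] -/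
theorem lastBaby_spec (nb : ℕ) : ∀ (l : List (List Bool)),
    match lastBaby nb l with
    | none => ∀ w ∈ l, tagOf nb w = true
    | some b => ∃ l₁ l₂, l = l₁ ++ b :: l₂ ∧ tagOf nb b = false ∧ ∀ w ∈ l₂, tagOf nb w = true := by
  intro l
  induction l using List.reverseRecOn with
  | nil => simp [lastBaby]
  | append_singleton l w ih =>
    rw [lastBaby_append]
    by_cases ht : tagOf nb w = true
    · rw [if_pos ht]
      rcases hlb : lastBaby nb l with _ | b
      · rw [hlb] at ih; simp only at ih ⊢
        intro x hx; rcases List.mem_append.1 hx with hx | hx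
        · exact ih x hx
        · rw [List.mem_singleton.1 hx]; exact ht
      · rw [hlb] at ih; simp only at ih ⊢
        obtain ⟨l₁, l₂, rfl, hb, hl₂⟩ := ih
        refine ⟨l₁, l₂ ++ [w], by simp, hb, fun x hx => ?_⟩
        rcases List.mem_append.1 hx with hx | hx
        · exact hl₂ x hx
        · rw [List.mem_singleton.1 hx]; exact ht
    · rw [if_neg ht]
      simp only
      exact ⟨l, [], rfl, by simpa using ht, by simp⟩

/-- **The memory of the scan**: the baby-step registers hold the last baby-step word met. [folklore] -/
theorem scanRun_cand (N m nb : ℕ) : ∀ (l : List (List Bool)),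
    match lastBaby nb l with
    | none => (scanRun N m nb ScanSt.init l).hb = false
    | some b => (scanRun N m nb ScanSt.init l).hb = true ∧ (scanRun N m nb ScanSt.init l).cand = b.take nb ∧ (scanRun N m nb ScanSt.init l).beta = payloadOf nb b := by
  intro l
  induction l using List.reverseRecOn with
  | nil => simp [lastBaby, scanRun, ScanSt.init]
  | append_singleton l w ih =>
    rw [lastBaby_append, scanRun_append]
    by_cases ht : tagOf nb w = true
    · rw [if_pos ht]
      have hst : ∀ st : ScanSt, (scanStep N m nb st w).hb = st.hb ∧ (scanStep N m nb st w).cand = st.cand ∧ (scanStep N m nb st w).beta = st.beta := fun st => by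
        unfold scanStep; rw [if_pos ht]; split_ifs <;> simp
      obtain ⟨e1, e2, e3⟩ := hst (scanRun N m nb ScanSt.init l)
      rcases hlb : lastBaby nb l with _ | b
      · rw [hlb] at ih; simp only at ih ⊢; rw [e1, ih]
      · rw [hlb] at ih; simp only at ih ⊢; rw [e1, e2, e3]; exact ih
    · rw [if_neg ht]
      simp only
      unfold scanStep; rw [if_neg ht]; exact ⟨rfl, rfl, rfl⟩

/-- A factor once found is kept. [folklore] -/
theorem scanRun_found_of_some (N m nb : ℕ) : ∀ (l : List (List Bool)) (st : ScanSt) (g : ℕ), st.found = some g → (scanRun N m nb st l).found = some g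
  | [], st, g, hg => by simpa [scanRun] using hg
  | w :: l, st, g, hg => by
    have hstep : (scanStep N m nb st w).found = some g := by
      unfold scanStep; split_ifs <;> simp [hg]
    exact scanRun_found_of_some N m nb l _ g hstep

/-- No factor at the end means no factor along the way. [folklore] -/
theorem found_none_of_scanRun (N m nb : ℕ) (l : List (List Bool)) (st : ScanSt) (hn : (scanRun N m nb st l).found = none) : st.found = none := by
  rcases hq : st.found with _ | g
  · rfl
  · rw [scanRun_found_of_some N m nb l st g hq] at hn; exact absurd hn (by simp)

/-- `scanRun` on `l ++ w :: l'`. [folklore] -/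
theorem scanRun_split (N m nb : ℕ) (st : ScanSt) (l : List (List Bool)) (w : List Bool) (l' : List (List Bool)) :
    scanRun N m nb st (l ++ w :: l') = scanRun N m nb (scanStep N m nb (scanRun N m nb st l) w) l' := by
  simp [scanRun, List.foldl_append]

/-- The values accumulate. [folklore] -/
theorem scanRun_acc_mono (N m nb : ℕ) : ∀ (l : List (List Bool)) (st : ScanSt) (v : ℕ), v ∈ st.acc → v ∈ (scanRun N m nb st l).acc
  | [], st, v, hv => by simpa [scanRun] using hv
  | w :: l, st, v, hv => by
    have hstep : v ∈ (scanStep N m nb st w).acc := by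
      unfold scanStep; split_ifs <;> simp [hv]
    exact scanRun_acc_mono N m nb l _ v hstep

/-- The match test of the scan at a giant-step word `w` after the words `l`. [folklore] -/
def Matched (N m nb : ℕ) (l : List (List Bool)) (w : List Bool) : Prop :=
  (scanRun N m nb ScanSt.init l).hb = true ∧ keyOf nb w = bitsToNat (scanRun N m nb ScanSt.init l).cand

/-- The match test is decidable. [folklore] -/
instance (N m nb : ℕ) (l : List (List Bool)) (w : List Bool) : Decidable (Matched N m nb l w) := by unfold Matched; infer_instance

/-- An unmatched giant step joins the values. [folklore] -/
theorem mem_acc_of_unmatched {N m nb : ℕ} {l l' : List (List Bool)} {w : List Bool} (ht : tagOf nb w = true) (hu : ¬ Matched N m nb l w) :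
    keyOf nb w ∈ (scanRun N m nb ScanSt.init (l ++ w :: l')).acc := by
  rw [scanRun_split]
  apply scanRun_acc_mono
  unfold scanStep; rw [if_pos ht, if_neg (by simpa [Matched] using hu)]; simp

/-- A matched giant step whose recovery succeeds sets the factor. [folklore] -/
theorem found_isSome_of_matched {N m nb : ℕ} {l l' : List (List Bool)} {w : List Bool} (ht : tagOf nb w = true) (hm : Matched N m nb l w)
    (hr : recoverSpec N m (bitsToNat (scanRun N m nb ScanSt.init l).beta) (fieldsOf (payloadOf nb w)).1 (fieldsOf (payloadOf nb w)).2.1 (fieldsOf (payloadOf nb w)).2.2 ≠ none) :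
    (scanRun N m nb ScanSt.init (l ++ w :: l')).found ≠ none := by
  intro hn
  rw [scanRun_split] at hn
  have h1 := found_none_of_scanRun N m nb l' _ hn
  unfold scanStep at h1; rw [if_pos ht, if_pos (by simpa [Matched] using hm)] at h1
  simp only [Option.or_eq_none_iff] at h1
  exact hr h1.2

/-- Where the values come from: each is the key of an unmatched giant-step word. [folklore] -/
theorem acc_origin {N m nb : ℕ} : ∀ (sw : List (List Bool)) (v : ℕ), v ∈ (scanRun N m nb ScanSt.init sw).acc →
    ∃ l w l', sw = l ++ w :: l' ∧ tagOf nb w = true ∧ keyOf nb w = v ∧ ¬ Matched N m nb l w := by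
  intro sw
  induction sw using List.reverseRecOn with
  | nil => simp [scanRun, ScanSt.init]
  | append_singleton l w ih =>
    intro v hv
    rw [scanRun_append] at hv
    have hprev : v ∈ (scanRun N m nb ScanSt.init l).acc ∨ (tagOf nb w = true ∧ keyOf nb w = v ∧ ¬ Matched N m nb l w) := by
      unfold scanStep at hv
      by_cases ht : tagOf nb w = true
      · rw [if_pos ht] at hv
        by_cases hmt : (scanRun N m nb ScanSt.init l).hb = true ∧ keyOf nb w = bitsToNat (scanRun N m nb ScanSt.init l).cand
        · rw [if_pos hmt] at hv; exact Or.inl hv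
        · rw [if_neg hmt] at hv
          simp only [List.mem_append, List.mem_singleton] at hv
          rcases hv with hv | rfl
          · exact Or.inl hv
          · exact Or.inr ⟨ht, rfl, by simpa [Matched] using hmt⟩
      · rw [if_neg ht] at hv; exact Or.inl hv
    rcases hprev with hv | ⟨ht, hk, hu⟩
    · obtain ⟨l₁, w₁, l₂, rfl, ht, hk, hu⟩ := ih v hv
      exact ⟨l₁, w₁, l₂ ++ [w], by simp, ht, hk, hu⟩
    · exact ⟨l, w, [], rfl, ht, hk, hu⟩

/-- **Matching**: in a list sorted by key in which no giant step precedes a baby step with the same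
key part, a giant step `w` with a baby step of the same key part somewhere in the list is matched,
against a baby step of the same key. [folklore] -/
theorem matched_of_baby {N m nb : ℕ} {l l' : List (List Bool)} {w B : List Bool}
    (hsort : (l ++ w :: l').Pairwise (fun x y => keyOf nb x ≤ keyOf nb y))
    (hstab : (l ++ w :: l').Pairwise (fun x y => x.take nb = y.take nb → tagOf nb x = true → tagOf nb y = true))
    (ht : tagOf nb w = true) (hB : B ∈ l ++ w :: l') (hBt : tagOf nb B = false) (hBw : B.take nb = w.take nb) :
    Matched N m nb l w ∧ ∃ b ∈ l, tagOf nb b = false ∧ keyOf nb b = keyOf nb w ∧ (scanRun N m nb ScanSt.init l).beta = payloadOf nb b := by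
  have hkB : keyOf nb B = keyOf nb w := by simp only [keyOf, hBw]
  -- `B` is before `w`
  have hBl : B ∈ l := by
    rcases List.mem_append.1 hB with h1 | h1
    · exact h1
    · rcases List.mem_cons.1 h1 with rfl | h1
      · rw [ht] at hBt; exact absurd hBt (by simp)
      · exfalso
        rw [List.pairwise_append] at hstab
        obtain ⟨-, hwl', -⟩ := hstab
        rw [List.pairwise_cons] at hwl'
        have := hwl'.1 B h1 hBw.symm ht
        rw [hBt] at this; exact absurd this (by simp)
  -- the last baby before `w`
  have hlb := lastBaby_spec nb l
  have hcand := scanRun_cand N m nb l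
  rcases hq : lastBaby nb l with _ | b
  · rw [hq] at hlb; simp only at hlb; have := hlb B hBl; rw [hBt] at this; exact absurd this (by simp)
  · rw [hq] at hlb hcand; simp only at hlb hcand
    obtain ⟨l₁, l₂, rfl, hbt, hl₂⟩ := hlb
    obtain ⟨hhb, hcd, hbeta⟩ := hcand
    have hbmem : b ∈ l₁ ++ b :: l₂ := by simp
    -- keys: `key B ≤ key b ≤ key w`, `key B = key w`
    have hsort' := hsort
    rw [List.append_assoc, List.cons_append, List.pairwise_append] at hsort'
    obtain ⟨h₁, hbl, hcross⟩ := hsort'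
    rw [List.pairwise_cons] at hbl
    have hbw : keyOf nb b ≤ keyOf nb w := hbl.1 w (by simp)
    have hBb : keyOf nb B ≤ keyOf nb b := by
      rcases List.mem_append.1 hBl with hB1 | hB1
      · exact hcross B hB1 b (by simp)
      · rcases List.mem_cons.1 hB1 with rfl | hB2
        · exact le_rfl
        · have := hl₂ B hB2; rw [hBt] at this; exact absurd this (by simp)
    have hkb : keyOf nb b = keyOf nb w := by omega
    refine ⟨⟨hhb, ?_⟩, b, hbmem, hbt, hkb, hbeta⟩
    rw [hcd]; exact hkb.symm

/-! #### The words of Algorithm 2 -/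

/-- The key of a word. [folklore] -/
theorem keyOf_mkWord {nb v : ℕ} (hv : (encodeNat v).length ≤ nb) (tag : Bool) (pl : List Bool) : keyOf nb (mkWord nb v tag pl) = v :=
  (mkWord_split hv tag pl).2.2.2.2

/-- The tag of a word. [folklore] -/
theorem tagOf_mkWord {nb v : ℕ} (hv : (encodeNat v).length ≤ nb) (tag : Bool) (pl : List Bool) : tagOf nb (mkWord nb v tag pl) = tag :=
  (mkWord_split hv tag pl).2.1

/-- The key part of a word. [folklore] -/
theorem take_mkWord {nb v : ℕ} (hv : (encodeNat v).length ≤ nb) (tag : Bool) (pl : List Bool) :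
    (mkWord nb v tag pl).take nb = encodeNat v ++ List.replicate (nb - (encodeNat v).length) false :=
  (mkWord_split hv tag pl).1

/-- The baby-step words. [folklore] -/
theorem mem_babyWords {N α C nb m : ℕ} {w : List Bool} : w ∈ babyWords N α C nb m ↔ ∃ i, i < m ∧ w = mkWord nb (bval N α C i) false (encodeNat i) := by
  simp only [babyWords, List.mem_map, List.mem_range]
  constructor
  · rintro ⟨i, hi, rfl⟩; exact ⟨i, hi, rfl⟩
  · rintro ⟨i, hi, rfl⟩; exact ⟨i, hi, rfl⟩

/-- The baby-step values are residues. [folklore] -/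
theorem bval_lt {N α C : ℕ} (hN0 : 0 < N) (i : ℕ) : bval N α C i < N := Nat.mod_lt _ hN0

/-- The shape of a giant-step word. [folklore] -/
def GiantShape (N m r nb : ℕ) (w : List Bool) : Prop :=
  ∃ v a b j, v < N ∧ 1 ≤ a ∧ 1 ≤ b ∧ a * b ≤ r ∧ j * m ≤ N ∧ j ≤ N ∧ w = mkWord nb v true (gPayload a b j)

/-- The words of a pair have the giant shape. [folklore] -/
theorem pairWords_shape {N α m r nb a b jj : ℕ} (hN1 : 1 < N) (hr1 : 1 ≤ r) (hm1 : 1 ≤ m) (ha1 : 1 ≤ a) (hb1 : 1 ≤ b) (habr : a * b ≤ r) :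
    ∀ w ∈ pairWords N α m r nb a b jj, GiantShape N m r nb w := by
  intro w hw
  simp only [pairWords, List.mem_map, List.mem_range] at hw
  obtain ⟨i, -, rfl⟩ := hw
  obtain ⟨h1, h2⟩ := jCount_pred_facts (a := a) (b := b) hN1 hr1 hm1
  refine ⟨_, a, b, jCount N m r a b - 1 - i, gVal_lt (by omega) i, ha1, hb1, habr, ?_, ?_, rfl⟩
  · exact (Nat.mul_le_mul_right m (Nat.sub_le _ _)).trans h1
  · exact (Nat.sub_le _ _).trans h2

/-- The words of a row have the giant shape. [folklore] -/
theorem rowWords_shape {N α m r nb a : ℕ} (hN1 : 1 < N) (hr1 : 1 ≤ r) (hm1 : 1 ≤ m) (ha1 : 1 ≤ a) :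
    ∀ bd, a * bd ≤ r → ∀ w ∈ rowWords N α m r nb a bd, GiantShape N m r nb w
  | 0, _ => by simp [rowWords]
  | bd + 1, hbd => by
    intro w hw
    simp only [rowWords, List.mem_append] at hw
    rcases hw with hw | hw
    · exact rowWords_shape hN1 hr1 hm1 ha1 bd (by nlinarith) w hw
    · exact pairWords_shape hN1 hr1 hm1 ha1 (by omega) hbd w hw

/-- The giant-step words have the giant shape. [folklore] -/
theorem giantWords_shape {N α m r nb : ℕ} (hN1 : 1 < N) (hr1 : 1 ≤ r) (hm1 : 1 ≤ m) :
    ∀ ad, ∀ w ∈ giantWords N α m r nb ad, GiantShape N m r nb w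
  | 0 => by simp [giantWords]
  | ad + 1 => by
    intro w hw
    simp only [giantWords, List.mem_append] at hw
    rcases hw with hw | hw
    · exact giantWords_shape hN1 hr1 hm1 ad w hw
    · exact rowWords_shape hN1 hr1 hm1 (by omega) _ (by rw [mul_comm]; exact Nat.div_mul_le_self r (ad + 1)) w hw

/-- The tags of the words of Algorithm 2: `false` = a baby step, `true` = a giant step. [folklore] -/
theorem tagOf_of_mem_a2Words {N α m r : ℕ} (hN1 : 1 < N) (hr1 : 1 ≤ r) (hm1 : 1 ≤ m) {w : List Bool} (hw : w ∈ a2Words N α m r) :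
    (tagOf (encodeNat N).length w = false ∧ w ∈ babyWords N α (a2C N α m r) (encodeNat N).length m) ∨
    (tagOf (encodeNat N).length w = true ∧ GiantShape N m r (encodeNat N).length w) := by
  have hN0 : 0 < N := by omega
  rcases List.mem_append.1 hw with hw | hw
  · left
    refine ⟨?_, hw⟩
    obtain ⟨i, -, rfl⟩ := mem_babyWords.1 hw
    exact tagOf_mkWord (len_le_nb rfl (bval_lt hN0 i)) _ _
  · right
    have hs := giantWords_shape (nb := (encodeNat N).length) (α := α) hN1 hr1 hm1 r w hw
    refine ⟨?_, hs⟩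
    obtain ⟨v, a, b, j, hv, -, -, -, -, -, rfl⟩ := hs
    exact tagOf_mkWord (len_le_nb rfl hv) _ _

/-- The words of Algorithm 2: babies first. [folklore] -/
theorem a2Words_pairwise_tag {N α m r : ℕ} (hN1 : 1 < N) (hr1 : 1 ≤ r) (hm1 : 1 ≤ m) :
    (a2Words N α m r).Pairwise (fun x y => tagOf (encodeNat N).length x = true → tagOf (encodeNat N).length y = true) := by
  have hN0 : 0 < N := by omega
  unfold a2Words
  rw [List.pairwise_append]
  refine ⟨?_, ?_, ?_⟩
  · refine List.Pairwise.imp_of_mem ?_ (List.pairwise_of_forall (R := fun _ _ : List Bool => True) fun _ _ => trivial)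
    intro x y hx _ _ htx
    obtain ⟨i, -, rfl⟩ := mem_babyWords.1 hx
    rw [tagOf_mkWord (len_le_nb rfl (bval_lt hN0 i))] at htx; exact absurd htx (by simp)
  · refine List.Pairwise.imp_of_mem ?_ (List.pairwise_of_forall (R := fun _ _ : List Bool => True) fun _ _ => trivial)
    intro x y _ hy _ _
    obtain ⟨v, a, b, j, hv, -, -, -, -, -, rfl⟩ := giantWords_shape (nb := (encodeNat N).length) (α := α) hN1 hr1 hm1 r y hy
    exact tagOf_mkWord (len_le_nb rfl hv) _ _
  · intro x _ y hy _
    obtain ⟨v, a, b, j, hv, -, -, -, -, -, rfl⟩ := giantWords_shape (nb := (encodeNat N).length) (α := α) hN1 hr1 hm1 r y hy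
    exact tagOf_mkWord (len_le_nb rfl hv) _ _

/-- **The sorted words of Algorithm 2**: sorted by key, babies before giants of the same key part. [folklore] -/
theorem a2Sorted_facts {N α m r : ℕ} (hN1 : 1 < N) (hr1 : 1 ≤ r) (hm1 : 1 ≤ m) :
    (radixIter (a2Words N α m r) (encodeNat N).length).Pairwise (fun x y => keyOf (encodeNat N).length x ≤ keyOf (encodeNat N).length y) ∧
    (radixIter (a2Words N α m r) (encodeNat N).length).Pairwise
      (fun x y => x.take (encodeNat N).length = y.take (encodeNat N).length → tagOf (encodeNat N).length x = true → tagOf (encodeNat N).length y = true) :=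
  ⟨sorted_radixIter (a2Words N α m r) (encodeNat N).length, radixIter_pairwise (a2Words_pairwise_tag hN1 hr1 hm1) _ le_rfl⟩

/-! #### Soundness: a reported factor is a proper divisor -/

/-- `properOpt` reports `g ∉ {1, N}`. [folklore] -/
theorem properOpt_eq_some {N g x : ℕ} (h : properOpt N g = some x) : x = g ∧ g ≠ 1 ∧ g ≠ N := by
  unfold properOpt at h
  split_ifs at h with h1 h2
  exact ⟨(Option.some.inj h).symm, h1, h2⟩

/-- A gcd with `N` outside `{1, N}` is a proper divisor. [folklore] -/
theorem gcd_proper {N y : ℕ} (hN0 : 0 < N) (h1 : Nat.gcd y N ≠ 1) (h2 : Nat.gcd y N ≠ N) : 1 < Nat.gcd y N ∧ Nat.gcd y N < N ∧ Nat.gcd y N ∣ N := by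
  have hpos : 0 < Nat.gcd y N := Nat.gcd_pos_of_pos_right _ hN0
  have hle : Nat.gcd y N ≤ N := Nat.gcd_le_right _ hN0
  exact ⟨by omega, by omega, Nat.gcd_dvd_right _ _⟩

/-- The recovery reports proper divisors. [folklore] -/
theorem recoverSpec_proper {N m i a b j g : ℕ} (hN0 : 0 < N) (h : recoverSpec N m i a b j = some g) : 1 < g ∧ g < N ∧ g ∣ N := by
  unfold recoverSpec at h
  simp only at h
  split_ifs at h with hx
  set u := i + j * m + ceilSqrt (4 * a * b * N)
  set s := Nat.sqrt (u * u - 4 * a * b * N)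
  rcases h1 : properOpt N (Nat.gcd ((u + s) / 2) N) with _ | g1
  · rw [h1, Option.none_or] at h
    obtain ⟨rfl, hne1, hneN⟩ := properOpt_eq_some h
    exact gcd_proper hN0 hne1 hneN
  · rw [h1, Option.some_or] at h
    obtain rfl := Option.some.inj h
    obtain ⟨rfl, hne1, hneN⟩ := properOpt_eq_some h1
    exact gcd_proper hN0 hne1 hneN

/-- The scan reports proper divisors. [folklore] -/
theorem scanRun_found_proper {N m nb : ℕ} (hN0 : 0 < N) : ∀ (l : List (List Bool)) (st : ScanSt),
    (∀ g, st.found = some g → 1 < g ∧ g < N ∧ g ∣ N) → ∀ g, (scanRun N m nb st l).found = some g → 1 < g ∧ g < N ∧ g ∣ N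
  | [], st, hst, g, hg => hst g (by simpa [scanRun] using hg)
  | w :: l, st, hst, g, hg => by
    refine scanRun_found_proper hN0 l (scanStep N m nb st w) (fun g' hg' => ?_) g hg
    unfold scanStep at hg'
    split_ifs at hg' with h1 h2
    · simp only at hg'
      rcases hq : st.found with _ | g₀
      · rw [hq, Option.none_or] at hg'; exact recoverSpec_proper hN0 hg'
      · rw [hq, Option.some_or] at hg'; exact hst g' (hq.trans hg')
    · exact hst g' hg'
    · exact hst g' hg'

/-- **Soundness of Algorithm 2**: with `ord_N(α) ≥ m`, a reported factor is a proper divisor of `N`.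
[cite: Harvey2021, Prop. 4.2 (arXiv Prop. 15)] -/
theorem a2Out_factor {N α m r g : ℕ} (hN1 : 1 < N) (hord : ∀ i, 1 ≤ i → i < m → (α : ZMod N) ^ i ≠ 1) (hg : a2Out N α m r = some g) :
    1 < g ∧ g < N ∧ g ∣ N := by
  have hN0 : 0 < N := by omega
  unfold a2Out at hg
  rcases hfh : firstHit (powHit N α) (m - 1) with _ | i₀
  · rw [hfh] at hg; simp only at hg
    unfold a2FinOut at hg
    rcases hfd : (a2Res N α m r).found with _ | g'
    · rw [hfd] at hg; simp only at hg
      split_ifs at hg with hacc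
      unfold a2SixOut at hg
      exact alg1Out_factor hN1 hg
    · rw [hfd] at hg; simp only at hg
      obtain rfl := Option.some.inj hg
      exact scanRun_found_proper hN0 _ ScanSt.init (by simp [ScanSt.init]) g' hfd
  · rw [hfh] at hg; simp only at hg
    obtain rfl := Option.some.inj hg
    rcases firstHit_spec (powHit N α) (m - 1) with ⟨hn', -⟩ | ⟨i₁, hs', hi₁, hp', -⟩
    · rw [hfh] at hn'; exact absurd hn' (by simp)
    · rw [hfh] at hs'
      obtain rfl : i₀ = i₁ := Option.some.inj hs'
      have hne1 : powGcd N α (i₀ + 1) ≠ 1 := by simpa [powHit] using hp'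
      have hneN : powGcd N α (i₀ + 1) ≠ N := fun hEq => hord (i₀ + 1) (by omega) (by omega) ((powGcd_eq_self_iff hN1 α (i₀ + 1)).1 hEq)
      exact gcd_proper hN0 hne1 hneN

/-! #### Completeness: the unmatched values miss every baby step -/

/-- **An unmatched value is no baby-step value**: a value handed to Step 4 differs from every
`C α^i mod N`, `i < m` (the precondition of Algorithm 1 in Step 4). [folklore] -/
theorem a2Res_acc_no_baby {N α m r : ℕ} (hN1 : 1 < N) (hr1 : 1 ≤ r) (hm1 : 1 ≤ m) {v : ℕ} (hv : v ∈ (a2Res N α m r).acc) {i : ℕ} (hi : i < m)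
    (hbv : bval N α (a2C N α m r) i = v) : False := by
  have hN0 : 0 < N := by omega
  obtain ⟨hsort, hstab⟩ := a2Sorted_facts (α := α) hN1 hr1 hm1
  unfold a2Res at hv
  obtain ⟨l, w, l', hsw, ht, hk, hu⟩ := acc_origin _ v hv
  rw [hsw] at hsort hstab
  have hwmem : w ∈ a2Words N α m r := (radixIter_perm _ _).subset (by rw [hsw]; simp)
  rcases tagOf_of_mem_a2Words (α := α) hN1 hr1 hm1 hwmem with ⟨ht', -⟩ | ⟨-, v', a, b, j, hv', -, -, -, -, -, hwE⟩
  · rw [ht] at ht'; exact absurd ht' (by simp)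
  · have hkw : keyOf (encodeNat N).length w = v' := by rw [hwE]; exact keyOf_mkWord (len_le_nb rfl hv') _ _
    have hvv' : v' = v := hkw.symm.trans hk
    subst hvv'
    have hvN : bval N α (a2C N α m r) i < N := bval_lt hN0 i
    set B := mkWord (encodeNat N).length (bval N α (a2C N α m r) i) false (encodeNat i) with hB0
    have hBmem : B ∈ a2Words N α m r := List.mem_append_left _ (mem_babyWords.2 ⟨i, hi, rfl⟩)
    have hBsw : B ∈ l ++ w :: l' := by rw [← hsw]; exact (radixIter_perm _ _).symm.subset hBmem
    have hBt : tagOf (encodeNat N).length B = false := tagOf_mkWord (len_le_nb rfl hvN) _ _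
    have hBw : B.take (encodeNat N).length = w.take (encodeNat N).length := by
      rw [hB0, hwE, take_mkWord (len_le_nb rfl hvN), take_mkWord (len_le_nb rfl hv'), hbv]
    exact hu (matched_of_baby hsort hstab ht hBsw hBt hBw).1

/-! #### Completeness: the arithmetic of the witness -/

/-- `⌈√x⌉` computed in integers is the ceiling of the real square root. [folklore] -/
theorem ceilSqrt_eq_ceil (x : ℕ) : ceilSqrt x = ⌈Real.sqrt (x : ℝ)⌉₊ := by
  unfold ceilSqrt
  set s := Nat.sqrt x with hs
  have h1 : s * s ≤ x := Nat.sqrt_le x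
  have h2 : x < (s + 1) * (s + 1) := Nat.lt_succ_sqrt x
  split_ifs with heq
  · have hx : (x : ℝ) = (s : ℝ) ^ 2 := by rw [sq]; exact_mod_cast heq.symm
    rw [hx, Real.sqrt_sq (Nat.cast_nonneg _), Nat.ceil_natCast]
  · have hlt : s * s < x := lt_of_le_of_ne h1 heq
    symm
    rw [Nat.ceil_eq_iff (by omega), Nat.add_sub_cancel]
    constructor
    · rw [Real.lt_sqrt (Nat.cast_nonneg _)]; exact_mod_cast (by rw [sq]; exact hlt)
    · refine (Real.sqrt_lt' (by positivity)).2 ?_ |>.le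
      push_cast
      exact_mod_cast (by rw [sq]; exact h2)

/-- The real bound on `j` of the witness is within the machine's count `J_{a,b}`. [folklore] -/
theorem lt_jCount_of_real {N m r a b j : ℕ} (hr1 : 1 ≤ r) (hm1 : 1 ≤ m) (hab : 1 ≤ a * b)
    (hj : (j : ℝ) < Real.sqrt N / (4 * r * m * Real.sqrt (a * b))) : j < jCount N m r a b := by
  unfold jCount
  set q := Nat.sqrt (a * b) with hq0
  set S := Nat.sqrt N + 1 with hS0
  have hq1 : 1 ≤ q := Nat.le_sqrt.2 (by simpa using hab)
  have hqle : (q : ℝ) ≤ Real.sqrt (a * b) := by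
    rw [Real.le_sqrt (Nat.cast_nonneg _) (by positivity)]
    have := Nat.sqrt_le (a * b)
    exact_mod_cast (by rw [sq]; exact this)
  have hS : Real.sqrt N < S := by
    rw [Real.sqrt_lt' (by positivity)]
    have := Nat.lt_succ_sqrt N
    rw [hS0]; push_cast
    exact_mod_cast (by rw [sq]; exact this)
  have hD : (0 : ℝ) < 4 * r * m * q := by positivity
  have h1 : Real.sqrt N / (4 * r * m * Real.sqrt (a * b)) ≤ (S : ℝ) / (4 * r * m * q) :=
    div_le_div₀ (by positivity) hS.le hD (by nlinarith [hqle, show (0:ℝ) < 4 * r * m by positivity])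
  have h2 : (S : ℝ) / (4 * r * m * q) < (S / (4 * r * m * q) : ℕ) + 1 := by
    have hpos : 0 < 4 * r * m * q := by positivity
    rw [div_lt_iff₀ hD]
    have h3 := Nat.lt_div_mul_add (a := S) hpos
    calc (S : ℝ) < ((S / (4 * r * m * q)) * (4 * r * m * q) + 4 * r * m * q : ℕ) := by exact_mod_cast h3
      _ = (((S / (4 * r * m * q) : ℕ) : ℝ) + 1) * (4 * r * m * q : ℝ) := by push_cast; ring
  have h4 : (j : ℝ) < (S / (4 * r * m * q) : ℕ) + 1 := (lt_of_lt_of_le hj h1).trans h2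
  have h5 : j < S / (4 * r * m * q) + 1 := by exact_mod_cast h4
  omega

/-- Residues of residues: `p ∣ N`. [folklore] -/
theorem natCast_mod_of_dvd {N d : ℕ} (hd : d ∣ N) (x : ℕ) : (((x % N : ℕ)) : ZMod d) = (x : ZMod d) := by
  rw [ZMod.natCast_eq_natCast_iff', Nat.mod_mod_of_dvd _ hd]

/-- The giant-step values modulo a divisor of `N`. [folklore] -/
theorem gVal_cast {N d α m r a b : ℕ} (hd : d ∣ N) : ∀ jj,
    ((gVal N α m r a b jj : ℕ) : ZMod d) = (α : ZMod d) ^ tExp N a b * (α : ZMod d) ^ ((a2JStar N m r - jCount N m r a b + 1 + jj) * m)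
  | 0 => by
    simp only [gVal, gStart, natCast_mod_of_dvd hd, Nat.cast_mul, Nat.cast_pow, add_zero]
  | jj + 1 => by
    rw [gVal, natCast_mod_of_dvd hd, Nat.cast_mul, gVal_cast hd jj, natCast_mod_of_dvd hd, Nat.cast_pow,
      show (a2JStar N m r - jCount N m r a b + 1 + (jj + 1)) * m = (a2JStar N m r - jCount N m r a b + 1 + jj) * m + m by ring, pow_add]
    ring

/-- The baby-step values modulo a divisor of `N`. [folklore] -/
theorem bval_cast {N d α C : ℕ} (hd : d ∣ N) (i : ℕ) : ((bval N α C i : ℕ) : ZMod d) = (C : ZMod d) * (α : ZMod d) ^ i := by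
  simp only [bval, natCast_mod_of_dvd hd, Nat.cast_mul, Nat.cast_pow]

/-- The shift `C` modulo a divisor of `N`. [folklore] -/
theorem a2C_cast {N d α m r : ℕ} (hd : d ∣ N) : ((a2C N α m r : ℕ) : ZMod d) = (α : ZMod d) ^ (a2JStar N m r * m) := by
  simp only [a2C, natCast_mod_of_dvd hd, Nat.cast_pow]

/-- Powers of `α` below its order are distinct. [folklore] -/
theorem pow_inj_of_order {p α m : ℕ} [Fact p.Prime] (hα0 : (α : ZMod p) ≠ 0) (hord : ∀ i, 1 ≤ i → i < m → (α : ZMod p) ^ i ≠ 1) {i i' : ℕ}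
    (hi : i < m) (hi' : i' < m) (heq : (α : ZMod p) ^ i = (α : ZMod p) ^ i') : i = i' := by
  wlog hle : i ≤ i' generalizing i i'
  · exact (this hi' hi heq.symm (by omega)).symm
  · rcases Nat.eq_or_lt_of_le hle with h | h
    · exact h
    · exfalso
      have h1 : (α : ZMod p) ^ i' = (α : ZMod p) ^ i * (α : ZMod p) ^ (i' - i) := by rw [← pow_add]; congr 1; omega
      rw [h1] at heq
      have h2 : (α : ZMod p) ^ (i' - i) = 1 := by
        have hne : (α : ZMod p) ^ i ≠ 0 := pow_ne_zero _ hα0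
        have := mul_left_cancel₀ hne (heq.symm.trans (mul_one _).symm)
        exact this
      exact hord (i' - i) (by omega) (by omega) h2

/-- **The recovery succeeds on the witness** (Lemma 10): for `u = aq + bp` the discriminant
`u² − 4abN = (aq − bp)²` is a square and one of `gcd((u ± √·)/2, N)` is `p` or `q`.
[cite: Harvey2021, Lemma 3.1 (arXiv Lemma 10)] -/
theorem recoverSpec_isSome {N m i a b j p q : ℕ} (hp : p.Prime) (hq : q.Prime) (hN : N = p * q) (ha : 0 < a) (hap : a < p) (hb : 0 < b) (hbq : b < q)
    (hu : i + j * m + ceilSqrt (4 * a * b * N) = a * q + b * p) : recoverSpec N m i a b j ≠ none := by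
  have hp2 := hp.two_le
  have hq2 := hq.two_le
  unfold recoverSpec
  simp only
  rw [hu]
  set u := a * q + b * p with hu0
  have hxZ : (4 * a * b * N : ℤ) ≤ (u : ℤ) * u := by
    rw [hu0, hN]; push_cast; nlinarith [sq_nonneg ((a : ℤ) * q - b * p)]
  have hx : 4 * a * b * N ≤ u * u := by exact_mod_cast hxZ
  rw [if_pos hx]
  -- the discriminant is the square of `D = |aq − bp|`
  set D := Int.natAbs ((a * q : ℤ) - b * p) with hD0
  have hDsq : u * u - 4 * a * b * N = D * D := by
    have h1 : ((u * u - 4 * a * b * N : ℕ) : ℤ) = ((a * q : ℤ) - b * p) ^ 2 := by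
      rw [Nat.cast_sub hx]; push_cast; rw [hu0, hN]; push_cast; ring
    have h2 : ((D * D : ℕ) : ℤ) = ((a * q : ℤ) - b * p) ^ 2 := by push_cast; rw [hD0, Int.natAbs_mul_self', sq]
    exact_mod_cast h1.trans h2.symm
  rw [hDsq, Nat.sqrt_eq]
  -- the two halves are `aq` and `bp`
  have hhalves : ((u + D) / 2 = a * q ∧ (u - D) / 2 = b * p) ∨ ((u + D) / 2 = b * p ∧ (u - D) / 2 = a * q) := by
    rcases le_total (b * p) (a * q) with hle | hle
    · left
      have hD : D = a * q - b * p := by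
        have : ((a * q : ℤ) - b * p) = ((a * q - b * p : ℕ) : ℤ) := by rw [Nat.cast_sub hle]; push_cast; ring
        rw [hD0, this, Int.natAbs_natCast]
      constructor <;> omega
    · right
      have hD : D = b * p - a * q := by
        have : ((a * q : ℤ) - b * p) = -((b * p - a * q : ℕ) : ℤ) := by rw [Nat.cast_sub hle]; push_cast; ring
        rw [hD0, this, Int.natAbs_neg, Int.natAbs_natCast]
      constructor <;> omega
  -- the gcds
  have hga : Nat.gcd (a * q) N = q := by
    rw [hN, Nat.gcd_mul_right, Nat.Coprime.gcd_eq_one (Nat.coprime_of_lt_prime (by omega) hap hp).symm, one_mul]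
  have hgb : Nat.gcd (b * p) N = p := by
    rw [hN, mul_comm p q, Nat.gcd_mul_right, Nat.Coprime.gcd_eq_one (Nat.coprime_of_lt_prime (by omega) hbq hq).symm, one_mul]
  have hq1 : q ≠ 1 := hq.one_lt.ne'
  have hp1 : p ≠ 1 := hp.one_lt.ne'
  have hqN : q ≠ N := by rw [hN]; nlinarith
  have hpN : p ≠ N := by rw [hN]; nlinarith
  rcases hhalves with ⟨e1, e2⟩ | ⟨e1, e2⟩
  · rw [e1, e2, hga, hgb]; simp [properOpt, hq1, hqN]
  · rw [e1, e2, hga, hgb]; simp [properOpt, hp1, hpN]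

/-- A giant-step word of the pair `(a, b)` is one of the giant-step words. [folklore] -/
theorem mem_giantWords {N α m r nb a b jj : ℕ} (ha1 : 1 ≤ a) (hb1 : 1 ≤ b) (habr : a * b ≤ r) (hjj : jj < jCount N m r a b) :
    mkWord nb (gVal N α m r a b jj) true (gPayload a b (jCount N m r a b - 1 - jj)) ∈ giantWords N α m r nb r := by
  have hpw : mkWord nb (gVal N α m r a b jj) true (gPayload a b (jCount N m r a b - 1 - jj)) ∈ pairWords N α m r nb a b (jCount N m r a b) := by
    simp only [pairWords, List.mem_map, List.mem_range]; exact ⟨jj, hjj, rfl⟩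
  have hrow : ∀ bd, b ≤ bd → pairWords N α m r nb a b (jCount N m r a b) ⊆ rowWords N α m r nb a bd := by
    intro bd
    induction bd with
    | zero => intro h; omega
    | succ bd ih =>
      intro hle x hx
      simp only [rowWords, List.mem_append]
      rcases Nat.lt_or_ge b (bd + 1) with hlt | hge
      · exact Or.inl (ih (by omega) hx)
      · have : b = bd + 1 := by omega
        subst this; exact Or.inr hx
  have hgiant : ∀ ad, a ≤ ad → rowWords N α m r nb a (r / a) ⊆ giantWords N α m r nb ad := by
    intro ad
    induction ad with
    | zero => intro h; omega
    | succ ad ih =>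
      intro hle x hx
      simp only [giantWords, List.mem_append]
      rcases Nat.lt_or_ge a (ad + 1) with hlt | hge
      · exact Or.inl (ih (by omega) hx)
      · have : a = ad + 1 := by omega
        subst this; exact Or.inr hx
  have hbd : b ≤ r / a := (Nat.le_div_iff_mul_le (by omega)).2 (by rw [mul_comm]; exact habr)
  have har : a ≤ r := le_trans (Nat.le_mul_of_pos_right _ (by omega)) habr
  exact hgiant r har (hrow (r / a) hbd hpw)

/-- The payload of a word. [folklore] -/
theorem payloadOf_mkWord {nb v : ℕ} (hv : (encodeNat v).length ≤ nb) (tag : Bool) (pl : List Bool) : payloadOf nb (mkWord nb v tag pl) = pl :=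
  (mkWord_split hv tag pl).2.2.1

/-- **Completeness of Algorithm 2** (the factor-finding half of Harvey's Prop. 4.2 = arXiv
Prop. 15, for the inverse-free variant run by the machine): if `N = pq` with primes `p < q`,
`r < p`, `N ≤ r p²` (i.e. `(N/r)^{1/2} ≤ p`), `α` a unit with `ord_p(α) ≥ m`, then Algorithm 2
reports a factor.  Deviation from the printed statement: the paper assumes only `α ∈ ℤ_N^*` with
`ord_N(α) ≥ m` and `(N/r)^{1/2} ≤ p < N^{1/2}`; this theorem is proved under the stronger
hypotheses `r < p` (automatic for the parameters of Algorithm 3, where `r ≈ N^{1/5} < N^{2/5} < p`)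
and `ord_p(α) ≥ m` (the order modulo `p`, which implies the paper's form modulo `N`; the machine's
order search certifies exactly this) — the paper's remaining case `ord_p(α) < m ≤ ord_N(α)`, settled
there by the gcd hit of Step 1, is not covered by this theorem.
[cite: Harvey2021, Prop. 4.2 (arXiv Prop. 15)] -/
theorem a2Out_complete {N α m r p q : ℕ} (hp : p.Prime) (hq : q.Prime) (hpq : p < q) (hN : N = p * q) (hNodd : Odd N)
    (hr1 : 1 ≤ r) (hrp : r < p) (hm1 : 1 ≤ m) (hlow : N ≤ r * (p * p)) (hcop : Nat.Coprime α N)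
    (hordp : ∀ i, 1 ≤ i → i < m → (α : ZMod p) ^ i ≠ 1) : a2Out N α m r ≠ none := by
  have hp2 : 2 ≤ p := hp.two_le
  have hq2 : 2 ≤ q := hq.two_le
  have hN1 : 1 < N := by rw [hN]; nlinarith
  have hN0 : 0 < N := by omega
  haveI : Fact p.Prime := ⟨hp⟩
  have hpN : p ∣ N := ⟨q, hN⟩
  have hmN : m ≤ N := by
    -- `ord_p(α) ≥ m` forces `m ≤ p − 1 < N`
    by_contra hmN'
    have hfermat : (α : ZMod p) ^ (p - 1) = 1 := by
      have hα0' : (α : ZMod p) ≠ 0 := by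
        intro h0; rw [ZMod.natCast_eq_zero_iff] at h0
        exact hp.one_lt.ne' (Nat.Coprime.eq_one_of_dvd (Nat.Coprime.coprime_dvd_right hpN hcop).symm h0)
      exact ZMod.pow_card_sub_one_eq_one hα0'
    have hpN' : p ≤ N := Nat.le_of_dvd hN0 hpN
    exact hordp (p - 1) (by omega) (by omega) hfermat
  -- `α ≠ 0 (mod p)`
  have hα0 : (α : ZMod p) ≠ 0 := by
    intro h0; rw [ZMod.natCast_eq_zero_iff] at h0
    exact hp.one_lt.ne' (Nat.Coprime.eq_one_of_dvd (Nat.Coprime.coprime_dvd_right hpN hcop).symm h0)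
  unfold a2Out
  rcases hfh : firstHit (powHit N α) (m - 1) with _ | i₁
  swap
  · simp
  simp only
  -- the witness of Lemma 12 / Prop. 15
  have hlowR : Real.sqrt (N / r) ≤ p := by
    rw [Real.sqrt_le_left (by positivity), div_le_iff₀ (by exact_mod_cast (show (0 : ℕ) < r by omega))]
    exact_mod_cast (show N ≤ p ^ 2 * r by nlinarith)
  have hupR : (p : ℝ) < Real.sqrt N := by
    rw [Real.lt_sqrt (by positivity)]
    exact_mod_cast (show p ^ 2 < N by nlinarith)
  obtain ⟨a₀, b₀, i₀, j₀, ha₀, hb₀, habr, hi₀, hj₀, hcu, hcN, hu₀, hcong⟩ :=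
    prop42_witness (p := p) (N := N) (q := q) (r := r) (m := m) (by omega) (by omega) (by omega) hN hlowR hupR hα0
  have hceil : ⌈Real.sqrt (4 * (a₀ * b₀) * N)⌉₊ = ceilSqrt (4 * a₀ * b₀ * N) := by
    rw [ceilSqrt_eq_ceil]; push_cast; ring_nf
  rw [hceil] at hcu hcN hu₀ hcong
  have ha₀p : a₀ < p := by nlinarith
  have hb₀q : b₀ < q := by nlinarith
  -- the giant step of the witness
  have hjJ : j₀ < jCount N m r a₀ b₀ := lt_jCount_of_real hr1 hm1 (by nlinarith) hj₀
  have hJJ : jCount N m r a₀ b₀ ≤ a2JStar N m r := jCount_le_JStar ha₀ hb₀ hr1 hm1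
  set nb := (encodeNat N).length with hnb0
  set C := a2C N α m r with hC0
  set jj₀ := jCount N m r a₀ b₀ - 1 - j₀ with hjj0
  set vw := gVal N α m r a₀ b₀ jj₀ with hv0
  have hvwN : vw < N := gVal_lt hN0 jj₀
  have hlvw : (encodeNat vw).length ≤ nb := len_le_nb rfl hvwN
  set g₀ := mkWord nb vw true (gPayload a₀ b₀ j₀) with hg0
  have hjeq : jCount N m r a₀ b₀ - 1 - jj₀ = j₀ := by omega
  have hg₀mem : g₀ ∈ a2Words N α m r := by
    have := mem_giantWords (N := N) (α := α) (m := m) (nb := nb) ha₀ hb₀ habr (show jj₀ < jCount N m r a₀ b₀ by omega)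
    rw [hjeq] at this
    exact List.mem_append_right _ this
  have htg₀ : tagOf nb g₀ = true := tagOf_mkWord hlvw _ _
  have hkg₀ : keyOf nb g₀ = vw := keyOf_mkWord hlvw _ _
  have hplg₀ : payloadOf nb g₀ = gPayload a₀ b₀ j₀ := payloadOf_mkWord hlvw _ _
  -- the congruence `vw ≡ C α^{i₀} (mod p)`
  have hcongr : (C : ZMod p) * (α : ZMod p) ^ i₀ = (vw : ZMod p) := by
    rw [hC0, a2C_cast hpN, hv0, gVal_cast hpN]
    have e1 : a2JStar N m r - jCount N m r a₀ b₀ + 1 + jj₀ = a2JStar N m r - j₀ := by omega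
    rw [e1]
    have e2 : (α : ZMod p) ^ (a2JStar N m r * m) = (α : ZMod p) ^ ((a2JStar N m r - j₀) * m) * (α : ZMod p) ^ (j₀ * m) := by
      rw [← pow_add]; congr 1
      have : j₀ ≤ a2JStar N m r := by omega
      calc a2JStar N m r * m = ((a2JStar N m r - j₀) + j₀) * m := by rw [Nat.sub_add_cancel this]
        _ = (a2JStar N m r - j₀) * m + j₀ * m := by ring
    have e3 : (α : ZMod p) ^ (j₀ * m) * (α : ZMod p) ^ i₀ = (α : ZMod p) ^ tExp N a₀ b₀ := by
      rw [hcong, ← mul_assoc, mul_inv_cancel₀ (pow_ne_zero _ hα0), one_mul]; rfl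
    rw [e2, mul_assoc, e3]; ring
  -- the recovery succeeds on the witness
  have hrec : recoverSpec N m i₀ a₀ b₀ j₀ ≠ none := recoverSpec_isSome hp hq hN ha₀ ha₀p hb₀ hb₀q hu₀
  -- the sorted words, split at `g₀`
  obtain ⟨hsort, hstab⟩ := a2Sorted_facts (α := α) hN1 hr1 hm1
  have hg₀sw : g₀ ∈ radixIter (a2Words N α m r) nb := (radixIter_perm _ _).symm.subset hg₀mem
  obtain ⟨l, l', hsw⟩ := List.append_of_mem hg₀sw
  rw [hsw] at hsort hstab
  have hres : a2Res N α m r = scanRun N m nb ScanSt.init (l ++ g₀ :: l') := by rw [a2Res, ← hnb0, hsw]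
  -- the values of the scan are residues
  have hacc : ∀ v ∈ (a2Res N α m r).acc, v < N := by
    obtain ⟨-, -, h3⟩ := scanRun_good (r := r) rfl hmN (radixIter (a2Words N α m r) (encodeNat N).length)
      (fun w hw => a2Words_good hN1 hr1 hm1 w ((radixIter_perm _ _).subset hw)) (radixIter (a2Words N α m r) (encodeNat N).length).length
    rw [List.take_length] at h3; exact h3
  -- a baby-step word among the words is of the form `mkWord nb (bval i) false (enc i)`
  have hbabyOf : ∀ b ∈ l ++ g₀ :: l', tagOf nb b = false → ∃ i, i < m ∧ b = mkWord nb (bval N α C i) false (encodeNat i) := fun b hb hbt => by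
    have hbmem : b ∈ a2Words N α m r := (radixIter_perm _ _).subset (by rw [hsw]; exact hb)
    rcases tagOf_of_mem_a2Words (α := α) hN1 hr1 hm1 hbmem with ⟨-, hbb⟩ | ⟨ht', -⟩
    · exact mem_babyWords.1 hbb
    · rw [hbt] at ht'; exact absurd ht' (by simp)
  unfold a2FinOut
  rcases hfd : (a2Res N α m r).found with _ | g
  swap
  · simp
  simp only
  by_cases hbaby : ∃ i, i < m ∧ bval N α C i = vw
  · -- `g₀` is matched, against the baby step `i₀`: the recovery would have reported a factor
    exfalso
    obtain ⟨i, hi, hbv⟩ := hbaby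
    set B := mkWord nb vw false (encodeNat i) with hB0
    have hBmem : B ∈ a2Words N α m r := List.mem_append_left _ (mem_babyWords.2 ⟨i, hi, by rw [hbv]⟩)
    have hBsw : B ∈ l ++ g₀ :: l' := by rw [← hsw]; exact (radixIter_perm _ _).symm.subset hBmem
    have hBt : tagOf nb B = false := tagOf_mkWord hlvw _ _
    have hBw : B.take nb = g₀.take nb := by rw [hB0, hg0, take_mkWord hlvw, take_mkWord hlvw]
    obtain ⟨hM, b, hbl, hbt, hkb, hbeta⟩ := matched_of_baby hsort hstab htg₀ hBsw hBt hBw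
    obtain ⟨i', hi', hbE⟩ := hbabyOf b (List.mem_append_left _ hbl) hbt
    have hli' : (encodeNat (bval N α C i')).length ≤ nb := len_le_nb rfl (bval_lt hN0 i')
    have hkb' : keyOf nb b = bval N α C i' := by rw [hbE]; exact keyOf_mkWord hli' _ _
    have hbv' : bval N α C i' = vw := by rw [← hkb', hkb, hkg₀]
    -- `i' = i₀` by the order of `α` modulo `p`
    have hii : i' = i₀ := by
      apply pow_inj_of_order hα0 hordp hi' hi₀
      have h1 : (C : ZMod p) * (α : ZMod p) ^ i' = (C : ZMod p) * (α : ZMod p) ^ i₀ := by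
        rw [hcongr, ← bval_cast hpN, hbv']
      have hC : (C : ZMod p) ≠ 0 := by rw [hC0, a2C_cast hpN]; exact pow_ne_zero _ hα0
      exact mul_left_cancel₀ hC h1
    have hbeta' : bitsToNat (scanRun N m nb ScanSt.init l).beta = i₀ := by
      rw [hbeta, hbE, payloadOf_mkWord hli', bitsToNat_encodeNat, hii]
    have hfnd := found_isSome_of_matched (l' := l') htg₀ hM (by rw [hbeta', hplg₀, fieldsOf_gPayload]; exact hrec)
    rw [← hres, hfd] at hfnd
    exact hfnd rfl
  · -- `g₀` is unmatched: `vw` is handed to Algorithm 1, which finds the factor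
    have hu : ¬ Matched N m nb l g₀ := by
      rintro ⟨hhb, hkc⟩
      have hc := scanRun_cand N m nb l
      have hlb := lastBaby_spec nb l
      rcases hq' : lastBaby nb l with _ | b
      · rw [hq'] at hc; simp only at hc; rw [hc] at hhb; exact absurd hhb (by simp)
      · rw [hq'] at hc hlb; simp only at hc hlb
        obtain ⟨-, hcd, -⟩ := hc
        obtain ⟨l₁, l₂, hl, hbt, -⟩ := hlb
        have hbl : b ∈ l := by rw [hl]; simp
        obtain ⟨i', hi', hbE⟩ := hbabyOf b (List.mem_append_left _ hbl) hbt
        have hli' : (encodeNat (bval N α C i')).length ≤ nb := len_le_nb rfl (bval_lt hN0 i')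
        apply hbaby
        refine ⟨i', hi', ?_⟩
        rw [hkg₀, hcd] at hkc
        have : bitsToNat (b.take nb) = bval N α C i' := by rw [hbE]; exact keyOf_mkWord hli' _ _
        rw [← this, hkc]
    have hmem : vw ∈ (a2Res N α m r).acc := by
      rw [hres, ← hkg₀]; exact mem_acc_of_unmatched htg₀ hu
    have hne : (a2Res N α m r).acc ≠ [] := List.ne_nil_of_mem hmem
    rw [if_neg hne]
    -- Algorithm 1 on the padded values
    unfold a2SixOut
    simp only
    set acc := (a2Res N α m r).acc with hacc0
    set e := a2E acc.length with he0
    obtain ⟨hvs, hvN, hvor⟩ := a2Vals_facts hN0 hacc hne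
    rw [← he0] at hvs
    obtain ⟨b, hb, -, -, -⟩ := NegFFT.prodTreeH_spec hNodd hN1 (e := e) hvs
    have hhead : (NegFFT.prodTreeH N e (a2Vals acc)).headD [] = b := by rw [hb]; rfl
    rw [hhead]
    obtain ⟨hkm, hk1⟩ := a2K_facts (2 ^ e) m
    set k := a2K (2 ^ e) m with hk0
    intro h1
    obtain ⟨-, -, hx23⟩ := alg1Out_index_facts N α C m k e b (a2Vals acc)
    rcases hq2 : (alg1Out N α C m k e b (a2Vals acc)).2.1 with _ | i₂
    · -- "clear" contradicts the congruence of `vw`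
      have hvwvs : vw ∈ a2Vals acc := List.mem_append_left _ hmem
      exact alg1Out_clear hNodd hN1 hk1 hkm hvs hb h1 hq2 hp hpN hi₀ hvwvs hcongr
    · have h3 := alg1Out_hit_resolved hNodd hN1 hk1 hkm hcop hvs hvN hb h1 hq2
      rcases hq3 : (alg1Out N α C m k e b (a2Vals acc)).2.2 with _ | h₂
      · exact h3 hq3
      · obtain ⟨hi₂, hh₂, hexact⟩ := alg1Out_exact hN1 hvs hvN hq2 hq3
        have hvmem : (a2Vals acc).getD h₂ 0 ∈ a2Vals acc := by
          rw [List.getD_eq_getElem _ _ (by omega)]; exact List.getElem_mem _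
        rcases hvor _ hvmem with hvacc | hv0
        · -- an exact hit on a value of the list: that value would be a baby-step value
          have hbv : bval N α C i₂ = (a2Vals acc).getD h₂ 0 := by
            have h1' : ((bval N α C i₂ : ℕ) : ZMod N) = (((a2Vals acc).getD h₂ 0 : ℕ) : ZMod N) := by
              rw [bval_cast (dvd_refl N), hexact]
            rw [ZMod.natCast_eq_natCast_iff', Nat.mod_eq_of_lt (bval_lt hN0 _), Nat.mod_eq_of_lt (hacc _ hvacc)] at h1'
            exact h1'
          exact a2Res_acc_no_baby hN1 hr1 hm1 hvacc hi₂ hbv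
        · -- an exact hit on a padding zero: a unit would vanish
          rw [hv0, Nat.cast_zero] at hexact
          haveI : Fact (1 < N) := ⟨hN1⟩
          have hu1 : IsUnit ((C : ZMod N) * (α : ZMod N) ^ i₂) := by
            rw [hC0, a2C_cast (dvd_refl N)]
            exact (((ZMod.isUnit_iff_coprime _ _).2 hcop).pow _).mul (((ZMod.isUnit_iff_coprime _ _).2 hcop).pow _)
          rw [← hexact] at hu1
          exact not_isUnit_zero hu1

end AlgTwoMath

end Com

end Literature.Computability.Complexity
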